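import Literature.NumberTheory.LFunctions.MoebiusWalshResonanceWindow
import Literature.NumberTheory.LFunctions.MoebiusWalshBoxCriterion
import Literature.NumberTheory.LFunctions.MoebiusSumClassicalBound
import Literature.Computability.Complexity.MoebiusBoundedDepthWalshProofs
import HarnessLib

/-!
# Bourgain 2013, Theorem 1 (uniform Möbius–Walsh bound): the assembly layer — proved pieces

Topic `Literature/NumberTheory/LFunctions`; the layer between the type-II mean squares of
`MoebiusWalshResonance.lean` / `MoebiusWalshResonanceWindow.lean`, the type-I estimates of
`MoebiusWalshTypeIEstimate.lean`, the box criterion `MoebiusWalshBoxCriterion.lean`, Green's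
Proposition 1 and the classical Möbius sum bound, on the way to
`bourgain_moebius_walsh_uniform_holds` (J. Bourgain, *Möbius–Walsh correlation bounds and an
estimate of Mauduit and Rivat*, J. Anal. Math. **119** (2013) 147–163 = arXiv:1109.2784,
Theorem 1, (2.29)–(2.33), (3.10)) [Bourgain2013MoebiusWalsh]. Everything here is PROVED
(0 `sorry`); the only `def` is the explicit finset family `stepWindows`; no named fact.

Contents:
* the two easy branches of (3.10): `walshSum_empty_lt` (`A = ∅`, the tree's
  `abs_sum_moebius_le_mul_exp_neg_sqrt_log`) and `walshSum_lt_of_card_le` (small weight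
  `|A| ≤ c₁√n/(n^{1/10} + log n)`, Green's Proposition 1 = tree's `green_moebius_fourierWalsh_holds`);
* the window choice: the STEPPED family `stepWindows` (bottom, top, last middle and middles in
  steps of `ν`), `stepWindows_cover`, `card_stepWindows_le` (`≤ (K₂−K₁)/ν + 4` windows) and the
  pigeonhole `exists_mem_card_mul_le`;
* closed forms of the three resonance bounds with a lower bound `c₀` on the window count
  (`resBoundTop_split_le` for the top window, `resBoundTop_split4_le` — four-monomial expansion of the
  count, for the middle windows where `Q < N` is possible —, `resBoundBottom_split_le`, `eta_antitone`),
  the budget lemma `meanSquare_budget` and the box bound from a mean square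
  (`abs_boxSum_le_of_meanSquare'`), the three families under explicit numeric conditions
  (`meanSquare_bottom_small`, `meanSquare_middle_small`, `meanSquare_top_small`), and the box
  bound with the window chosen by pigeonhole (`box_small_of_windows`, for a sub-digit-set
  `T' ⊆ T` living above `K₁`, coefficient `∑α² ≤ Dα` — used both for type-II boxes and for the
  top-heavy type-I boxes);
* the type-I inputs in monotone form (`typeI_box_crude_le`, `typeI_box_refined_le`,
  `sum_sq_typeICoeff_le`);
* quantitative constants `1/6 ≤ c₂` (`one_div_six_le_walshSupExponent`) and `2κ ≤ 8/9`
  (`two_mul_walshL1Exponent_le`), the Fejér errors in closed form (`fejerErrMid_le`,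
  `fejerErrTop_le`, with `s = 4s₄`, `t = 8s₄`), the exponent bookkeeping reducing the three
  resonance conditions to LINEAR inequalities among the exponents (`bottom_h4_of_exponents`,
  `middle4_h4_of_exponents` + `supTerm_le`, `top_h4_of_exponents`), and the box bound with the full parameter
  scheme `box_param` (`θ = 2^{-θ₀}`, `M₁ = W = 2^{i−E−2−a₀}`, `A = 2^{a₀}`): its hypotheses are
  linear inequalities in `i, j, ρ, E, a₀, s₄, e₀, x₀, c₀, θ₀, lg`, discharged for large `n` by
  the final assembly (next file).

## References

* J. Bourgain, J. Anal. Math. 119 (2013) 147–163 = arXiv:1109.2784, (2.29)–(2.33), (3.10). [Bourgain2013MoebiusWalsh]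
* B. Green, *On (not) computing the Möbius function using bounded depth circuits*, Combin.
  Probab. Comput. 21 (2012), Proposition 1. [Green2012]
-/

noncomputable section

open Finset Real ArithmeticFunction
open scoped ArithmeticFunction.Moebius

namespace Literature.NumberTheory.LFunctions.MoebiusWalshResonance

open Literature.NumberTheory.LFunctions.MoebiusWalshVaughan (natWalsh natWalsh_empty walshSum_eq_sum_Ico_natWalsh
  dyBlock mem_dyBlock boxSum typeICoeff typeIICoeffA typeIICoeffB)

/-! ### The empty digit set -/

/-- For `A = ∅` the Walsh sum is the plain Möbius sum `∑_{1 ≤ m < 2ⁿ} μ(m)`. [folklore] -/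
theorem walshSum_empty_eq (n : ℕ) :
    walshSum (fun m => (μ m : ℤ)) (∅ : Finset (Fin n)) = ∑ m ∈ Ioc 0 (2 ^ n - 1), (μ m : ℝ) := by
  rw [walshSum_eq_sum_Ico_natWalsh (fun m => (μ m : ℤ)) (by simp) ∅]
  have hIco : Ico 1 (2 ^ n) = Ioc 0 (2 ^ n - 1) := by
    ext m; simp only [mem_Ico, mem_Ioc]; have := Nat.one_le_two_pow (n := n); omega
  rw [hIco]
  refine Finset.sum_congr rfl fun m _ => ?_
  rw [Finset.map_empty, natWalsh_empty, mul_one]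

/-- **The case `A = ∅`**: `|∑_{m < 2ⁿ} μ(m)| < 2^{n − n^{1/10}}` for all large `n`.
[cite: Bourgain2013MoebiusWalsh, (3.10) (the term A = ∅, by the prime number theorem for μ)] -/
theorem walshSum_empty_lt :
    ∃ n₀ : ℕ, ∀ n : ℕ, n₀ ≤ n →
      |walshSum (fun m => (μ m : ℤ)) (∅ : Finset (Fin n))| < (2 : ℝ) ^ ((n : ℝ) - (n : ℝ) ^ ((1 : ℝ) / 10)) := by
  obtain ⟨c, hc, C, hC⟩ := abs_sum_moebius_le_mul_exp_neg_sqrt_log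
  -- choose `n₀` with `C e^{-c√((n-1) log 2)} · 2 < 2^{-n^{1/10}}`-type decay; we use a crude sufficient condition
  -- `log(max C 1) + 1 + n^{1/10} ≤ c √(n/2)` (note `(n-1) log 2 ≥ n/2 · ... ` for `n ≥ 4`)
  have hev : ∀ᶠ n : ℕ in Filter.atTop, Real.log (max C 1) + 1 + (n : ℝ) ^ ((1 : ℝ) / 10) ≤ c * Real.sqrt ((n : ℝ) / 4) := by
    -- `n^{1/10}` and constants are `o(√n)`
    have h1 : Filter.Tendsto (fun n : ℕ => c * Real.sqrt ((n : ℝ) / 4) - (n : ℝ) ^ ((1 : ℝ) / 10)) Filter.atTop Filter.atTop := by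
      have e : ∀ n : ℕ, c * Real.sqrt ((n : ℝ) / 4) - (n : ℝ) ^ ((1 : ℝ) / 10) =
          (n : ℝ) ^ ((1 : ℝ) / 10) * (c / 2 * (n : ℝ) ^ ((2 : ℝ) / 5) - 1) := by
        intro n
        have hn : (0 : ℝ) ≤ n := Nat.cast_nonneg n
        rw [Real.sqrt_eq_rpow, Real.div_rpow hn (by norm_num), show (4 : ℝ) ^ ((1 : ℝ) / 2) = 2 by
          rw [show (4 : ℝ) = 2 ^ (2 : ℝ) by norm_num, ← Real.rpow_mul (by norm_num)]; norm_num]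
        have : (n : ℝ) ^ ((1 : ℝ) / 2) = (n : ℝ) ^ ((1 : ℝ) / 10) * (n : ℝ) ^ ((2 : ℝ) / 5) := by
          rw [← Real.rpow_add' hn (by norm_num)]; norm_num
        rw [this]; ring
      simp_rw [e]
      refine Filter.Tendsto.atTop_mul_atTop₀ ?_ ?_
      · exact (tendsto_rpow_atTop (by norm_num)).comp tendsto_natCast_atTop_atTop
      · refine Filter.tendsto_atTop_add_const_right _ (-1) ?_
        refine Filter.Tendsto.const_mul_atTop (by positivity) ?_
        exact (tendsto_rpow_atTop (by norm_num)).comp tendsto_natCast_atTop_atTop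
    have h2 := h1.eventually_ge_atTop (Real.log (max C 1) + 1)
    filter_upwards [h2] with n hn
    linarith
  obtain ⟨n₁, hn₁⟩ := Filter.eventually_atTop.1 hev
  refine ⟨max n₁ 4, fun n hn => ?_⟩
  have hn4 : 4 ≤ n := le_of_max_le_right hn
  have hkey := hn₁ n (le_of_max_le_left hn)
  rw [walshSum_empty_eq]
  set x : ℝ := ((2 ^ n - 1 : ℕ) : ℝ) with hx
  have hx2 : (2 : ℝ) ≤ x := by
    rw [hx]
    have : 4 ≤ 2 ^ n := by
      calc 4 = 2 ^ 2 := by norm_num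
        _ ≤ 2 ^ n := Nat.pow_le_pow_right (by norm_num) (by omega)
    have : (3 : ℕ) ≤ 2 ^ n - 1 := by omega
    exact_mod_cast (show (2 : ℕ) ≤ 2 ^ n - 1 by omega)
  have hfloor : ⌊x⌋₊ = 2 ^ n - 1 := by rw [hx, Nat.floor_natCast]
  have h := hC x hx2
  rw [hfloor] at h
  refine lt_of_le_of_lt h ?_
  -- `C x e^{-c√log x} < 2^{n - n^{1/10}}`
  have hxle : x ≤ (2 : ℝ) ^ n := by
    rw [hx]; have : 2 ^ n - 1 ≤ 2 ^ n := Nat.sub_le _ _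
    exact_mod_cast this
  have hxpos : 0 < x := by linarith
  have hlogx : (n : ℝ) / 4 ≤ Real.log x := by
    -- `x ≥ 2^{n-1}` and `log 2 ≥ 1/2`
    have h1 : (2 : ℝ) ^ (n - 1) ≤ x := by
      rw [hx]
      have : 2 ^ (n - 1) ≤ 2 ^ n - 1 := by
        have := Nat.pow_le_pow_right (show 0 < 2 by norm_num) (show n - 1 ≤ n by omega)
        have h2 : 2 ^ n = 2 * 2 ^ (n - 1) := by rw [← pow_succ']; congr 1; omega
        omega
      exact_mod_cast this
    have h2 : Real.log ((2 : ℝ) ^ (n - 1)) ≤ Real.log x := Real.log_le_log (by positivity) h1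
    rw [Real.log_pow] at h2
    have h3 : (1 / 2 : ℝ) ≤ Real.log 2 := by
      have := Real.log_two_gt_d9; linarith
    have h4 : ((n - 1 : ℕ) : ℝ) * (1 / 2) ≤ ((n - 1 : ℕ) : ℝ) * Real.log 2 :=
      mul_le_mul_of_nonneg_left h3 (Nat.cast_nonneg _)
    have h5 : (n : ℝ) / 4 ≤ ((n - 1 : ℕ) : ℝ) * (1 / 2) := by
      rw [Nat.cast_sub (by omega)]; push_cast
      have : (4 : ℝ) ≤ n := by exact_mod_cast hn4
      linarith
    linarith
  have hsqrt : Real.sqrt ((n : ℝ) / 4) ≤ Real.sqrt (Real.log x) := Real.sqrt_le_sqrt hlogx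
  have hexp : Real.exp (-c * Real.sqrt (Real.log x)) ≤ Real.exp (-(Real.log (max C 1) + 1 + (n : ℝ) ^ ((1 : ℝ) / 10))) := by
    refine Real.exp_le_exp.2 ?_
    have := mul_le_mul_of_nonneg_left hsqrt hc.le
    linarith
  have hC1 : C ≤ max C 1 := le_max_left _ _
  have hmax : 0 < max C 1 := lt_of_lt_of_le zero_lt_one (le_max_right _ _)
  calc C * x * Real.exp (-c * Real.sqrt (Real.log x))
      ≤ max C 1 * (2 : ℝ) ^ n * Real.exp (-(Real.log (max C 1) + 1 + (n : ℝ) ^ ((1 : ℝ) / 10))) := by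
        have h0 : 0 ≤ Real.exp (-c * Real.sqrt (Real.log x)) := (Real.exp_pos _).le
        calc C * x * Real.exp (-c * Real.sqrt (Real.log x)) ≤ max C 1 * (2 : ℝ) ^ n * Real.exp (-c * Real.sqrt (Real.log x)) := by
              refine mul_le_mul_of_nonneg_right ?_ h0
              exact mul_le_mul hC1 hxle hxpos.le hmax.le
          _ ≤ _ := mul_le_mul_of_nonneg_left hexp (by positivity)
    _ = (2 : ℝ) ^ n * Real.exp (-1) * Real.exp (-(n : ℝ) ^ ((1 : ℝ) / 10)) := by
        rw [show -(Real.log (max C 1) + 1 + (n : ℝ) ^ ((1 : ℝ) / 10)) =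
          -Real.log (max C 1) + (-1) + (-(n : ℝ) ^ ((1 : ℝ) / 10)) by ring, Real.exp_add, Real.exp_add,
          Real.exp_neg, Real.exp_log hmax]
        field_simp
    _ < (2 : ℝ) ^ n * 1 * (2 : ℝ) ^ (-(n : ℝ) ^ ((1 : ℝ) / 10)) := by
        have h1 : Real.exp (-1) < 1 := by
          have := Real.exp_lt_exp.2 (show (-1 : ℝ) < 0 by norm_num); rwa [Real.exp_zero] at this
        have h2 : Real.exp (-(n : ℝ) ^ ((1 : ℝ) / 10)) ≤ (2 : ℝ) ^ (-(n : ℝ) ^ ((1 : ℝ) / 10)) := by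
          rw [Real.rpow_def_of_pos (by norm_num : (0 : ℝ) < 2), Real.exp_le_exp]
          have hl : Real.log 2 ≤ 1 := by have := Real.log_two_lt_d9; linarith
          have hp : 0 ≤ (n : ℝ) ^ ((1 : ℝ) / 10) := by positivity
          nlinarith
        have h3 : 0 < Real.exp (-(n : ℝ) ^ ((1 : ℝ) / 10)) := Real.exp_pos _
        have h4 : (0 : ℝ) < 2 ^ n := by positivity
        calc (2 : ℝ) ^ n * Real.exp (-1) * Real.exp (-(n : ℝ) ^ ((1 : ℝ) / 10))
            < (2 : ℝ) ^ n * 1 * Real.exp (-(n : ℝ) ^ ((1 : ℝ) / 10)) := by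
              refine mul_lt_mul_of_pos_right ?_ h3
              exact mul_lt_mul_of_pos_left h1 h4
          _ ≤ _ := mul_le_mul_of_nonneg_left h2 (by positivity)
    _ = (2 : ℝ) ^ ((n : ℝ) - (n : ℝ) ^ ((1 : ℝ) / 10)) := by
        rw [mul_one, sub_eq_add_neg, Real.rpow_add (by norm_num : (0 : ℝ) < 2), Real.rpow_natCast]

/-! ### Small weight: Green's estimate -/

/-- **Small weight** ((2.32) of Bourgain 2013, via Green 2012, Proposition 1): there is `c₁ > 0`
such that for all large `n` and every non-empty `S ⊆ [0,n)` with `|S| ≤ c₁ √n/(n^{1/10} + log n)`,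
`|∑_{m<2ⁿ} μ(m) w_S(m)| < 2^{n − n^{1/10}}`. [cite: Bourgain2013MoebiusWalsh, (2.32)] -/
theorem walshSum_lt_of_card_le :
    ∃ c₁ : ℝ, 0 < c₁ ∧ ∃ n₀ : ℕ, ∀ n : ℕ, n₀ ≤ n → ∀ S : Finset (Fin n), S.Nonempty →
      (S.card : ℝ) ≤ c₁ * Real.sqrt n / ((n : ℝ) ^ ((1 : ℝ) / 10) + Real.log n) →
        |walshSum (fun m => (μ m : ℤ)) S| < (2 : ℝ) ^ ((n : ℝ) - (n : ℝ) ^ ((1 : ℝ) / 10)) := by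
  obtain ⟨c, hc, K, hK⟩ := Literature.Computability.Complexity.green_moebius_fourierWalsh_holds
  refine ⟨c / 2, by positivity, ⌈max K 1⌉₊ + 1, fun n hn S hS hcard => ?_⟩
  have hn1 : 1 ≤ n := by omega
  have hnK : max K 1 < n := by
    have h1 := Nat.le_ceil (max K 1)
    have h2 : ((⌈max K 1⌉₊ : ℕ) : ℝ) + 1 ≤ n := by exact_mod_cast hn
    linarith
  have hnr : (1 : ℝ) ≤ n := by exact_mod_cast hn1
  have hn0 : (0 : ℝ) < n := by linarith
  set k : ℕ := S.card with hk
  have hk1 : 1 ≤ k := Finset.card_pos.2 hS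
  have hkr : (1 : ℝ) ≤ k := by exact_mod_cast hk1
  have hk0 : (0 : ℝ) < k := by linarith
  have hkn : (k : ℝ) ≤ n := by
    have : k ≤ n := by rw [hk]; exact (Finset.card_le_univ S).trans (by simp)
    exact_mod_cast this
  set D : ℝ := (n : ℝ) ^ ((1 : ℝ) / 10) + Real.log n with hD
  have hD1 : 1 ≤ D := by
    have h1 : (1 : ℝ) ≤ (n : ℝ) ^ ((1 : ℝ) / 10) := Real.one_le_rpow hnr (by norm_num)
    have h2 : 0 ≤ Real.log n := Real.log_nonneg hnr
    rw [hD]; linarith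
  have hD0 : 0 < D := by linarith
  -- from the cardinality hypothesis: `c √n / k ≥ 2 D`
  have hexpo : 2 * D ≤ c * Real.sqrt n / k := by
    rw [le_div_iff₀ hk0]
    have h1 : (k : ℝ) * D ≤ c / 2 * Real.sqrt n := by
      have := (le_div_iff₀ hD0).1 hcard; linarith
    nlinarith
  have hgreen := hK n hn1 S hS
  rw [div_le_iff₀ (by positivity : (0 : ℝ) < 2 ^ n)] at hgreen
  -- `exp(-c√n/k) ≤ exp(-2D) = exp(-2 n^{1/10}) / n²`
  have hexp : Real.exp (-(c * Real.sqrt n / S.card)) ≤ Real.exp (-2 * (n : ℝ) ^ ((1 : ℝ) / 10)) / (n : ℝ) ^ 2 := by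
    rw [← hk, le_div_iff₀ (by positivity), ← Real.exp_log (by positivity : (0 : ℝ) < (n : ℝ) ^ 2), ← Real.exp_add,
      Real.exp_le_exp, Real.log_pow]
    have : -(c * Real.sqrt n / k) ≤ -(2 * D) := by linarith
    rw [hD] at this; push_cast; linarith
  have hKle : K * S.card * Real.exp (-(c * Real.sqrt n / S.card)) ≤
      max K 1 * n * (Real.exp (-2 * (n : ℝ) ^ ((1 : ℝ) / 10)) / (n : ℝ) ^ 2) := by
    have h0 : 0 ≤ Real.exp (-(c * Real.sqrt n / S.card)) := (Real.exp_pos _).le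
    rw [← hk]
    calc K * k * Real.exp (-(c * Real.sqrt n / k)) ≤ max K 1 * n * Real.exp (-(c * Real.sqrt n / k)) := by
          refine mul_le_mul_of_nonneg_right ?_ h0
          exact mul_le_mul (le_max_left _ _) hkn hk0.le (le_trans zero_le_one (le_max_right _ _))
      _ ≤ _ := by
          rw [hk]
          exact mul_le_mul_of_nonneg_left hexp (by positivity)
  calc |walshSum (fun m => (μ m : ℤ)) S| ≤ K * S.card * Real.exp (-(c * Real.sqrt n / S.card)) * 2 ^ n := hgreen
    _ ≤ max K 1 * n * (Real.exp (-2 * (n : ℝ) ^ ((1 : ℝ) / 10)) / (n : ℝ) ^ 2) * 2 ^ n :=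
        mul_le_mul_of_nonneg_right hKle (by positivity)
    _ = (max K 1 / n) * Real.exp (-2 * (n : ℝ) ^ ((1 : ℝ) / 10)) * 2 ^ n := by
        field_simp
    _ < 1 * (2 : ℝ) ^ (-(n : ℝ) ^ ((1 : ℝ) / 10)) * 2 ^ n := by
        refine mul_lt_mul_of_pos_right ?_ (by positivity)
        have h1 : max K 1 / n < 1 := (div_lt_one hn0).2 hnK
        have h2 : Real.exp (-2 * (n : ℝ) ^ ((1 : ℝ) / 10)) ≤ (2 : ℝ) ^ (-(n : ℝ) ^ ((1 : ℝ) / 10)) := by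
          rw [Real.rpow_def_of_pos (by norm_num : (0 : ℝ) < 2), Real.exp_le_exp]
          have hl : Real.log 2 ≤ 2 := by have := Real.log_two_lt_d9; linarith
          have hp : 0 ≤ (n : ℝ) ^ ((1 : ℝ) / 10) := by positivity
          nlinarith
        have h3 : 0 < Real.exp (-2 * (n : ℝ) ^ ((1 : ℝ) / 10)) := Real.exp_pos _
        have h4 : 0 ≤ max K 1 / n := by positivity
        calc max K 1 / n * Real.exp (-2 * (n : ℝ) ^ ((1 : ℝ) / 10))
            < 1 * Real.exp (-2 * (n : ℝ) ^ ((1 : ℝ) / 10)) := mul_lt_mul_of_pos_right h1 h3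
          _ ≤ 1 * (2 : ℝ) ^ (-(n : ℝ) ^ ((1 : ℝ) / 10)) := mul_le_mul_of_nonneg_left h2 zero_le_one
    _ = (2 : ℝ) ^ ((n : ℝ) - (n : ℝ) ^ ((1 : ℝ) / 10)) := by
        rw [one_mul, sub_eq_add_neg, Real.rpow_add (by norm_num : (0 : ℝ) < 2), Real.rpow_natCast]; ring

/-! ### Choosing a digit window: pigeonhole -/

/-- **Pigeonhole over a covering family of windows**: if the finsets `ws` cover `T`, one of them
meets `T` in at least `|T|/|ws|` points. [folklore] -/
theorem exists_mem_card_mul_le {T : Finset ℕ} {ws : Finset (Finset ℕ)} (hne : ws.Nonempty)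
    (hcover : ∀ t ∈ T, ∃ w ∈ ws, t ∈ w) :
    ∃ w ∈ ws, T.card ≤ ws.card * (T ∩ w).card := by
  classical
  obtain ⟨w, hw, hmax⟩ := Finset.exists_max_image ws (fun w => (T ∩ w).card) hne
  refine ⟨w, hw, ?_⟩
  have hsub : T ⊆ ws.biUnion (fun w => T ∩ w) := by
    intro t ht
    obtain ⟨w', hw', htw'⟩ := hcover t ht
    exact Finset.mem_biUnion.2 ⟨w', hw', Finset.mem_inter.2 ⟨ht, htw'⟩⟩
  calc T.card ≤ (ws.biUnion (fun w => T ∩ w)).card := Finset.card_le_card hsub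
    _ ≤ ∑ w' ∈ ws, (T ∩ w').card := Finset.card_biUnion_le
    _ ≤ ∑ _w' ∈ ws, (T ∩ w).card := Finset.sum_le_sum fun w' hw' => hmax w' hw'
    _ = ws.card * (T ∩ w).card := by rw [Finset.sum_const, smul_eq_mul]

/-- The STEPPED family of digit windows: the bottom window `[0, ν)`, the top window `[K_t, Λ)`,
the last middle window `[K₂, K₂+ν)` and the middle windows `[K₁ + qν, K₁ + qν + ν)`,
`q ≤ (K₂ − K₁)/ν`. [cite: Bourgain2013MoebiusWalsh, §2 (choice of K)] -/
def stepWindows (ν K₁ K₂ Kt Lm : ℕ) : Finset (Finset ℕ) :=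
  {range ν, Ico Kt Lm, Ico K₂ (K₂ + ν)} ∪
    (range ((K₂ - K₁) / ν + 1)).image (fun q => Ico (K₁ + q * ν) (K₁ + q * ν + ν))

/-- **The stepped windows cover**: for `0 < ν` and `K_t ≤ K₂ + ν`, every `t < Λ` with
`t < ν ∨ K₁ ≤ t` lies in a window of the family. [cite: Bourgain2013MoebiusWalsh, §2 (choice of K)] -/
theorem stepWindows_cover {ν K₁ K₂ Kt Lm t : ℕ} (hν : 0 < ν) (hKt : Kt ≤ K₂ + ν)
    (ht : t < Lm) (hlow : t < ν ∨ K₁ ≤ t) :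
    ∃ w ∈ stepWindows ν K₁ K₂ Kt Lm, t ∈ w := by
  classical
  unfold stepWindows
  by_cases h1 : t < ν
  · exact ⟨range ν, by simp, mem_range.2 h1⟩
  by_cases h2 : Kt ≤ t
  · exact ⟨Ico Kt Lm, by simp, Finset.mem_Ico.2 ⟨h2, ht⟩⟩
  by_cases h3 : K₂ ≤ t
  · exact ⟨Ico K₂ (K₂ + ν), by simp, Finset.mem_Ico.2 ⟨h3, by omega⟩⟩
  · -- a stepped middle window
    have hK₁t : K₁ ≤ t := by
      rcases hlow with h | h
      · exact absurd h h1
      · exact h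
    set q := (t - K₁) / ν with hq
    refine ⟨Ico (K₁ + q * ν) (K₁ + q * ν + ν), ?_, ?_⟩
    · refine Finset.mem_union_right _ (Finset.mem_image.2 ⟨q, mem_range.2 ?_, rfl⟩)
      rw [Nat.lt_succ_iff, hq]
      exact Nat.div_le_div_right (by omega)
    · rw [Finset.mem_Ico]
      have h4 := Nat.div_mul_le_self (t - K₁) ν
      have h5 := Nat.lt_div_mul_add (a := t - K₁) hν
      rw [← hq] at h4 h5
      constructor <;> omega

/-- The stepped family has at most `(K₂ − K₁)/ν + 4` windows. [folklore] -/
theorem card_stepWindows_le (ν K₁ K₂ Kt Lm : ℕ) :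
    (stepWindows ν K₁ K₂ Kt Lm).card ≤ (K₂ - K₁) / ν + 4 := by
  classical
  unfold stepWindows
  calc _ ≤ ({range ν, Ico Kt Lm, Ico K₂ (K₂ + ν)} : Finset (Finset ℕ)).card +
        ((range ((K₂ - K₁) / ν + 1)).image (fun q => Ico (K₁ + q * ν) (K₁ + q * ν + ν))).card :=
        Finset.card_union_le _ _
    _ ≤ 3 + ((K₂ - K₁) / ν + 1) := by
        refine add_le_add Finset.card_le_three ?_
        exact Finset.card_image_le.trans (by rw [Finset.card_range])
    _ = _ := by omega

/-- A middle window of the stepped family has `K₁ ≤ K ≤ K₂` (when `K₁ ≤ K₂`). [folklore] -/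
theorem stepWindows_middle_mem {ν K₁ K₂ q : ℕ} (hK : K₁ ≤ K₂) (hq : q ∈ range ((K₂ - K₁) / ν + 1)) :
    K₁ + q * ν ∈ Icc K₁ K₂ := by
  rw [Finset.mem_Icc]
  have hq' : q ≤ (K₂ - K₁) / ν := Nat.lt_succ_iff.mp (mem_range.mp hq)
  have : q * ν ≤ K₂ - K₁ := (Nat.mul_le_mul_right ν hq').trans (Nat.div_mul_le_self _ _)
  constructor <;> omega

/-! ### Monotonicity of the sup-norm saving in the window count -/

open Literature.NumberTheory.LFunctions.MoebiusWalsh (walshSupExponent) in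
/-- `η = 2·2^{-c₂ c}` decreases with `c`. [folklore] -/
theorem eta_antitone {c₀ c : ℕ} (h : c₀ ≤ c) :
    2 * (2 : ℝ) ^ (-(walshSupExponent * c)) ≤ 2 * (2 : ℝ) ^ (-(walshSupExponent * c₀)) := by
  refine mul_le_mul_of_nonneg_left (Real.rpow_le_rpow_of_exponent_le (by norm_num) ?_) (by norm_num)
  have hc2 : 0 ≤ walshSupExponent := by
    unfold walshSupExponent
    exact div_nonneg (Real.logb_nonneg (by norm_num) (by norm_num)) (by norm_num)
  have : (c₀ : ℝ) ≤ c := by exact_mod_cast h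
  nlinarith

/-! ### Simplifying the resonance bounds: the top window -/

open Literature.NumberTheory.LFunctions.MoebiusWalsh (walshSupExponent walshL1Exponent walshL1Exponent_pos)

/-- `resSumBound` is monotone in the threshold. [folklore] -/
theorem resSumBound_mono (V L : ℕ) {P Cint κ τ τ' : ℝ} (hP : 0 ≤ P) (hC : 0 ≤ Cint) (hκ : 0 ≤ κ)
    (hτ : 0 ≤ τ) (h : τ ≤ τ') : resSumBound V L P Cint κ τ ≤ resSumBound V L P Cint κ τ' := by
  unfold resSumBound
  refine mul_le_mul_of_nonneg_left (mul_le_mul_of_nonneg_left ?_ hC) (by positivity)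
  exact Real.rpow_le_rpow (by positivity) (by nlinarith) hκ

/-- **The resonance bound of the top window in closed form** (general `E₁`, split of the blocks
at `e₀ ≤ E₁`): for `e < e₀` the sup route (`count ≤ N`, `min(RS, η₁) ≤ RS(τ_{e₀})`, block sum
`≤ 2·2^{e₀}η`), for `e₀ ≤ e < E₁` the Lemma-6 route with the honest decay `2^{-e(1-2κ)}`:
if `2^{E₁} N ≤ 2Q`, `2δP + 1 ≤ (8NP/Q) 2^{e₀}` and `2^{E₁} ≤ 2δQ`, then each such block is
`≤ 32 δQ · (2VL/P + 2) C_int² (16NP/Q)^κ (2^{e₀})^{2κ-1}`. [cite: Bourgain2013MoebiusWalsh, (2.23)–(2.27)] -/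
theorem resBoundTop_split_le (ν t cT N L E₁ K e₀ c₀ : ℕ) (hc₀ : c₀ ≤ cT) {M₁ : ℝ} (hM₁ : 0 < M₁) (he₀ : e₀ ≤ E₁)
    (hE₁ : (2 : ℝ) ^ E₁ * N ≤ 2 * (2 : ℝ) ^ (K + ν))
    (hA : 2 * (1 / M₁) * ((2 : ℝ) ^ (K + ν) / (2 ^ K : ℕ)) + 1 ≤
      (8 * N * ((2 : ℝ) ^ (K + ν) / (2 ^ K : ℕ)) / (2 : ℝ) ^ (K + ν)) * 2 ^ e₀)
    (hB : (2 : ℝ) ^ E₁ ≤ 2 * (1 / M₁) * (2 : ℝ) ^ (K + ν)) :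
    resBoundTop ν t cT N L E₁ K M₁ ≤
      N * (2 * (2 : ℝ) ^ (-(walshSupExponent * c₀))) *
          resSumBound (2 ^ (ν + t)) L ((2 : ℝ) ^ (K + ν) / (2 ^ K : ℕ)) (2 ^ (t + 4)) walshL1Exponent (1 / M₁) +
        (2 ^ (t + 3) * (2 : ℝ) ^ (walshL1Exponent * ν)) ^ 2 *
          (((N : ℝ) * (2 * (2 ^ (ν + t) : ℕ)) / (2 : ℝ) ^ (K + ν) + 2) *
            (2 * (1 / M₁) * (2 : ℝ) ^ (K + ν) / 2 ^ E₁ + 1)) +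
        ((e₀ : ℝ) * ((N : ℝ) *
            resSumBound (2 ^ (ν + t)) L ((2 : ℝ) ^ (K + ν) / (2 ^ K : ℕ)) (2 ^ (t + 4)) walshL1Exponent
              (1 / M₁ + 2 ^ (e₀ + 1) * ((N + N : ℕ) : ℝ) / (2 : ℝ) ^ (K + ν)) *
            (2 * 2 ^ e₀ * (2 * (2 : ℝ) ^ (-(walshSupExponent * c₀))))) +
          ((E₁ : ℝ) * (32 * ((1 / M₁) * (2 : ℝ) ^ (K + ν)) *
            ((2 * (2 ^ (ν + t) : ℕ) * L / ((2 : ℝ) ^ (K + ν) / (2 ^ K : ℕ)) + 2) * (2 : ℝ) ^ (t + 4)) *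
            (2 : ℝ) ^ (t + 4) * (16 * N * ((2 : ℝ) ^ (K + ν) / (2 ^ K : ℕ)) / (2 : ℝ) ^ (K + ν)) ^ walshL1Exponent *
            ((2 : ℝ) ^ e₀) ^ (2 * walshL1Exponent - 1)))) := by
  have hκ0 : 0 ≤ walshL1Exponent := walshL1Exponent_pos.le
  have hκ1 : 2 * walshL1Exponent - 1 ≤ 0 := by
    have := Literature.NumberTheory.LFunctions.MoebiusWalsh.walshL1Exponent_lt_half; linarith
  set Q : ℝ := (2 : ℝ) ^ (K + ν) with hQ
  set P : ℝ := Q / (2 ^ K : ℕ) with hPdef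
  set δ : ℝ := 1 / M₁ with hδ
  set V : ℕ := 2 ^ (ν + t) with hV
  set Cint : ℝ := (2 : ℝ) ^ (t + 4) with hCint
  set η : ℝ := 2 * (2 : ℝ) ^ (-(walshSupExponent * cT)) with hη
  set η₀ : ℝ := 2 * (2 : ℝ) ^ (-(walshSupExponent * c₀)) with hη₀
  have hηη₀ : η ≤ η₀ := eta_antitone hc₀
  set η₁ : ℝ := 2 ^ (t + 3) * (2 : ℝ) ^ (walshL1Exponent * ν) with hη₁
  have hQ0 : 0 < Q := by positivity
  have hP0 : 0 < P := by positivity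
  have hδ0 : 0 < δ := by positivity
  have hη0 : 0 ≤ η := by positivity
  have hη₁0 : 0 ≤ η₁ := by positivity
  set τ : ℕ → ℝ := fun e => δ + 2 ^ (e + 1) * ((N + N : ℕ) : ℝ) / Q with hτ
  have hτ0 : ∀ e, 0 ≤ τ e := fun e => by simp only [hτ]; positivity
  have hτmono : ∀ e e', e ≤ e' → τ e ≤ τ e' := by
    intro e e' h
    simp only [hτ]
    have : (2 : ℝ) ^ (e + 1) ≤ 2 ^ (e' + 1) := pow_le_pow_right₀ (by norm_num) (by omega)
    have h2 : (2 : ℝ) ^ (e + 1) * ((N + N : ℕ) : ℝ) / Q ≤ 2 ^ (e' + 1) * ((N + N : ℕ) : ℝ) / Q :=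
      div_le_div_of_nonneg_right (mul_le_mul_of_nonneg_right this (by positivity)) hQ0.le
    linarith
  set RS : ℝ → ℝ := fun x => resSumBound V L P Cint walshL1Exponent x with hRS
  have hRS0 : ∀ x, 0 ≤ x → 0 ≤ RS x := fun x hx => by simp only [hRS]; unfold resSumBound; positivity
  have hη₀0 : 0 ≤ η₀ := by positivity
  unfold resBoundTop
  rw [← hQ, ← hPdef, ← hδ, ← hV, ← hCint, ← hη, ← hη₁]
  refine add_le_add (add_le_add ?_ le_rfl) ?_
  · exact mul_le_mul (mul_le_mul_of_nonneg_left hηη₀ (Nat.cast_nonneg N)) (min_le_left _ _)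
      (le_min (hRS0 _ hδ0.le) hη₁0) (by positivity)
  · -- split the blocks at `e₀`
    rw [← Finset.sum_range_add_sum_Ico _ he₀]
    refine add_le_add ?_ ?_
    · -- `e < e₀`: the sup route
      have hterm : ∀ e ∈ range e₀,
          min (N : ℝ) (((N : ℝ) * 2 ^ (e + 1) / Q + 2) * (2 * δ * Q / 2 ^ e + 1)) *
            min (RS (δ + 2 ^ (e + 1) * ((N + N : ℕ) : ℝ) / Q)) η₁ *
            min (2 * (Cint * ((2 ^ e : ℕ) : ℝ) ^ walshL1Exponent)) (2 * 2 ^ e * η) ≤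
            (N : ℝ) * RS (τ e₀) * (2 * 2 ^ e₀ * η₀) := by
        intro e he
        have hee : e ≤ e₀ := (mem_range.mp he).le
        have h1 : min (N : ℝ) (((N : ℝ) * 2 ^ (e + 1) / Q + 2) * (2 * δ * Q / 2 ^ e + 1)) ≤ N := min_le_left _ _
        have h2 : min (RS (δ + 2 ^ (e + 1) * ((N + N : ℕ) : ℝ) / Q)) η₁ ≤ RS (τ e₀) :=
          (min_le_left _ _).trans (resSumBound_mono V L hP0.le (by positivity) hκ0 (hτ0 e) (hτmono e e₀ hee))
        have h3 : min (2 * (Cint * ((2 ^ e : ℕ) : ℝ) ^ walshL1Exponent)) (2 * 2 ^ e * η) ≤ 2 * 2 ^ e₀ * η₀ := by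
          refine (min_le_right _ _).trans ?_
          have : (2 : ℝ) ^ e ≤ 2 ^ e₀ := pow_le_pow_right₀ (by norm_num) hee
          have h2e0 : (0 : ℝ) ≤ 2 ^ e₀ := by positivity
          calc 2 * (2 : ℝ) ^ e * η ≤ 2 * 2 ^ e₀ * η := by nlinarith
            _ ≤ 2 * 2 ^ e₀ * η₀ := mul_le_mul_of_nonneg_left hηη₀ (by positivity)
        have hm1 : 0 ≤ min (N : ℝ) (((N : ℝ) * 2 ^ (e + 1) / Q + 2) * (2 * δ * Q / 2 ^ e + 1)) :=
          le_min (Nat.cast_nonneg N) (by positivity)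
        have hm2 : 0 ≤ min (RS (δ + 2 ^ (e + 1) * ((N + N : ℕ) : ℝ) / Q)) η₁ := le_min (hRS0 _ (hτ0 e)) hη₁0
        have hm3 : 0 ≤ min (2 * (Cint * ((2 ^ e : ℕ) : ℝ) ^ walshL1Exponent)) (2 * 2 ^ e * η) :=
          le_min (by positivity) (by positivity)
        exact mul_le_mul (mul_le_mul h1 h2 hm2 (Nat.cast_nonneg N)) h3 hm3 (mul_nonneg (Nat.cast_nonneg N) (hRS0 _ (hτ0 e₀)))
      calc _ ≤ ∑ _e ∈ range e₀, (N : ℝ) * RS (τ e₀) * (2 * 2 ^ e₀ * η₀) := Finset.sum_le_sum hterm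
        _ = _ := by rw [Finset.sum_const, Finset.card_range, nsmul_eq_mul]
    · -- `e₀ ≤ e < E₁`: the Lemma-6 route with the decay in `e`
      set B₀ : ℝ := 8 * N * P / Q with hB₀
      have hB₀0 : 0 ≤ B₀ := by positivity
      set D : ℝ := 32 * (δ * Q) * ((2 * V * L / P + 2) * Cint) * Cint * (2 * B₀) ^ walshL1Exponent *
        ((2 : ℝ) ^ e₀) ^ (2 * walshL1Exponent - 1) with hD
      have hterm : ∀ e ∈ Finset.Ico e₀ E₁,
          min (N : ℝ) (((N : ℝ) * 2 ^ (e + 1) / Q + 2) * (2 * δ * Q / 2 ^ e + 1)) *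
            min (RS (δ + 2 ^ (e + 1) * ((N + N : ℕ) : ℝ) / Q)) η₁ *
            min (2 * (Cint * ((2 ^ e : ℕ) : ℝ) ^ walshL1Exponent)) (2 * 2 ^ e * η) ≤ D := by
        intro e he
        rw [Finset.mem_Ico] at he
        have h2e : (0 : ℝ) < 2 ^ e := by positivity
        have h2e₀ : (2 : ℝ) ^ e₀ ≤ 2 ^ e := pow_le_pow_right₀ (by norm_num) he.1
        -- the count
        have hcnt : min (N : ℝ) (((N : ℝ) * 2 ^ (e + 1) / Q + 2) * (2 * δ * Q / 2 ^ e + 1)) ≤ 4 * (4 * δ * Q / 2 ^ e) := by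
          refine (min_le_right _ _).trans ?_
          have h1 : (N : ℝ) * 2 ^ (e + 1) / Q ≤ 2 := by
            rw [div_le_iff₀ hQ0]
            have : (2 : ℝ) ^ (e + 1) ≤ 2 ^ E₁ := pow_le_pow_right₀ (by norm_num) he.2
            calc (N : ℝ) * 2 ^ (e + 1) ≤ N * 2 ^ E₁ := mul_le_mul_of_nonneg_left this (Nat.cast_nonneg N)
              _ = 2 ^ E₁ * N := mul_comm _ _
              _ ≤ 2 * Q := hE₁
          have h2 : 1 ≤ 2 * δ * Q / 2 ^ e := by
            rw [le_div_iff₀ h2e, one_mul]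
            have : (2 : ℝ) ^ e ≤ 2 ^ E₁ := pow_le_pow_right₀ (by norm_num) he.2.le
            linarith
          have h3 : 0 ≤ 2 * δ * Q / 2 ^ e := by positivity
          calc ((N : ℝ) * 2 ^ (e + 1) / Q + 2) * (2 * δ * Q / 2 ^ e + 1) ≤ 4 * (2 * δ * Q / 2 ^ e + 2 * δ * Q / 2 ^ e) :=
                mul_le_mul (by linarith) (by linarith) (by positivity) (by norm_num)
            _ = 4 * (4 * δ * Q / 2 ^ e) := by ring
        -- the restricted sum
        have hrs : min (RS (δ + 2 ^ (e + 1) * ((N + N : ℕ) : ℝ) / Q)) η₁ ≤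
            ((2 * V * L / P + 2) * Cint) * (2 * B₀ * 2 ^ e) ^ walshL1Exponent := by
          refine (min_le_left _ _).trans ?_
          simp only [hRS]; unfold resSumBound
          rw [show ((2 * (V : ℝ) * L / P + 2) * Cint) * (2 * B₀ * 2 ^ e) ^ walshL1Exponent =
            (2 * (V : ℝ) * L / P + 2) * (Cint * (2 * B₀ * 2 ^ e) ^ walshL1Exponent) by ring]
          refine mul_le_mul_of_nonneg_left (mul_le_mul_of_nonneg_left ?_ (by rw [hCint]; positivity)) (by positivity)
          refine Real.rpow_le_rpow (by positivity) ?_ hκ0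
          -- `2 τ_e P + 1 = (2δP + 1) + B₀ 2^e ≤ 2 B₀ 2^e`
          have e1 : 2 * (δ + 2 ^ (e + 1) * ((N + N : ℕ) : ℝ) / Q) * P + 1 = (2 * δ * P + 1) + B₀ * 2 ^ e := by
            rw [hB₀, Nat.cast_add, pow_succ]; field_simp; ring
          rw [e1]
          have hA' : 2 * δ * P + 1 ≤ B₀ * 2 ^ e₀ := by rw [hB₀]; exact hA
          have : B₀ * 2 ^ e₀ ≤ B₀ * 2 ^ e := mul_le_mul_of_nonneg_left h2e₀ hB₀0
          linarith
        -- the block sum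
        have hbl : min (2 * (Cint * ((2 ^ e : ℕ) : ℝ) ^ walshL1Exponent)) (2 * 2 ^ e * η) ≤
            2 * (Cint * ((2 : ℝ) ^ e) ^ walshL1Exponent) := by
          refine (min_le_left _ _).trans (le_of_eq ?_); push_cast; ring
        have hm1 : 0 ≤ min (N : ℝ) (((N : ℝ) * 2 ^ (e + 1) / Q + 2) * (2 * δ * Q / 2 ^ e + 1)) :=
          le_min (Nat.cast_nonneg N) (by positivity)
        have hm2 : 0 ≤ min (RS (δ + 2 ^ (e + 1) * ((N + N : ℕ) : ℝ) / Q)) η₁ := le_min (hRS0 _ (hτ0 e)) hη₁0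
        have hm3 : 0 ≤ min (2 * (Cint * ((2 ^ e : ℕ) : ℝ) ^ walshL1Exponent)) (2 * 2 ^ e * η) :=
          le_min (by positivity) (by positivity)
        calc _ ≤ (4 * (4 * δ * Q / 2 ^ e)) * (((2 * V * L / P + 2) * Cint) * (2 * B₀ * 2 ^ e) ^ walshL1Exponent) *
              (2 * (Cint * ((2 : ℝ) ^ e) ^ walshL1Exponent)) :=
              mul_le_mul (mul_le_mul hcnt hrs hm2 (by positivity)) hbl hm3 (by positivity)
          _ = 32 * (δ * Q) * ((2 * V * L / P + 2) * Cint) * Cint * ((2 * B₀) ^ walshL1Exponent *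
              (((2 : ℝ) ^ e) ^ walshL1Exponent * ((2 : ℝ) ^ e) ^ walshL1Exponent / 2 ^ e)) := by
              rw [Real.mul_rpow (by positivity) h2e.le]
              field_simp
              ring
          _ = 32 * (δ * Q) * ((2 * V * L / P + 2) * Cint) * Cint * (2 * B₀) ^ walshL1Exponent *
              ((2 : ℝ) ^ e) ^ (2 * walshL1Exponent - 1) := by
              have : ((2 : ℝ) ^ e) ^ walshL1Exponent * ((2 : ℝ) ^ e) ^ walshL1Exponent / 2 ^ e =
                  ((2 : ℝ) ^ e) ^ (2 * walshL1Exponent - 1) := by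
                rw [← Real.rpow_add h2e, Real.rpow_sub h2e, Real.rpow_one]; ring_nf
              rw [this]; ring
          _ ≤ D := by
              rw [hD]
              refine mul_le_mul_of_nonneg_left ?_ (by positivity)
              exact Real.rpow_le_rpow_of_nonpos (by positivity) h2e₀ hκ1
      calc _ ≤ ∑ _e ∈ Finset.Ico e₀ E₁, D := Finset.sum_le_sum hterm
        _ = ((E₁ - e₀ : ℕ) : ℝ) * D := by rw [Finset.sum_const, Nat.card_Ico, nsmul_eq_mul]
        _ ≤ (E₁ : ℝ) * D := by
            have hD0 : 0 ≤ D := by rw [hD]; positivity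
            exact mul_le_mul_of_nonneg_right (by exact_mod_cast Nat.sub_le E₁ e₀) hD0
        _ = _ := by rw [hD, hB₀]; ring


/-- **The resonance bound of a general window in closed form, four-monomial version** (split
of the blocks at `e₀ ≤ E₁`; for `e ≥ e₀` the count `(N2^{e+1}/Q + 2)(2δQ/2^e + 1)` is EXPANDED,
so that the cross term `4δN` keeps its `1/M₁` and the term `2δQ/2^e` keeps its decay in `e`;
only `2δP + 1 ≤ (8NP/Q)2^{e₀}` is assumed). For the middle windows, where `Q < N` is possible.
[cite: Bourgain2013MoebiusWalsh, (2.23)–(2.27)] -/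
theorem resBoundTop_split4_le (ν t cT N L E₁ K e₀ c₀ : ℕ) (hc₀ : c₀ ≤ cT) {M₁ : ℝ} (hM₁ : 0 < M₁) (he₀ : e₀ ≤ E₁)
    (hA : 2 * (1 / M₁) * ((2 : ℝ) ^ (K + ν) / (2 ^ K : ℕ)) + 1 ≤
      (8 * N * ((2 : ℝ) ^ (K + ν) / (2 ^ K : ℕ)) / (2 : ℝ) ^ (K + ν)) * 2 ^ e₀) :
    resBoundTop ν t cT N L E₁ K M₁ ≤
      N * (2 * (2 : ℝ) ^ (-(walshSupExponent * c₀))) *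
          resSumBound (2 ^ (ν + t)) L ((2 : ℝ) ^ (K + ν) / (2 ^ K : ℕ)) (2 ^ (t + 4)) walshL1Exponent (1 / M₁) +
        (2 ^ (t + 3) * (2 : ℝ) ^ (walshL1Exponent * ν)) ^ 2 *
          (((N : ℝ) * (2 * (2 ^ (ν + t) : ℕ)) / (2 : ℝ) ^ (K + ν) + 2) *
            (2 * (1 / M₁) * (2 : ℝ) ^ (K + ν) / 2 ^ E₁ + 1)) +
        ((e₀ : ℝ) * ((N : ℝ) *
            resSumBound (2 ^ (ν + t)) L ((2 : ℝ) ^ (K + ν) / (2 ^ K : ℕ)) (2 ^ (t + 4)) walshL1Exponent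
              (1 / M₁ + 2 ^ (e₀ + 1) * ((N + N : ℕ) : ℝ) / (2 : ℝ) ^ (K + ν)) *
            (2 * 2 ^ e₀ * (2 * (2 : ℝ) ^ (-(walshSupExponent * c₀))))) +
          ((E₁ : ℝ) * ((4 * (1 / M₁) * N + (N : ℝ) * 2 ^ E₁ / (2 : ℝ) ^ (K + ν) + 2) *
              (2 ^ (t + 3) * (2 : ℝ) ^ (walshL1Exponent * ν)) * (2 * ((2 : ℝ) ^ (t + 4) * ((2 : ℝ) ^ E₁) ^ walshL1Exponent)) +
            8 * ((1 / M₁) * (2 : ℝ) ^ (K + ν)) *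
            ((2 * (2 ^ (ν + t) : ℕ) * L / ((2 : ℝ) ^ (K + ν) / (2 ^ K : ℕ)) + 2) * (2 : ℝ) ^ (t + 4)) *
            (2 : ℝ) ^ (t + 4) * (16 * N * ((2 : ℝ) ^ (K + ν) / (2 ^ K : ℕ)) / (2 : ℝ) ^ (K + ν)) ^ walshL1Exponent *
            ((2 : ℝ) ^ e₀) ^ (2 * walshL1Exponent - 1)))) := by
  have hκ0 : 0 ≤ walshL1Exponent := walshL1Exponent_pos.le
  have hκ1 : 2 * walshL1Exponent - 1 ≤ 0 := by
    have := Literature.NumberTheory.LFunctions.MoebiusWalsh.walshL1Exponent_lt_half; linarith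
  set Q : ℝ := (2 : ℝ) ^ (K + ν) with hQ
  set P : ℝ := Q / (2 ^ K : ℕ) with hPdef
  set δ : ℝ := 1 / M₁ with hδ
  set V : ℕ := 2 ^ (ν + t) with hV
  set Cint : ℝ := (2 : ℝ) ^ (t + 4) with hCint
  set η : ℝ := 2 * (2 : ℝ) ^ (-(walshSupExponent * cT)) with hη
  set η₀ : ℝ := 2 * (2 : ℝ) ^ (-(walshSupExponent * c₀)) with hη₀
  have hηη₀ : η ≤ η₀ := eta_antitone hc₀
  set η₁ : ℝ := 2 ^ (t + 3) * (2 : ℝ) ^ (walshL1Exponent * ν) with hη₁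
  have hQ0 : 0 < Q := by positivity
  have hP0 : 0 < P := by positivity
  have hδ0 : 0 < δ := by positivity
  have hη0 : 0 ≤ η := by positivity
  have hη₁0 : 0 ≤ η₁ := by positivity
  set τ : ℕ → ℝ := fun e => δ + 2 ^ (e + 1) * ((N + N : ℕ) : ℝ) / Q with hτ
  have hτ0 : ∀ e, 0 ≤ τ e := fun e => by simp only [hτ]; positivity
  have hτmono : ∀ e e', e ≤ e' → τ e ≤ τ e' := by
    intro e e' h
    simp only [hτ]
    have : (2 : ℝ) ^ (e + 1) ≤ 2 ^ (e' + 1) := pow_le_pow_right₀ (by norm_num) (by omega)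
    have h2 : (2 : ℝ) ^ (e + 1) * ((N + N : ℕ) : ℝ) / Q ≤ 2 ^ (e' + 1) * ((N + N : ℕ) : ℝ) / Q :=
      div_le_div_of_nonneg_right (mul_le_mul_of_nonneg_right this (by positivity)) hQ0.le
    linarith
  set RS : ℝ → ℝ := fun x => resSumBound V L P Cint walshL1Exponent x with hRS
  have hRS0 : ∀ x, 0 ≤ x → 0 ≤ RS x := fun x hx => by simp only [hRS]; unfold resSumBound; positivity
  have hη₀0 : 0 ≤ η₀ := by positivity
  unfold resBoundTop
  rw [← hQ, ← hPdef, ← hδ, ← hV, ← hCint, ← hη, ← hη₁]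
  refine add_le_add (add_le_add ?_ le_rfl) ?_
  · exact mul_le_mul (mul_le_mul_of_nonneg_left hηη₀ (Nat.cast_nonneg N)) (min_le_left _ _)
      (le_min (hRS0 _ hδ0.le) hη₁0) (by positivity)
  · -- split the blocks at `e₀`
    rw [← Finset.sum_range_add_sum_Ico _ he₀]
    refine add_le_add ?_ ?_
    · -- `e < e₀`: the sup route
      have hterm : ∀ e ∈ range e₀,
          min (N : ℝ) (((N : ℝ) * 2 ^ (e + 1) / Q + 2) * (2 * δ * Q / 2 ^ e + 1)) *
            min (RS (δ + 2 ^ (e + 1) * ((N + N : ℕ) : ℝ) / Q)) η₁ *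
            min (2 * (Cint * ((2 ^ e : ℕ) : ℝ) ^ walshL1Exponent)) (2 * 2 ^ e * η) ≤
            (N : ℝ) * RS (τ e₀) * (2 * 2 ^ e₀ * η₀) := by
        intro e he
        have hee : e ≤ e₀ := (mem_range.mp he).le
        have h1 : min (N : ℝ) (((N : ℝ) * 2 ^ (e + 1) / Q + 2) * (2 * δ * Q / 2 ^ e + 1)) ≤ N := min_le_left _ _
        have h2 : min (RS (δ + 2 ^ (e + 1) * ((N + N : ℕ) : ℝ) / Q)) η₁ ≤ RS (τ e₀) :=
          (min_le_left _ _).trans (resSumBound_mono V L hP0.le (by positivity) hκ0 (hτ0 e) (hτmono e e₀ hee))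
        have h3 : min (2 * (Cint * ((2 ^ e : ℕ) : ℝ) ^ walshL1Exponent)) (2 * 2 ^ e * η) ≤ 2 * 2 ^ e₀ * η₀ := by
          refine (min_le_right _ _).trans ?_
          have : (2 : ℝ) ^ e ≤ 2 ^ e₀ := pow_le_pow_right₀ (by norm_num) hee
          have h2e0 : (0 : ℝ) ≤ 2 ^ e₀ := by positivity
          calc 2 * (2 : ℝ) ^ e * η ≤ 2 * 2 ^ e₀ * η := by nlinarith
            _ ≤ 2 * 2 ^ e₀ * η₀ := mul_le_mul_of_nonneg_left hηη₀ (by positivity)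
        have hm1 : 0 ≤ min (N : ℝ) (((N : ℝ) * 2 ^ (e + 1) / Q + 2) * (2 * δ * Q / 2 ^ e + 1)) :=
          le_min (Nat.cast_nonneg N) (by positivity)
        have hm2 : 0 ≤ min (RS (δ + 2 ^ (e + 1) * ((N + N : ℕ) : ℝ) / Q)) η₁ := le_min (hRS0 _ (hτ0 e)) hη₁0
        have hm3 : 0 ≤ min (2 * (Cint * ((2 ^ e : ℕ) : ℝ) ^ walshL1Exponent)) (2 * 2 ^ e * η) :=
          le_min (by positivity) (by positivity)
        exact mul_le_mul (mul_le_mul h1 h2 hm2 (Nat.cast_nonneg N)) h3 hm3 (mul_nonneg (Nat.cast_nonneg N) (hRS0 _ (hτ0 e₀)))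
      calc _ ≤ ∑ _e ∈ range e₀, (N : ℝ) * RS (τ e₀) * (2 * 2 ^ e₀ * η₀) := Finset.sum_le_sum hterm
        _ = _ := by rw [Finset.sum_const, Finset.card_range, nsmul_eq_mul]
    · -- `e₀ ≤ e < E₁`: the Lemma-6 route with the decay in `e`
      set B₀ : ℝ := 8 * N * P / Q with hB₀
      have hB₀0 : 0 ≤ B₀ := by positivity
      set BL₁ : ℝ := 2 * (Cint * ((2 : ℝ) ^ E₁) ^ walshL1Exponent) with hBL₁
      have hBL₁0 : 0 ≤ BL₁ := by positivity
      set Afac : ℝ := 4 * δ * N + (N : ℝ) * 2 ^ E₁ / Q + 2 with hAfac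
      have hAfac0 : 0 ≤ Afac := by positivity
      set D₂ : ℝ := 8 * (δ * Q) * ((2 * V * L / P + 2) * Cint) * Cint * (2 * B₀) ^ walshL1Exponent *
        ((2 : ℝ) ^ e₀) ^ (2 * walshL1Exponent - 1) with hD₂
      set D : ℝ := Afac * η₁ * BL₁ + D₂ with hD
      have hterm : ∀ e ∈ Finset.Ico e₀ E₁,
          min (N : ℝ) (((N : ℝ) * 2 ^ (e + 1) / Q + 2) * (2 * δ * Q / 2 ^ e + 1)) *
            min (RS (δ + 2 ^ (e + 1) * ((N + N : ℕ) : ℝ) / Q)) η₁ *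
            min (2 * (Cint * ((2 ^ e : ℕ) : ℝ) ^ walshL1Exponent)) (2 * 2 ^ e * η) ≤ D := by
        intro e he
        rw [Finset.mem_Ico] at he
        have h2e : (0 : ℝ) < 2 ^ e := by positivity
        have h2e₀ : (2 : ℝ) ^ e₀ ≤ 2 ^ e := pow_le_pow_right₀ (by norm_num) he.1
        -- expand the count: `min(N, C_e) ≤ Afac + 2·(2δQ/2^e)`
        set bterm : ℝ := 2 * δ * Q / 2 ^ e with hbterm
        have hbterm0 : 0 ≤ bterm := by positivity
        have hcnt : min (N : ℝ) (((N : ℝ) * 2 ^ (e + 1) / Q + 2) * (2 * δ * Q / 2 ^ e + 1)) ≤ Afac + 2 * bterm := by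
          refine (min_le_right _ _).trans ?_
          have hcross : ((N : ℝ) * 2 ^ (e + 1) / Q) * bterm = 4 * δ * N := by
            rw [hbterm]; field_simp; ring
          have ha : (N : ℝ) * 2 ^ (e + 1) / Q ≤ (N : ℝ) * 2 ^ E₁ / Q := by
            have : (2 : ℝ) ^ (e + 1) ≤ 2 ^ E₁ := pow_le_pow_right₀ (by norm_num) he.2
            exact div_le_div_of_nonneg_right (mul_le_mul_of_nonneg_left this (Nat.cast_nonneg N)) hQ0.le
          have ha0 : 0 ≤ (N : ℝ) * 2 ^ (e + 1) / Q := by positivity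
          rw [hAfac, ← hbterm]
          nlinarith [hcross]
        -- the restricted sum by Lemma 6 (for the `bterm` part) and by the mass (for the `Afac` part)
        have hrsη : min (RS (δ + 2 ^ (e + 1) * ((N + N : ℕ) : ℝ) / Q)) η₁ ≤ η₁ := min_le_right _ _
        have hrs : min (RS (δ + 2 ^ (e + 1) * ((N + N : ℕ) : ℝ) / Q)) η₁ ≤
            ((2 * V * L / P + 2) * Cint) * (2 * B₀ * 2 ^ e) ^ walshL1Exponent := by
          refine (min_le_left _ _).trans ?_
          simp only [hRS]; unfold resSumBound
          rw [show ((2 * (V : ℝ) * L / P + 2) * Cint) * (2 * B₀ * 2 ^ e) ^ walshL1Exponent =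
            (2 * (V : ℝ) * L / P + 2) * (Cint * (2 * B₀ * 2 ^ e) ^ walshL1Exponent) by ring]
          refine mul_le_mul_of_nonneg_left (mul_le_mul_of_nonneg_left ?_ (by rw [hCint]; positivity)) (by positivity)
          refine Real.rpow_le_rpow (by positivity) ?_ hκ0
          have e1 : 2 * (δ + 2 ^ (e + 1) * ((N + N : ℕ) : ℝ) / Q) * P + 1 = (2 * δ * P + 1) + B₀ * 2 ^ e := by
            rw [hB₀, Nat.cast_add, pow_succ]; field_simp; ring
          rw [e1]
          have hA' : 2 * δ * P + 1 ≤ B₀ * 2 ^ e₀ := by rw [hB₀]; exact hA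
          have : B₀ * 2 ^ e₀ ≤ B₀ * 2 ^ e := mul_le_mul_of_nonneg_left h2e₀ hB₀0
          linarith
        -- the block sums
        have hbl : min (2 * (Cint * ((2 ^ e : ℕ) : ℝ) ^ walshL1Exponent)) (2 * 2 ^ e * η) ≤
            2 * (Cint * ((2 : ℝ) ^ e) ^ walshL1Exponent) := by
          refine (min_le_left _ _).trans (le_of_eq ?_); push_cast; ring
        have hbl₁ : min (2 * (Cint * ((2 ^ e : ℕ) : ℝ) ^ walshL1Exponent)) (2 * 2 ^ e * η) ≤ BL₁ := by
          refine hbl.trans ?_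
          rw [hBL₁]
          refine mul_le_mul_of_nonneg_left (mul_le_mul_of_nonneg_left ?_ (by rw [hCint]; positivity)) (by norm_num)
          exact Real.rpow_le_rpow (by positivity) (pow_le_pow_right₀ (by norm_num) he.2.le) hκ0
        have hm2 : 0 ≤ min (RS (δ + 2 ^ (e + 1) * ((N + N : ℕ) : ℝ) / Q)) η₁ := le_min (hRS0 _ (hτ0 e)) hη₁0
        have hm3 : 0 ≤ min (2 * (Cint * ((2 ^ e : ℕ) : ℝ) ^ walshL1Exponent)) (2 * 2 ^ e * η) :=
          le_min (by positivity) (by positivity)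
        -- split the product along `Afac + 2 bterm`
        have hsplitp : (Afac + 2 * bterm) * min (RS (δ + 2 ^ (e + 1) * ((N + N : ℕ) : ℝ) / Q)) η₁ *
            min (2 * (Cint * ((2 ^ e : ℕ) : ℝ) ^ walshL1Exponent)) (2 * 2 ^ e * η) ≤ D := by
          have p1 : Afac * min (RS (δ + 2 ^ (e + 1) * ((N + N : ℕ) : ℝ) / Q)) η₁ *
              min (2 * (Cint * ((2 ^ e : ℕ) : ℝ) ^ walshL1Exponent)) (2 * 2 ^ e * η) ≤ Afac * η₁ * BL₁ :=
            mul_le_mul (mul_le_mul_of_nonneg_left hrsη hAfac0) hbl₁ hm3 (by positivity)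
          have p2 : (2 * bterm) * min (RS (δ + 2 ^ (e + 1) * ((N + N : ℕ) : ℝ) / Q)) η₁ *
              min (2 * (Cint * ((2 ^ e : ℕ) : ℝ) ^ walshL1Exponent)) (2 * 2 ^ e * η) ≤ D₂ := by
            calc _ ≤ (2 * bterm) * (((2 * V * L / P + 2) * Cint) * (2 * B₀ * 2 ^ e) ^ walshL1Exponent) *
                  (2 * (Cint * ((2 : ℝ) ^ e) ^ walshL1Exponent)) :=
                  mul_le_mul (mul_le_mul_of_nonneg_left hrs (by positivity)) hbl hm3 (by positivity)
              _ = 8 * (δ * Q) * ((2 * V * L / P + 2) * Cint) * Cint * ((2 * B₀) ^ walshL1Exponent *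
                  (((2 : ℝ) ^ e) ^ walshL1Exponent * ((2 : ℝ) ^ e) ^ walshL1Exponent / 2 ^ e)) := by
                  rw [hbterm, Real.mul_rpow (by positivity) h2e.le]
                  field_simp
                  ring
              _ = 8 * (δ * Q) * ((2 * V * L / P + 2) * Cint) * Cint * (2 * B₀) ^ walshL1Exponent *
                  ((2 : ℝ) ^ e) ^ (2 * walshL1Exponent - 1) := by
                  have : ((2 : ℝ) ^ e) ^ walshL1Exponent * ((2 : ℝ) ^ e) ^ walshL1Exponent / 2 ^ e =
                      ((2 : ℝ) ^ e) ^ (2 * walshL1Exponent - 1) := by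
                    rw [← Real.rpow_add h2e, Real.rpow_sub h2e, Real.rpow_one]; ring_nf
                  rw [this]; ring
              _ ≤ D₂ := by
                  rw [hD₂]
                  refine mul_le_mul_of_nonneg_left ?_ (by positivity)
                  exact Real.rpow_le_rpow_of_nonpos (by positivity) h2e₀ hκ1
          calc _ = Afac * min (RS (δ + 2 ^ (e + 1) * ((N + N : ℕ) : ℝ) / Q)) η₁ *
                min (2 * (Cint * ((2 ^ e : ℕ) : ℝ) ^ walshL1Exponent)) (2 * 2 ^ e * η) +
              (2 * bterm) * min (RS (δ + 2 ^ (e + 1) * ((N + N : ℕ) : ℝ) / Q)) η₁ *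
                min (2 * (Cint * ((2 ^ e : ℕ) : ℝ) ^ walshL1Exponent)) (2 * 2 ^ e * η) := by ring
            _ ≤ Afac * η₁ * BL₁ + D₂ := add_le_add p1 p2
            _ = D := by rw [hD]
        have hm1 : 0 ≤ min (N : ℝ) (((N : ℝ) * 2 ^ (e + 1) / Q + 2) * (2 * δ * Q / 2 ^ e + 1)) :=
          le_min (Nat.cast_nonneg N) (by positivity)
        calc _ ≤ (Afac + 2 * bterm) * min (RS (δ + 2 ^ (e + 1) * ((N + N : ℕ) : ℝ) / Q)) η₁ *
              min (2 * (Cint * ((2 ^ e : ℕ) : ℝ) ^ walshL1Exponent)) (2 * 2 ^ e * η) :=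
              mul_le_mul_of_nonneg_right (mul_le_mul_of_nonneg_right hcnt hm2) hm3
          _ ≤ D := hsplitp
      calc _ ≤ ∑ _e ∈ Finset.Ico e₀ E₁, D := Finset.sum_le_sum hterm
        _ = ((E₁ - e₀ : ℕ) : ℝ) * D := by rw [Finset.sum_const, Nat.card_Ico, nsmul_eq_mul]
        _ ≤ (E₁ : ℝ) * D := by
            have hD0 : 0 ≤ D := by rw [hD]; positivity
            exact mul_le_mul_of_nonneg_right (by exact_mod_cast Nat.sub_le E₁ e₀) hD0
        _ = _ := by rw [hD, hD₂, hAfac, hBL₁, hB₀]; ring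


/-! ### Simplifying the resonance bounds: the bottom window -/

/-- **The resonance bound of the bottom window in closed form** (split of the `2`-adic levels
`x = ν − r` at `x₀`): with `Λ = 2(2^ν/M₁ + L)`, `η = 2·2^{-c₂|A|}`,
`RES ≤ N η² Λ + ν·( (N/M₁ + 2^ν/M₁ + 1)·8Λ·2^{2κν} + 4NΛη·2^{κx₀} + 8NΛ·2^{(2κ-1)x₀} )`.
[cite: Bourgain2013MoebiusWalsh, (2.13)–(2.22)] -/
theorem resBoundBottom_split_le (ν cA N L x₀ c₀ : ℕ) (hc₀ : c₀ ≤ cA) {M₁ : ℝ} (hM₁ : 0 < M₁) :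
    resBoundBottom ν cA N L M₁ ≤
      N * (2 * (2 : ℝ) ^ (-(walshSupExponent * c₀))) ^ 2 * (2 * ((2 : ℝ) ^ ν / M₁ + L)) +
        (ν : ℝ) * (((N : ℝ) / M₁ + (2 : ℝ) ^ ν / M₁ + 1) * (8 * (2 * ((2 : ℝ) ^ ν / M₁ + L))) *
              (2 : ℝ) ^ (2 * walshL1Exponent * ν) +
            4 * N * (2 * ((2 : ℝ) ^ ν / M₁ + L)) * (2 * (2 : ℝ) ^ (-(walshSupExponent * c₀))) *
              (2 : ℝ) ^ (walshL1Exponent * x₀) +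
            8 * N * (2 * ((2 : ℝ) ^ ν / M₁ + L)) * (2 : ℝ) ^ ((2 * walshL1Exponent - 1) * x₀)) := by
  have hκ0 : 0 ≤ walshL1Exponent := walshL1Exponent_pos.le
  have hκ1 : 2 * walshL1Exponent - 1 ≤ 0 := by
    have := Literature.NumberTheory.LFunctions.MoebiusWalsh.walshL1Exponent_lt_half; linarith
  set Lam : ℝ := 2 * ((2 : ℝ) ^ ν / M₁ + L) with hLam
  set η : ℝ := 2 * (2 : ℝ) ^ (-(walshSupExponent * cA)) with hη
  set η₀ : ℝ := 2 * (2 : ℝ) ^ (-(walshSupExponent * c₀)) with hη₀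
  have hηη₀ : η ≤ η₀ := eta_antitone hc₀
  have hLam0 : 0 ≤ Lam := by positivity
  have hη0 : 0 ≤ η := by positivity
  have hη₀0 : 0 ≤ η₀ := by positivity
  set T1 : ℝ := ((N : ℝ) / M₁ + (2 : ℝ) ^ ν / M₁ + 1) * (8 * Lam) * (2 : ℝ) ^ (2 * walshL1Exponent * ν) with hT1
  set T2 : ℝ := 4 * N * Lam * η₀ * (2 : ℝ) ^ (walshL1Exponent * x₀) with hT2
  set T3 : ℝ := 8 * N * Lam * (2 : ℝ) ^ ((2 * walshL1Exponent - 1) * x₀) with hT3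
  have hT10 : 0 ≤ T1 := by rw [hT1]; positivity
  have hT20 : 0 ≤ T2 := by rw [hT2]; positivity
  have hT30 : 0 ≤ T3 := by rw [hT3]; positivity
  unfold resBoundBottom
  rw [← hLam, ← hη]
  refine add_le_add ?_ ?_
  · refine mul_le_mul_of_nonneg_right (mul_le_mul_of_nonneg_left ?_ (Nat.cast_nonneg N)) hLam0
    exact pow_le_pow_left₀ hη0 hηη₀ 2
  have hterm : ∀ r ∈ range ν,
      2 * ((2 : ℝ) ^ (ν - r) / M₁ + 1) * ((N : ℝ) / 2 ^ (ν - r) + 1) *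
        (Lam * (2 * (2 : ℝ) ^ (walshL1Exponent * (ν - r : ℕ)))) *
        min (2 * (2 : ℝ) ^ (walshL1Exponent * (ν - r : ℕ))) (2 ^ (ν - r) * η) ≤ T1 + T2 + T3 := by
    intro r hr
    have hr' := mem_range.mp hr
    set x : ℕ := ν - r with hx
    have hx1 : 1 ≤ x := by omega
    have hxν : x ≤ ν := Nat.sub_le ν r
    have h2x : (0 : ℝ) < 2 ^ x := by positivity
    set p : ℝ := (2 : ℝ) ^ (walshL1Exponent * (x : ℕ)) with hp
    have hp0 : 0 < p := by rw [hp]; positivity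
    -- `p ≤ 2^{κν}` and `p² = 2^{2κx}`
    have hpν : p ≤ (2 : ℝ) ^ (walshL1Exponent * ν) := by
      rw [hp]; refine Real.rpow_le_rpow_of_exponent_le (by norm_num) ?_
      exact mul_le_mul_of_nonneg_left (by exact_mod_cast hxν) hκ0
    have hpp : p * p = (2 : ℝ) ^ (2 * walshL1Exponent * x) := by
      rw [hp, ← Real.rpow_add (by norm_num)]; ring_nf
    have hppν : p * p ≤ (2 : ℝ) ^ (2 * walshL1Exponent * ν) := by
      rw [hpp]; refine Real.rpow_le_rpow_of_exponent_le (by norm_num) ?_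
      have : (x : ℝ) ≤ ν := by exact_mod_cast hxν
      nlinarith
    have hmin0 : 0 ≤ min (2 * p) (2 ^ x * η) := le_min (by positivity) (by positivity)
    have hmin1 : min (2 * p) (2 ^ x * η) ≤ 2 * p := min_le_left _ _
    -- expand the count
    have hexp : 2 * ((2 : ℝ) ^ x / M₁ + 1) * ((N : ℝ) / 2 ^ x + 1) * (Lam * (2 * p)) * min (2 * p) (2 ^ x * η) =
        4 * Lam * p * min (2 * p) (2 ^ x * η) * ((N : ℝ) / M₁ + 2 ^ x / M₁ + 1) +
          4 * Lam * p * min (2 * p) (2 ^ x * η) * ((N : ℝ) / 2 ^ x) := by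
      field_simp; ring
    rw [hexp]
    have hA : 4 * Lam * p * min (2 * p) (2 ^ x * η) * ((N : ℝ) / M₁ + 2 ^ x / M₁ + 1) ≤ T1 := by
      rw [hT1]
      have h1 : (N : ℝ) / M₁ + 2 ^ x / M₁ + 1 ≤ (N : ℝ) / M₁ + 2 ^ ν / M₁ + 1 := by
        have : (2 : ℝ) ^ x ≤ 2 ^ ν := pow_le_pow_right₀ (by norm_num) hxν
        have := div_le_div_of_nonneg_right this hM₁.le
        linarith
      calc 4 * Lam * p * min (2 * p) (2 ^ x * η) * ((N : ℝ) / M₁ + 2 ^ x / M₁ + 1)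
          ≤ 4 * Lam * p * (2 * p) * ((N : ℝ) / M₁ + 2 ^ ν / M₁ + 1) := by
            refine mul_le_mul (mul_le_mul_of_nonneg_left hmin1 (by positivity)) h1 (by positivity) (by positivity)
        _ = ((N : ℝ) / M₁ + 2 ^ ν / M₁ + 1) * (8 * Lam) * (p * p) := by ring
        _ ≤ ((N : ℝ) / M₁ + 2 ^ ν / M₁ + 1) * (8 * Lam) * (2 : ℝ) ^ (2 * walshL1Exponent * ν) :=
            mul_le_mul_of_nonneg_left hppν (by positivity)
    have hB : 4 * Lam * p * min (2 * p) (2 ^ x * η) * ((N : ℝ) / 2 ^ x) ≤ T2 + T3 := by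
      rcases le_or_gt x x₀ with hle | hgt
      · -- sup route
        have h1 : min (2 * p) (2 ^ x * η) ≤ 2 ^ x * η := min_le_right _ _
        have hpx₀ : p ≤ (2 : ℝ) ^ (walshL1Exponent * x₀) := by
          rw [hp]; refine Real.rpow_le_rpow_of_exponent_le (by norm_num) ?_
          exact mul_le_mul_of_nonneg_left (by exact_mod_cast hle) hκ0
        calc 4 * Lam * p * min (2 * p) (2 ^ x * η) * ((N : ℝ) / 2 ^ x)
            ≤ 4 * Lam * p * (2 ^ x * η) * ((N : ℝ) / 2 ^ x) :=
              mul_le_mul_of_nonneg_right (mul_le_mul_of_nonneg_left h1 (by positivity)) (by positivity)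
          _ = 4 * N * Lam * η * p := by field_simp
          _ ≤ 4 * N * Lam * η₀ * p := mul_le_mul_of_nonneg_right (mul_le_mul_of_nonneg_left hηη₀ (by positivity)) hp0.le
          _ ≤ T2 := by rw [hT2]; exact mul_le_mul_of_nonneg_left hpx₀ (by positivity)
          _ ≤ T2 + T3 := le_add_of_nonneg_right hT30
      · -- Lemma-4 route with the decay `2^{(2κ-1)x}`
        have hdec : p * (2 * p) / 2 ^ x = 2 * (2 : ℝ) ^ ((2 * walshL1Exponent - 1) * x) := by
          rw [show p * (2 * p) / 2 ^ x = 2 * ((p * p) / 2 ^ x) by ring, hpp]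
          congr 1
          rw [show ((2 : ℝ) ^ x : ℝ) = (2 : ℝ) ^ ((x : ℕ) : ℝ) by rw [Real.rpow_natCast], ← Real.rpow_sub (by norm_num)]
          ring_nf
        have hmono : (2 : ℝ) ^ ((2 * walshL1Exponent - 1) * x) ≤ (2 : ℝ) ^ ((2 * walshL1Exponent - 1) * x₀) := by
          refine Real.rpow_le_rpow_of_exponent_le (by norm_num) ?_
          have : (x₀ : ℝ) ≤ x := by exact_mod_cast hgt.le
          nlinarith
        calc 4 * Lam * p * min (2 * p) (2 ^ x * η) * ((N : ℝ) / 2 ^ x)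
            ≤ 4 * Lam * p * (2 * p) * ((N : ℝ) / 2 ^ x) :=
              mul_le_mul_of_nonneg_right (mul_le_mul_of_nonneg_left hmin1 (by positivity)) (by positivity)
          _ = 4 * N * Lam * (p * (2 * p) / 2 ^ x) := by field_simp
          _ = 8 * N * Lam * (2 : ℝ) ^ ((2 * walshL1Exponent - 1) * x) := by rw [hdec]; ring
          _ ≤ T3 := by rw [hT3]; exact mul_le_mul_of_nonneg_left hmono (by positivity)
          _ ≤ T2 + T3 := le_add_of_nonneg_left hT20
    linarith
  calc ∑ r ∈ range ν, _ ≤ ∑ _r ∈ range ν, (T1 + T2 + T3) := Finset.sum_le_sum hterm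
    _ = (ν : ℝ) * (T1 + T2 + T3) := by rw [Finset.sum_const, Finset.card_range, nsmul_eq_mul]
    _ = _ := by rw [hT1, hT2, hT3]

/-! ### From the mean-square bounds to `S₂ ≤ M N² θ²` -/

/-- **Budget lemma**: if `S₂ ≤ ((N + SL)/L)(3MN + 2LC)` with `SL ≤ N`, `12 ≤ θ²L` and (for `C ≥ 0`)
`8C ≤ MNθ²`, then `S₂ ≤ MN²θ²`. [folklore] -/
theorem meanSquare_budget {S₂ M N S L C θ : ℝ} (hM : 0 ≤ M) (hN : 0 ≤ N) (hL : 0 < L)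
    (hC : 0 ≤ C) (h : S₂ ≤ ((N + S * L) / L) * (3 * M * N + 2 * L * C)) (hSL : S * L ≤ N)
    (hθL : 12 ≤ θ ^ 2 * L) (hCθ : 8 * C ≤ M * N * θ ^ 2) : S₂ ≤ M * N ^ 2 * θ ^ 2 := by
  have h1 : (N + S * L) / L ≤ 2 * N / L := by
    rw [div_le_div_iff_of_pos_right hL]; linarith
  have h2 : S₂ ≤ (2 * N / L) * (3 * M * N + 2 * L * C) :=
    h.trans (mul_le_mul_of_nonneg_right h1 (by positivity))
  have h3 : (2 * N / L) * (3 * M * N + 2 * L * C) = 6 * M * N ^ 2 / L + 4 * N * C := by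
    field_simp; ring
  rw [h3] at h2
  have h4 : 6 * M * N ^ 2 / L ≤ M * N ^ 2 * θ ^ 2 / 2 := by
    rw [div_le_div_iff₀ hL (by norm_num)]
    have : 0 ≤ M * N ^ 2 := by positivity
    nlinarith
  have h5 : 4 * N * C ≤ M * N ^ 2 * θ ^ 2 / 2 := by nlinarith
  linarith

/-- **Type-II box bound from a mean-square bound**: `|boxSum T i j α β| ≤ √(∑α²)·√S₂ ≤ √M · (√M N θ)`
when `|α| ≤ 1` and `S₂ ≤ MN²θ²`: `|boxSum| ≤ MNθ`. [cite: Bourgain2013MoebiusWalsh, (2.1), (2.31)] -/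
theorem abs_boxSum_le_of_meanSquare' (T : Finset ℕ) (i j : ℕ) {α β : ℕ → ℝ} {Dα : ℝ}
    (hα : ∑ a ∈ dyBlock i, α a ^ 2 ≤ Dα) {θ : ℝ}
    (hθ : 0 ≤ θ) (hS₂ : ∑ a ∈ dyBlock i, (longSum T β j a) ^ 2 ≤ (2 : ℝ) ^ i * ((2 : ℝ) ^ j) ^ 2 * θ ^ 2) :
    |boxSum T i j α β| ≤ Real.sqrt Dα * Real.sqrt ((2 : ℝ) ^ i) * 2 ^ j * θ := by
  have h := abs_boxSum_le_sqrt_mul_sqrt T β j i α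
  have h1 : Real.sqrt (∑ a ∈ dyBlock i, α a ^ 2) ≤ Real.sqrt Dα := Real.sqrt_le_sqrt hα
  have h2 : Real.sqrt (∑ a ∈ dyBlock i, (longSum T β j a) ^ 2) ≤ Real.sqrt ((2 : ℝ) ^ i) * (2 ^ j * θ) := by
    calc Real.sqrt (∑ a ∈ dyBlock i, (longSum T β j a) ^ 2) ≤ Real.sqrt ((2 : ℝ) ^ i * ((2 : ℝ) ^ j) ^ 2 * θ ^ 2) :=
          Real.sqrt_le_sqrt hS₂
      _ = Real.sqrt ((2 : ℝ) ^ i) * (2 ^ j * θ) := by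
          rw [show (2 : ℝ) ^ i * ((2 : ℝ) ^ j) ^ 2 * θ ^ 2 = (2 : ℝ) ^ i * (2 ^ j * θ) ^ 2 by ring,
            Real.sqrt_mul (by positivity), Real.sqrt_sq (by positivity)]
  calc |boxSum T i j α β| ≤ Real.sqrt (∑ a ∈ dyBlock i, α a ^ 2) * Real.sqrt (∑ a ∈ dyBlock i, (longSum T β j a) ^ 2) := h
    _ ≤ Real.sqrt Dα * (Real.sqrt ((2 : ℝ) ^ i) * (2 ^ j * θ)) :=
        mul_le_mul h1 h2 (Real.sqrt_nonneg _) (Real.sqrt_nonneg _)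
    _ = _ := by ring

/-- For `|α| ≤ 1`: `|boxSum| ≤ 2^{i+j} θ`. [cite: Bourgain2013MoebiusWalsh, (2.1), (2.31)] -/
theorem abs_boxSum_le_of_meanSquare (T : Finset ℕ) (i j : ℕ) {α β : ℕ → ℝ} (hα : ∀ a, |α a| ≤ 1) {θ : ℝ}
    (hθ : 0 ≤ θ) (hS₂ : ∑ a ∈ dyBlock i, (longSum T β j a) ^ 2 ≤ (2 : ℝ) ^ i * ((2 : ℝ) ^ j) ^ 2 * θ ^ 2) :
    |boxSum T i j α β| ≤ (2 : ℝ) ^ i * 2 ^ j * θ := by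
  have hα2 : ∑ a ∈ dyBlock i, α a ^ 2 ≤ (2 : ℝ) ^ i := by
    calc ∑ a ∈ dyBlock i, α a ^ 2 ≤ ∑ _a ∈ dyBlock i, (1 : ℝ) := by
          refine Finset.sum_le_sum fun a _ => ?_
          have := hα a; rw [← sq_abs]; nlinarith [abs_nonneg (α a)]
      _ = (2 : ℝ) ^ i := by
          rw [Finset.sum_const, nsmul_eq_mul, mul_one, dyBlock, Nat.card_Ico, pow_succ]
          rw [show (2 : ℕ) ^ i * 2 - 2 ^ i = 2 ^ i by omega]; push_cast; ring
  have h := abs_boxSum_le_of_meanSquare' T i j hα2 hθ hS₂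
  rwa [Real.mul_self_sqrt (by positivity)] at h

/-! ### The three window families: `S₂ ≤ M N² θ²` under explicit numeric conditions -/

/-- The kernel parameters: `W = M₁ = 2^{i−E−2−a₀}`, `A = 2^{a₀}`, so that `AW ≤ 2^i/2` and the
kernel tail is `(M₁/(2W))^A = 2^{-2^{a₀}}`. [folklore] -/
theorem kernel_params {i E a₀ : ℕ} (ha : E + 2 + a₀ + 1 ≤ i) :
    0 < 2 ^ (i - E - 2 - a₀) ∧ 2 ^ a₀ * 2 ^ (i - E - 2 - a₀) ≤ 2 ^ i / 2 ∧
      (((2 ^ (i - E - 2 - a₀) : ℕ) : ℝ) / (2 * ((2 ^ (i - E - 2 - a₀) : ℕ) : ℝ))) ^ (2 ^ a₀) = (1 / 2 : ℝ) ^ (2 ^ a₀) := by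
  refine ⟨Nat.two_pow_pos _, ?_, ?_⟩
  · rw [← pow_add, show a₀ + (i - E - 2 - a₀) = i - E - 2 by omega]
    rw [Nat.le_div_iff_mul_le (by norm_num), ← pow_succ]
    exact Nat.pow_le_pow_right (by norm_num) (by omega)
  · congr 1
    have h : (0 : ℝ) < ((2 ^ (i - E - 2 - a₀) : ℕ) : ℝ) := by positivity
    field_simp

/-- **Middle window**: `S₂ ≤ MN²θ²` provided the carry, Fejér, resonance and tail terms fit the
budget (all conditions explicit; `M₁ = W = 2^{i−E−2−a₀}`, `A = 2^{a₀}`, `E₁ = ν + t + 1`).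
[cite: Bourgain2013MoebiusWalsh, §2 (2.29)–(2.31)] -/
theorem meanSquare_middle_small {T : Finset ℕ} {β : ℕ → ℝ} (hβ : ∀ b, |β b| ≤ 1)
    {i j ρ E K t s a₀ c₀ : ℕ} {θ : ℝ} (hi : 1 ≤ i) (hρ : 1 ≤ ρ) (hjE : K + ρ + E + 5 ≤ j)
    (htK : t ≤ K) (ha : E + 2 + a₀ + 1 ≤ i) (hc₀ : c₀ ≤ (T.filter fun u => K ≤ u ∧ u < K + i + 2 + ρ + E).card)
    (h1 : 12 ≤ θ ^ 2 * 2 ^ ρ) (h2 : 1152 ≤ θ ^ 2 * 2 ^ E)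
    (h3 : 64 * fejerErrMid i j K (i + 2 + ρ + E) t s ≤ 2 ^ i * 2 ^ j * θ ^ 2)
    (h4 : ∀ c : ℕ, c₀ ≤ c → 64 * resBoundTop (i + 2 + ρ + E) t c (2 ^ j) (2 ^ ρ) ((i + 2 + ρ + E) + t + 1) K
      (((2 ^ (i - E - 2 - a₀) : ℕ)) : ℝ) ≤ 2 ^ j * θ ^ 2)
    (h5 : 64 * ((1 / 2 : ℝ) ^ (2 ^ a₀) * (2 ^ (t + 3) * (2 : ℝ) ^ (walshL1Exponent * (i + 2 + ρ + E : ℕ))) ^ 2) ≤ θ ^ 2) :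
    ∑ a ∈ dyBlock i, (longSum T β j a) ^ 2 ≤ (2 : ℝ) ^ i * ((2 : ℝ) ^ j) ^ 2 * θ ^ 2 := by
  obtain ⟨hW, hAW, htail⟩ := kernel_params ha
  set W : ℕ := 2 ^ (i - E - 2 - a₀) with hWdef
  set ν := i + 2 + ρ + E with hν
  have hM₁ : (0 : ℝ) < ((W : ℕ) : ℝ) := by exact_mod_cast hW
  have hms := meanSquare_le_middle T j hβ hi (s := s) (E₁ := ν + t + 1) hρ hjE htK hW hAW hM₁
  rw [htail] at hms
  simp only [Nat.cast_pow, Nat.cast_ofNat] at hms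
  -- budget
  have hθ2 : 0 ≤ θ ^ 2 := sq_nonneg θ
  set RES := resBoundTop ν t (T.filter fun u => K ≤ u ∧ u < K + i + 2 + ρ + E).card (2 ^ j) (2 ^ ρ) (ν + t + 1) K ((W : ℕ) : ℝ)
    with hRES
  set ERR := fejerErrMid i j K ν t s with hERR
  set η₁ : ℝ := 2 ^ (t + 3) * (2 : ℝ) ^ (walshL1Exponent * (ν : ℕ)) with hη₁
  have hRESle : 64 * RES ≤ 2 ^ j * θ ^ 2 := by
    have h := h4 _ hc₀
    exact h
  have hRES0 : 0 ≤ RES := by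
    -- `RES` dominates a sum of nonnegative terms; cheaper: it is bounded below by its first summand's `0 ≤ ...`
    rw [hRES]; unfold resBoundTop
    refine add_nonneg (add_nonneg ?_ (by positivity)) (Finset.sum_nonneg fun e _ => ?_)
    · refine mul_nonneg (by positivity) (le_min (by unfold resSumBound; positivity) (by positivity))
    · refine mul_nonneg (mul_nonneg (le_min (by positivity) (by positivity))
        (le_min (by unfold resSumBound; positivity) (by positivity))) (le_min (by positivity) (by positivity))
  have hERR0 : 0 ≤ ERR := by rw [hERR]; unfold fejerErrMid; exact Real.sqrt_nonneg _
  set C : ℝ := 36 * 2 ^ i * 2 ^ j / 2 ^ E + 2 * ERR + 2 * 2 ^ i * RES + 2 * 2 ^ i * (1 / 2 : ℝ) ^ (2 ^ a₀) * 2 ^ j * η₁ ^ 2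
    with hC
  have hC0 : 0 ≤ C := by rw [hC]; positivity
  have hms' : ∑ a ∈ dyBlock i, (longSum T β j a) ^ 2 ≤
      (((2 : ℝ) ^ j + (2 : ℝ) ^ K * (2 : ℝ) ^ ρ) / (2 : ℝ) ^ ρ) * (3 * 2 ^ i * 2 ^ j + 2 * (2 : ℝ) ^ ρ * C) := by
    rw [hC]; exact hms
  refine meanSquare_budget (M := (2 : ℝ) ^ i) (N := (2 : ℝ) ^ j) (S := (2 : ℝ) ^ K) (L := (2 : ℝ) ^ ρ) (C := C)
    (by positivity) (by positivity) (by positivity) hC0 hms' ?_ h1 ?_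
  · rw [← pow_add]; exact pow_le_pow_right₀ (by norm_num) (by omega)
  · -- `8C ≤ MNθ²`
    rw [hC]
    have e1 : 8 * (36 * (2 : ℝ) ^ i * 2 ^ j / 2 ^ E) ≤ 2 ^ i * 2 ^ j * θ ^ 2 / 4 := by
      have hE2 : (1152 : ℝ) / 2 ^ E ≤ θ ^ 2 := by rw [div_le_iff₀ (by positivity)]; linarith [h2]
      have e : 8 * (36 * (2 : ℝ) ^ i * 2 ^ j / 2 ^ E) = 2 ^ i * 2 ^ j * ((1152 : ℝ) / 2 ^ E) / 4 := by ring
      rw [e]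
      have : 0 ≤ (2 : ℝ) ^ i * 2 ^ j := by positivity
      have := mul_le_mul_of_nonneg_left hE2 this
      linarith
    have e2 : 8 * (2 * ERR) ≤ 2 ^ i * 2 ^ j * θ ^ 2 / 4 := by rw [hERR, hν]; linarith
    have e3 : 8 * (2 * (2 : ℝ) ^ i * RES) ≤ 2 ^ i * 2 ^ j * θ ^ 2 / 4 := by
      have := mul_le_mul_of_nonneg_left hRESle (show (0 : ℝ) ≤ 2 ^ i by positivity)
      linarith
    have e4 : 8 * (2 * (2 : ℝ) ^ i * (1 / 2 : ℝ) ^ (2 ^ a₀) * 2 ^ j * η₁ ^ 2) ≤ 2 ^ i * 2 ^ j * θ ^ 2 / 4 := by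
      have h5' : 64 * ((1 / 2 : ℝ) ^ (2 ^ a₀) * η₁ ^ 2) ≤ θ ^ 2 := by rw [hη₁, hν]; exact h5
      have := mul_le_mul_of_nonneg_left h5' (show (0 : ℝ) ≤ 2 ^ i * 2 ^ j by positivity)
      linarith
    linarith

/-- **Top window**: `S₂ ≤ MN²θ²` under explicit conditions (`E₁ = i + 3`, split at `e₀ ≤ i + 3`,
`M₁ = W = 2^{i−E−2−a₀}`, `A = 2^{a₀}`; here `E` only sizes the kernel).
[cite: Bourgain2013MoebiusWalsh, §2 (2.29)–(2.31)] -/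
theorem meanSquare_top_small {T : Finset ℕ} {β : ℕ → ℝ} (hβ : ∀ b, |β b| ≤ 1)
    {i j ρ E K t s a₀ c₀ : ℕ} {θ : ℝ} (hT : ∀ u ∈ T, u < i + j + 3) (hi : 1 ≤ i) (hρ : 1 ≤ ρ)
    (hK : K + (i + ρ + 4) = i + j + 3) (htK : t ≤ K) (ha : E + 2 + a₀ + 1 ≤ i)
    (hc₀ : c₀ ≤ (T.filter fun u => ¬ u < K).card)
    (h1 : 12 ≤ θ ^ 2 * 2 ^ ρ)
    (h3 : 64 * fejerErrTop i j K (i + ρ + 4) t s ≤ 2 ^ i * 2 ^ j * θ ^ 2)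
    (h4 : ∀ c : ℕ, c₀ ≤ c → 64 * resBoundTop (i + ρ + 4) t c (2 ^ j) (2 ^ ρ) (i + 3) K
      (((2 ^ (i - E - 2 - a₀) : ℕ)) : ℝ) ≤ 2 ^ j * θ ^ 2)
    (h5 : 64 * ((1 / 2 : ℝ) ^ (2 ^ a₀) * (2 ^ (t + 3) * (2 : ℝ) ^ (walshL1Exponent * (i + ρ + 4 : ℕ))) ^ 2) ≤ θ ^ 2) :
    ∑ a ∈ dyBlock i, (longSum T β j a) ^ 2 ≤ (2 : ℝ) ^ i * ((2 : ℝ) ^ j) ^ 2 * θ ^ 2 := by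
  obtain ⟨hW, hAW, htail⟩ := kernel_params ha
  set W : ℕ := 2 ^ (i - E - 2 - a₀) with hWdef
  set ν := i + ρ + 4 with hν
  have hM₁ : (0 : ℝ) < ((W : ℕ) : ℝ) := by exact_mod_cast hW
  have hms := meanSquare_le_top T j hT hβ hi (s := s) (E₁ := i + 3) hρ hK htK hW hAW hM₁
  rw [htail] at hms
  simp only [Nat.cast_pow, Nat.cast_ofNat] at hms
  have hθ2 : 0 ≤ θ ^ 2 := sq_nonneg θ
  set RES := resBoundTop ν t (T.filter fun u => ¬ u < K).card (2 ^ j) (2 ^ ρ) (i + 3) K ((W : ℕ) : ℝ) with hRES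
  set ERR := fejerErrTop i j K ν t s with hERR
  set η₁ : ℝ := 2 ^ (t + 3) * (2 : ℝ) ^ (walshL1Exponent * (ν : ℕ)) with hη₁
  have hRESle : 64 * RES ≤ 2 ^ j * θ ^ 2 := by
    have h := h4 _ hc₀
    exact h
  have hRES0 : 0 ≤ RES := by
    rw [hRES]; unfold resBoundTop
    refine add_nonneg (add_nonneg ?_ (by positivity)) (Finset.sum_nonneg fun e _ => ?_)
    · refine mul_nonneg (by positivity) (le_min (by unfold resSumBound; positivity) (by positivity))
    · refine mul_nonneg (mul_nonneg (le_min (by positivity) (by positivity))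
        (le_min (by unfold resSumBound; positivity) (by positivity))) (le_min (by positivity) (by positivity))
  have hERR0 : 0 ≤ ERR := by rw [hERR]; unfold fejerErrTop; exact Real.sqrt_nonneg _
  set C : ℝ := 2 * ERR + 2 * 2 ^ i * RES + 2 * 2 ^ i * (1 / 2 : ℝ) ^ (2 ^ a₀) * 2 ^ j * η₁ ^ 2 with hC
  have hC0 : 0 ≤ C := by rw [hC]; positivity
  have hms' : ∑ a ∈ dyBlock i, (longSum T β j a) ^ 2 ≤
      (((2 : ℝ) ^ j + (2 : ℝ) ^ K * (2 : ℝ) ^ ρ) / (2 : ℝ) ^ ρ) * (3 * 2 ^ i * 2 ^ j + 2 * (2 : ℝ) ^ ρ * C) := by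
    rw [hC]; exact hms
  refine meanSquare_budget (M := (2 : ℝ) ^ i) (N := (2 : ℝ) ^ j) (S := (2 : ℝ) ^ K) (L := (2 : ℝ) ^ ρ) (C := C)
    (by positivity) (by positivity) (by positivity) hC0 hms' ?_ h1 ?_
  · rw [← pow_add]; exact pow_le_pow_right₀ (by norm_num) (by omega)
  · rw [hC]
    have e2 : 8 * (2 * ERR) ≤ 2 ^ i * 2 ^ j * θ ^ 2 / 4 := by rw [hERR, hν]; linarith
    have e3 : 8 * (2 * (2 : ℝ) ^ i * RES) ≤ 2 ^ i * 2 ^ j * θ ^ 2 / 4 := by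
      have := mul_le_mul_of_nonneg_left hRESle (show (0 : ℝ) ≤ 2 ^ i by positivity)
      linarith
    have e4 : 8 * (2 * (2 : ℝ) ^ i * (1 / 2 : ℝ) ^ (2 ^ a₀) * 2 ^ j * η₁ ^ 2) ≤ 2 ^ i * 2 ^ j * θ ^ 2 / 4 := by
      have h5' : 64 * ((1 / 2 : ℝ) ^ (2 ^ a₀) * η₁ ^ 2) ≤ θ ^ 2 := by rw [hη₁, hν]; exact h5
      have := mul_le_mul_of_nonneg_left h5' (show (0 : ℝ) ≤ 2 ^ i * 2 ^ j by positivity)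
      linarith
    have : 0 ≤ (2 : ℝ) ^ i * 2 ^ j * θ ^ 2 := by positivity
    linarith

/-- **Bottom window**: `S₂ ≤ MN²θ²` under explicit conditions (split of the `2`-adic levels at
`x₀`, `M₁ = W = 2^{i−E−2−a₀}`, `A = 2^{a₀}`). [cite: Bourgain2013MoebiusWalsh, §2 (2.29)–(2.31)] -/
theorem meanSquare_bottom_small {T : Finset ℕ} {β : ℕ → ℝ} (hβ : ∀ b, |β b| ≤ 1)
    {i j ρ E a₀ c₀ : ℕ} {θ : ℝ} (hi : 1 ≤ i) (hρ : 1 ≤ ρ) (hjE : ρ + E + 5 ≤ j) (ha : E + 2 + a₀ + 1 ≤ i)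
    (hc₀ : c₀ ≤ (T.filter (fun u => u < i + 2 + ρ + E)).card)
    (h1 : 12 ≤ θ ^ 2 * 2 ^ ρ) (h2 : 1152 ≤ θ ^ 2 * 2 ^ E)
    (h4 : ∀ c : ℕ, c₀ ≤ c → 64 * resBoundBottom (i + 2 + ρ + E) c (2 ^ j) (2 ^ ρ)
      (((2 ^ (i - E - 2 - a₀) : ℕ)) : ℝ) ≤ 2 ^ j * θ ^ 2)
    (h5 : 64 * ((1 / 2 : ℝ) ^ (2 ^ a₀) * (2 * (2 : ℝ) ^ (walshL1Exponent * (i + 2 + ρ + E : ℕ))) ^ 2) ≤ θ ^ 2) :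
    ∑ a ∈ dyBlock i, (longSum T β j a) ^ 2 ≤ (2 : ℝ) ^ i * ((2 : ℝ) ^ j) ^ 2 * θ ^ 2 := by
  obtain ⟨hW, hAW, htail⟩ := kernel_params ha
  set W : ℕ := 2 ^ (i - E - 2 - a₀) with hWdef
  set ν := i + 2 + ρ + E with hν
  have hM₁ : (0 : ℝ) < ((W : ℕ) : ℝ) := by exact_mod_cast hW
  have hms := meanSquare_le_bottom T j hβ hi hρ hjE hW hAW hM₁
  rw [htail] at hms
  have hθ2 : 0 ≤ θ ^ 2 := sq_nonneg θ
  set RES := resBoundBottom ν (T.filter (fun u => u < i + 2 + ρ + E)).card (2 ^ j) (2 ^ ρ) ((W : ℕ) : ℝ) with hRES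
  set η₁ : ℝ := 2 * (2 : ℝ) ^ (walshL1Exponent * (ν : ℕ)) with hη₁
  have hRESle : 64 * RES ≤ 2 ^ j * θ ^ 2 := by
    have h := h4 _ hc₀
    exact h
  have hRES0 : 0 ≤ RES := resBoundBottom_nonneg _ _ _ _ hM₁
  set C : ℝ := 36 * 2 ^ i * 2 ^ j / 2 ^ E + 2 * 2 ^ i * RES + 2 * 2 ^ i * (1 / 2 : ℝ) ^ (2 ^ a₀) * 2 ^ j * η₁ ^ 2 with hC
  have hC0 : 0 ≤ C := by rw [hC]; positivity
  have hms' : ∑ a ∈ dyBlock i, (longSum T β j a) ^ 2 ≤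
      (((2 : ℝ) ^ j + 1 * (2 : ℝ) ^ ρ) / (2 : ℝ) ^ ρ) * (3 * 2 ^ i * 2 ^ j + 2 * (2 : ℝ) ^ ρ * C) := by
    rw [hC, one_mul]; exact hms
  refine meanSquare_budget (M := (2 : ℝ) ^ i) (N := (2 : ℝ) ^ j) (S := 1) (L := (2 : ℝ) ^ ρ) (C := C)
    (by positivity) (by positivity) (by positivity) hC0 hms' ?_ h1 ?_
  · rw [one_mul]; exact pow_le_pow_right₀ (by norm_num) (by omega)
  · rw [hC]
    have e1 : 8 * (36 * (2 : ℝ) ^ i * 2 ^ j / 2 ^ E) ≤ 2 ^ i * 2 ^ j * θ ^ 2 / 4 := by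
      have hE2 : (1152 : ℝ) / 2 ^ E ≤ θ ^ 2 := by rw [div_le_iff₀ (by positivity)]; linarith [h2]
      have e : 8 * (36 * (2 : ℝ) ^ i * 2 ^ j / 2 ^ E) = 2 ^ i * 2 ^ j * ((1152 : ℝ) / 2 ^ E) / 4 := by ring
      rw [e]
      have : 0 ≤ (2 : ℝ) ^ i * 2 ^ j := by positivity
      have := mul_le_mul_of_nonneg_left hE2 this
      linarith
    have e3 : 8 * (2 * (2 : ℝ) ^ i * RES) ≤ 2 ^ i * 2 ^ j * θ ^ 2 / 4 := by
      have := mul_le_mul_of_nonneg_left hRESle (show (0 : ℝ) ≤ 2 ^ i by positivity)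
      linarith
    have e4 : 8 * (2 * (2 : ℝ) ^ i * (1 / 2 : ℝ) ^ (2 ^ a₀) * 2 ^ j * η₁ ^ 2) ≤ 2 ^ i * 2 ^ j * θ ^ 2 / 4 := by
      have h5' : 64 * ((1 / 2 : ℝ) ^ (2 ^ a₀) * η₁ ^ 2) ≤ θ ^ 2 := by rw [hη₁, hν]; exact h5
      have := mul_le_mul_of_nonneg_left h5' (show (0 : ℝ) ≤ 2 ^ i * 2 ^ j by positivity)
      linarith
    have : 0 ≤ (2 : ℝ) ^ i * 2 ^ j * θ ^ 2 := by positivity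
    linarith

/-! ### The type-II box bound: choosing the window -/

/-- **The type-II box bound** (Bourgain 2013, (2.31)/(2.33), with the window chosen by
pigeonhole among the bottom window, the middle family `K ∈ [i+2−ρ, j−ρ−E−5]` and the top window
`K = j−ρ−1`): if every window of the family would satisfy the numeric conditions of the
corresponding mean-square theorem as soon as it holds `c₀` elements of `T`, and
`c₀ · #windows ≤ |T|`, then `|boxSum T i j α β| ≤ 2^{i+j} θ` for `|α|, |β| ≤ 1`.
[cite: Bourgain2013MoebiusWalsh, (2.31), (2.33)] -/
theorem box_small_of_windows {T T' : Finset ℕ} (hT'T : T' ⊆ T) {α β : ℕ → ℝ} {Dα : ℝ}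
    {i j ρ E t s a₀ c₀ K₁ K₂ : ℕ} (hα : ∑ a ∈ dyBlock i, α a ^ 2 ≤ Dα) (hβ : ∀ b, |β b| ≤ 1)
    {θ : ℝ} (hθ : 0 ≤ θ) (hT : ∀ u ∈ T, u < i + j + 3)
    (hi : 1 ≤ i) (hρ : 2 ≤ ρ) (hρi : ρ ≤ i + 2) (hjE : ρ + E + 5 ≤ j) (hij : i ≤ j) (ha : E + 2 + a₀ + 1 ≤ i)
    (hK₁ : i + 2 - ρ ≤ K₁) (hK₂ : K₂ ≤ j - ρ - E - 5) (hKt : j - ρ - 1 ≤ K₂ + (i + 2 + ρ + E))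
    (hK12 : K₁ ≤ K₂ ∨ j - ρ - 1 ≤ i + 2 + ρ + E)
    (hlow : ∀ u ∈ T', u < i + 2 + ρ + E ∨ K₁ ≤ u)
    (ht : t ≤ i + 2 - ρ) (ht' : t ≤ j - ρ - 1)
    (hcard : c₀ * ((K₂ - K₁) / (i + 2 + ρ + E) + 4) ≤ T'.card)
    (h1 : 12 ≤ θ ^ 2 * 2 ^ ρ) (h2 : 1152 ≤ θ ^ 2 * 2 ^ E)
    -- bottom window
    (h4b : ∀ c : ℕ, c₀ ≤ c → 64 * resBoundBottom (i + 2 + ρ + E) c (2 ^ j) (2 ^ ρ)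
      (((2 ^ (i - E - 2 - a₀) : ℕ)) : ℝ) ≤ 2 ^ j * θ ^ 2)
    (h5b : 64 * ((1 / 2 : ℝ) ^ (2 ^ a₀) * (2 * (2 : ℝ) ^ (walshL1Exponent * (i + 2 + ρ + E : ℕ))) ^ 2) ≤ θ ^ 2)
    -- middle windows
    (h3m : ∀ K ∈ Icc K₁ K₂, 64 * fejerErrMid i j K (i + 2 + ρ + E) t s ≤ 2 ^ i * 2 ^ j * θ ^ 2)
    (h4m : ∀ K ∈ Icc K₁ K₂, ∀ c : ℕ, c₀ ≤ c → 64 * resBoundTop (i + 2 + ρ + E) t c (2 ^ j) (2 ^ ρ) ((i + 2 + ρ + E) + t + 1) K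
      (((2 ^ (i - E - 2 - a₀) : ℕ)) : ℝ) ≤ 2 ^ j * θ ^ 2)
    (h5m : 64 * ((1 / 2 : ℝ) ^ (2 ^ a₀) * (2 ^ (t + 3) * (2 : ℝ) ^ (walshL1Exponent * (i + 2 + ρ + E : ℕ))) ^ 2) ≤ θ ^ 2)
    -- top window
    (h3t : 64 * fejerErrTop i j (j - ρ - 1) (i + ρ + 4) t s ≤ 2 ^ i * 2 ^ j * θ ^ 2)
    (h4t : ∀ c : ℕ, c₀ ≤ c → 64 * resBoundTop (i + ρ + 4) t c (2 ^ j) (2 ^ ρ) (i + 3) (j - ρ - 1)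
      (((2 ^ (i - E - 2 - a₀) : ℕ)) : ℝ) ≤ 2 ^ j * θ ^ 2)
    (h5t : 64 * ((1 / 2 : ℝ) ^ (2 ^ a₀) * (2 ^ (t + 3) * (2 : ℝ) ^ (walshL1Exponent * (i + ρ + 4 : ℕ))) ^ 2) ≤ θ ^ 2) :
    |boxSum T i j α β| ≤ Real.sqrt Dα * Real.sqrt ((2 : ℝ) ^ i) * 2 ^ j * θ := by
  classical
  set ν := i + 2 + ρ + E with hν
  set Kt := j - ρ - 1 with hKt
  set ws : Finset (Finset ℕ) := stepWindows ν K₁ K₂ Kt (i + j + 3) with hws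
  have hne : ws.Nonempty := ⟨range ν, by rw [hws]; unfold stepWindows; simp⟩
  have hνpos : 0 < ν := by rw [hν]; omega
  have hK12 : K₁ ≤ K₂ ∨ Kt ≤ ν := by rw [hKt, hν]; exact hK12
  have hcover : ∀ u ∈ T', ∃ w ∈ ws, u ∈ w := by
    intro u hu
    exact stepWindows_cover hνpos (by omega) (hT u (hT'T hu)) (hlow u hu)
  obtain ⟨w, hw, hwcard⟩ := exists_mem_card_mul_le hne hcover
  set nW : ℕ := (K₂ - K₁) / ν + 4 with hnWdef
  have hnW : ws.card ≤ nW := card_stepWindows_le ν K₁ K₂ Kt (i + j + 3)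
  have hc₀' : c₀ ≤ (T' ∩ w).card := by
    by_contra hlt
    have hlt' : (T' ∩ w).card < c₀ := not_le.mp hlt
    have h3' : ws.card * (T' ∩ w).card ≤ nW * (T' ∩ w).card := Nat.mul_le_mul_right _ hnW
    have h4' : nW * (T' ∩ w).card < nW * c₀ := Nat.mul_lt_mul_of_pos_left hlt' (by rw [hnWdef]; positivity)
    have h5' : nW * c₀ ≤ T'.card := by rw [mul_comm, hnWdef, hν]; exact hcard
    exact absurd (lt_of_le_of_lt (hwcard.trans h3') (lt_of_lt_of_le h4' h5')) (lt_irrefl _)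
  have hmonoW : ∀ w : Finset ℕ, (T' ∩ w).card ≤ (T ∩ w).card := fun w =>
    Finset.card_le_card (Finset.inter_subset_inter_right hT'T)
  have hc₀ : c₀ ≤ (T ∩ w).card := hc₀'.trans (hmonoW w)
  -- the mean square for the chosen window
  have hS₂ : ∑ a ∈ dyBlock i, (longSum T β j a) ^ 2 ≤ (2 : ℝ) ^ i * ((2 : ℝ) ^ j) ^ 2 * θ ^ 2 := by
    rw [hws] at hw; unfold stepWindows at hw
    rw [Finset.mem_union, Finset.mem_insert, Finset.mem_insert, Finset.mem_singleton, Finset.mem_image] at hw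
    rcases hw with (rfl | rfl | rfl) | ⟨q, hq, rfl⟩
    · -- bottom window
      have hTw : T ∩ range ν = T.filter (fun u => u < i + 2 + ρ + E) := by
        ext u; simp [hν, Finset.mem_filter, Finset.mem_inter]
      rw [hTw] at hc₀
      exact meanSquare_bottom_small hβ hi (by omega) hjE ha hc₀ h1 h2 h4b h5b
    · -- top window
      have hTw : T ∩ Ico Kt (i + j + 3) = T.filter (fun u => ¬ u < (j - ρ - 1)) := by
        ext u
        simp only [Finset.mem_inter, Finset.mem_Ico, Finset.mem_filter, hKt, not_lt]
        constructor
        · rintro ⟨h1', h2', _⟩; exact ⟨h1', h2'⟩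
        · rintro ⟨h1', h2'⟩; exact ⟨h1', h2', hT u h1'⟩
      rw [hTw] at hc₀
      exact meanSquare_top_small hβ hT hi (by omega) (K := j - ρ - 1) (by omega) ht' ha hc₀ h1 h3t h4t h5t
    · -- the last middle window `K = K₂` (or, if the family is degenerate, it still is a valid bound only when K₁ ≤ K₂)
      rcases hK12 with hK12' | hKtν
      · have hK : K₂ ∈ Icc K₁ K₂ := Finset.mem_Icc.2 ⟨hK12', le_rfl⟩
        have hTw : T ∩ Ico K₂ (K₂ + ν) = T.filter (fun u => K₂ ≤ u ∧ u < K₂ + i + 2 + ρ + E) := by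
          ext u; simp [hν, Finset.mem_filter, Finset.mem_inter, Finset.mem_Ico, add_assoc]
        rw [hTw] at hc₀
        exact meanSquare_middle_small hβ hi (by omega) (K := K₂) (by omega) (by omega) ha hc₀ h1 h2 (h3m K₂ hK) (h4m K₂ hK) h5m
      · -- degenerate family: the window `[K₂, K₂+ν)` is contained in `[0, ν) ∪ [Kt, Λ)`; use whichever of bottom/top holds `c₀`
        -- (in fact `T ∩ [K₂, K₂+ν) ⊆ T`, and we simply fall back to the bottom window, which holds at least as many... not
        -- necessarily). We avoid this case by a direct argument: every element `u ≥ ν` has `u ≥ Kt`, so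
        -- `T ∩ [K₂,K₂+ν) ⊆ (T ∩ [0,ν)) ∪ (T ∩ [Kt,Λ))`, and one of the two holds `≥ c₀/2`… To keep the statement clean we
        -- instead require the caller to provide `c₀` for this window too via the middle hypotheses at `K = K₂` when
        -- `K₁ ≤ K₂`; when `K₁ > K₂` we use the top window, which contains `[K₂, K₂+ν) ∩ [ν, Λ)`, together with the bottom one.
        -- one of the two windows holds at least `c₀ / 2`; but our hypotheses are stated with `c₀`.  We therefore use the
        -- crude fact that in the degenerate case the bottom and top windows COVER `T`, so one of them holds `≥ |T|/2 ≥ c₀`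
        -- (as `nW ≥ 4`, `c₀ · 4 ≤ |T|`).
        have hcovT : T' ⊆ (T ∩ range ν) ∪ (T ∩ Ico Kt (i + j + 3)) := by
          intro u hu
          rw [Finset.mem_union, Finset.mem_inter, Finset.mem_inter, mem_range, Finset.mem_Ico]
          by_cases h : u < ν
          · exact Or.inl ⟨hT'T hu, h⟩
          · exact Or.inr ⟨hT'T hu, by omega, hT u (hT'T hu)⟩
        have hT2 : T'.card ≤ (T ∩ range ν).card + (T ∩ Ico Kt (i + j + 3)).card :=
          (Finset.card_le_card hcovT).trans (Finset.card_union_le _ _)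
        have hc4 : 4 * c₀ ≤ T'.card := by
          have : 4 ≤ (K₂ - K₁) / (i + 2 + ρ + E) + 4 := Nat.le_add_left 4 _
          calc 4 * c₀ ≤ ((K₂ - K₁) / (i + 2 + ρ + E) + 4) * c₀ := Nat.mul_le_mul_right c₀ this
            _ ≤ T'.card := by rw [mul_comm]; exact hcard
        rcases le_or_gt c₀ (T ∩ range ν).card with hb | hb
        · have hTw : T ∩ range ν = T.filter (fun u => u < i + 2 + ρ + E) := by
            ext u; simp [hν, Finset.mem_filter, Finset.mem_inter]
          rw [hTw] at hb
          exact meanSquare_bottom_small hβ hi (by omega) hjE ha hb h1 h2 h4b h5b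
        · have htop : c₀ ≤ (T ∩ Ico Kt (i + j + 3)).card := by omega
          have hTw : T ∩ Ico Kt (i + j + 3) = T.filter (fun u => ¬ u < (j - ρ - 1)) := by
            ext u
            simp only [Finset.mem_inter, Finset.mem_Ico, Finset.mem_filter, hKt, not_lt]
            constructor
            · rintro ⟨h1', h2', _⟩; exact ⟨h1', h2'⟩
            · rintro ⟨h1', h2'⟩; exact ⟨h1', h2', hT u h1'⟩
          rw [hTw] at htop
          exact meanSquare_top_small hβ hT hi (by omega) (K := j - ρ - 1) (by omega) ht' ha htop h1 h3t h4t h5t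
    · -- a stepped middle window
      rcases hK12 with hK12' | hKtν
      · have hK := stepWindows_middle_mem hK12' hq
        set K := K₁ + q * ν with hKdef
        have hTw : T ∩ Ico K (K + ν) = T.filter (fun u => K ≤ u ∧ u < K + i + 2 + ρ + E) := by
          ext u; simp [hν, Finset.mem_filter, Finset.mem_inter, Finset.mem_Ico, add_assoc]
        rw [hTw] at hc₀
        have hK' := Finset.mem_Icc.mp hK
        exact meanSquare_middle_small hβ hi (by omega) (K := K) (by omega) (by omega) ha hc₀ h1 h2 (h3m K hK) (h4m K hK) h5m
      · -- degenerate family (`K₁ > K₂` is possible only here): `q = 0`, and the window `[K₁, K₁+ν)` lies inside `[0,ν) ∪ [Kt, Λ)`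
        have hcovT : T' ⊆ (T ∩ range ν) ∪ (T ∩ Ico Kt (i + j + 3)) := by
          intro u hu
          rw [Finset.mem_union, Finset.mem_inter, Finset.mem_inter, mem_range, Finset.mem_Ico]
          by_cases h : u < ν
          · exact Or.inl ⟨hT'T hu, h⟩
          · exact Or.inr ⟨hT'T hu, by omega, hT u (hT'T hu)⟩
        have hT2 : T'.card ≤ (T ∩ range ν).card + (T ∩ Ico Kt (i + j + 3)).card :=
          (Finset.card_le_card hcovT).trans (Finset.card_union_le _ _)
        have hc4 : 4 * c₀ ≤ T'.card := by
          have : 4 ≤ (K₂ - K₁) / (i + 2 + ρ + E) + 4 := Nat.le_add_left 4 _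
          calc 4 * c₀ ≤ ((K₂ - K₁) / (i + 2 + ρ + E) + 4) * c₀ := Nat.mul_le_mul_right c₀ this
            _ ≤ T'.card := by rw [mul_comm]; exact hcard
        rcases le_or_gt c₀ (T ∩ range ν).card with hb | hb
        · have hTw : T ∩ range ν = T.filter (fun u => u < i + 2 + ρ + E) := by
            ext u; simp [hν, Finset.mem_filter, Finset.mem_inter]
          rw [hTw] at hb
          exact meanSquare_bottom_small hβ hi (by omega) hjE ha hb h1 h2 h4b h5b
        · have htop : c₀ ≤ (T ∩ Ico Kt (i + j + 3)).card := by omega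
          have hTw : T ∩ Ico Kt (i + j + 3) = T.filter (fun u => ¬ u < (j - ρ - 1)) := by
            ext u
            simp only [Finset.mem_inter, Finset.mem_Ico, Finset.mem_filter, hKt, not_lt]
            constructor
            · rintro ⟨h1', h2', _⟩; exact ⟨h1', h2'⟩
            · rintro ⟨h1', h2'⟩; exact ⟨h1', h2', hT u h1'⟩
          rw [hTw] at htop
          exact meanSquare_top_small hβ hT hi (by omega) (K := j - ρ - 1) (by omega) ht' ha htop h1 h3t h4t h5t
  exact abs_boxSum_le_of_meanSquare' T i j hα hθ hS₂

/-! ### Type-I boxes -/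

open Literature.NumberTheory.LFunctions.MoebiusWalsh (typeI_crude typeI_refined abs_boxSum_typeI_le)
open Literature.NumberTheory.LFunctions.MoebiusWalshVaughan (abs_typeICoeff_le)

/-- **Type-I box, crude** (Bourgain (3.2)–(3.3) through the tree's `typeI_crude` and
`abs_boxSum_typeI_le`), with the sup-norm saving monotone in a lower bound `c₀ ≤ |T|`.
[cite: Bourgain2013MoebiusWalsh, (3.2)–(3.3)] -/
theorem typeI_box_crude_le {T : Finset ℕ} {Lm : ℕ} (hT : ∀ t ∈ T, t < Lm) (i j u : ℕ) {c₀ : ℕ} (hc₀ : c₀ ≤ T.card) :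
    |boxSum T i j (typeICoeff u) (fun _ => 1)| ≤
      Real.sqrt (2 ^ (i + 1) * (1 + Real.log (2 ^ (i + 1))) ^ 3) *
        Real.sqrt (2 ^ j * ((2 * (2 : ℝ) ^ (-(walshSupExponent * c₀))) *
          (2 * 2 ^ j * ((i + 1) * 2 ^ i) + 2 ^ i * (2 ^ Lm * (1 + Real.log (2 ^ Lm)))))) := by
  refine abs_boxSum_typeI_le T i j u ((typeI_crude T hT i j).trans ?_)
  refine mul_le_mul_of_nonneg_right (eta_antitone hc₀) ?_
  have : 0 ≤ 1 + Real.log ((2 : ℝ) ^ Lm) := by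
    have := Real.log_nonneg (one_le_pow₀ (M₀ := ℝ) one_le_two (n := Lm)); linarith
  positivity

/-- **Type-I box, refined split at `j − i`** (Bourgain (3.4)–(3.9) through the tree's
`typeI_refined`), monotone in a lower bound `c₁ ≤ |T ∩ [0, j−i)|` and an upper bound
`|T ∩ [j−i, Λ)| ≤ s₁`. [cite: Bourgain2013MoebiusWalsh, (3.4)–(3.9)] -/
theorem typeI_box_refined_le {T : Finset ℕ} {Lm : ℕ} (hLm : 1 ≤ Lm) (hT : ∀ t ∈ T, t < Lm) {i j : ℕ} (hij : i ≤ j) (u : ℕ)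
    {c₁ s₁ : ℕ} (hc₁ : c₁ ≤ (T.filter (· < j - i)).card) (hs₁ : (T.filter fun t => ¬ t < j - i).card ≤ s₁) :
    |boxSum T i j (typeICoeff u) (fun _ => 1)| ≤
      Real.sqrt (2 ^ (i + 1) * (1 + Real.log (2 ^ (i + 1))) ^ 3) *
        Real.sqrt (2 ^ j * ((2 * (2 : ℝ) ^ (-(walshSupExponent * c₁))) * (2 * Lm : ℝ) ^ s₁ *
          (2 ^ j * (2 * ((i + 1) * 2 ^ i) + (1 + Real.log (2 ^ (j - i))))))) := by
  refine abs_boxSum_typeI_le T i j u ((typeI_refined T hT hij).trans ?_)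
  have hlog : 0 ≤ 1 + Real.log ((2 : ℝ) ^ (j - i)) := by
    have := Real.log_nonneg (one_le_pow₀ (M₀ := ℝ) one_le_two (n := j - i)); linarith
  refine mul_le_mul_of_nonneg_right ?_ (by positivity)
  refine mul_le_mul (eta_antitone hc₁) ?_ (by positivity) (by positivity)
  have h2L : (1 : ℝ) ≤ 2 * Lm := by
    have : (1 : ℝ) ≤ Lm := by exact_mod_cast hLm
    linarith
  exact pow_le_pow_right₀ h2L hs₁

/-- `∑_{a ∈ D_i} c(a)² ≤ 2^{i+1}(1 + log 2^{i+1})³` for the type-I coefficient `|c| ≤ τ`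
(the tree's `∑_{m ≤ K} d(m)² ≤ K(1 + log K)³`). [folklore] -/
theorem sum_sq_typeICoeff_le (u i : ℕ) :
    ∑ a ∈ dyBlock i, (typeICoeff u a) ^ 2 ≤ 2 ^ (i + 1) * (1 + Real.log (2 ^ (i + 1))) ^ 3 := by
  have h1 : ∑ a ∈ dyBlock i, (typeICoeff u a) ^ 2 ≤ ∑ a ∈ dyBlock i, ((a.divisors.card : ℕ) : ℝ) ^ 2 := by
    refine Finset.sum_le_sum fun a _ => ?_
    have h := abs_typeICoeff_le u a
    rw [ArithmeticFunction.sigma_zero_apply] at h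
    rw [← sq_abs]
    exact pow_le_pow_left₀ (abs_nonneg _) h 2
  have h2 : ∑ a ∈ dyBlock i, ((a.divisors.card : ℕ) : ℝ) ^ 2 ≤ ∑ a ∈ Ioc 0 (2 ^ (i + 1)), ((a.divisors.card : ℕ) : ℝ) ^ 2 := by
    refine Finset.sum_le_sum_of_subset_of_nonneg ?_ fun a _ _ => sq_nonneg _
    intro a ha; rw [mem_dyBlock] at ha; rw [Finset.mem_Ioc]
    have := Nat.one_le_two_pow (n := i); constructor <;> omega
  have h3 := Literature.NumberTheory.Sieve.Vaughan.sum_sq_card_divisors_le (2 ^ (i + 1))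
  push_cast at h3
  exact h1.trans (h2.trans h3)

/-! ### Quantitative values of the exponents -/

/-- `c₂ = log₂(27/16)/4 ≥ 1/6` (since `(27/16)³ ≥ 4 = 2²`). [folklore] -/
theorem one_div_six_le_walshSupExponent : (1 : ℝ) / 6 ≤ walshSupExponent := by
  unfold walshSupExponent
  rw [div_le_div_iff₀ (by norm_num) (by norm_num)]
  -- `4 ≤ 6 logb 2 (27/16)`, i.e. `2/3 ≤ logb 2 (27/16)`, i.e. `2^{2/3} ≤ 27/16`
  have h : (2 : ℝ) / 3 ≤ Real.logb 2 (27 / 16) := by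
    rw [Real.le_logb_iff_rpow_le one_lt_two (by norm_num)]
    have h1 : ((2 : ℝ) ^ ((2 : ℝ) / 3)) ^ (3 : ℕ) = 4 := by
      rw [← Real.rpow_natCast, ← Real.rpow_mul (by norm_num)]; norm_num
    have h2 : (0 : ℝ) ≤ (2 : ℝ) ^ ((2 : ℝ) / 3) := by positivity
    nlinarith [h1, h2, sq_nonneg ((2 : ℝ) ^ ((2 : ℝ) / 3) - 27 / 16)]
  linarith

/-- `2κ = log₂(2 + √2)/2 ≤ 8/9` (since `(2 + √2)⁹ ≤ 2¹⁶`, using `√2 ≤ 1.4143`). [folklore] -/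
theorem two_mul_walshL1Exponent_le : 2 * walshL1Exponent ≤ 8 / 9 := by
  unfold walshL1Exponent
  have hs : Real.sqrt 2 ≤ 14143 / 10000 := by
    rw [Real.sqrt_le_left (by norm_num)]; norm_num
  have hpos : (0 : ℝ) < 2 + Real.sqrt 2 := by have := Real.sqrt_nonneg 2; linarith
  have h : Real.logb 2 (2 + Real.sqrt 2) ≤ 16 / 9 := by
    rw [Real.logb_le_iff_le_rpow one_lt_two hpos]
    have h1 : (2 + Real.sqrt 2) ^ (9 : ℕ) ≤ (2 : ℝ) ^ (16 : ℕ) := by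
      calc (2 + Real.sqrt 2) ^ (9 : ℕ) ≤ ((34143 : ℝ) / 10000) ^ (9 : ℕ) :=
            pow_le_pow_left₀ hpos.le (by linarith) 9
        _ ≤ (2 : ℝ) ^ (16 : ℕ) := by norm_num
    have h2 : (2 : ℝ) ^ ((16 : ℝ) / 9) = ((2 : ℝ) ^ (16 : ℕ)) ^ ((1 : ℝ) / 9) := by
      rw [← Real.rpow_natCast, ← Real.rpow_mul (by norm_num)]; norm_num
    rw [h2]
    calc 2 + Real.sqrt 2 = ((2 + Real.sqrt 2) ^ (9 : ℕ)) ^ ((1 : ℝ) / 9) := by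
          rw [← Real.rpow_natCast, ← Real.rpow_mul hpos.le]; norm_num
      _ ≤ ((2 : ℝ) ^ (16 : ℕ)) ^ ((1 : ℝ) / 9) := Real.rpow_le_rpow (by positivity) h1 (by norm_num)
  linarith

/-! ### The Fejér error terms in closed form -/

/-- The core of both Fejér error terms: with `t = 8s₄`, `s = 4s₄ ≤ K`,
`2^{K+ν}(4(2^{K+ν}/(2^{ν+t}2^{K−s}))² + 8·2^{K−s}/2^K) ≤ 12 · 2^{K+ν} · 2^{-4s₄}`. [folklore] -/
theorem fejerB₃_le {K ν s₄ : ℕ} (hsK : 4 * s₄ ≤ K) :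
    (2 : ℝ) ^ (K + ν) * (4 * ((2 : ℝ) ^ (K + ν) / ((2 ^ (ν + 8 * s₄) : ℕ) * (2 ^ (K - 4 * s₄) : ℕ))) ^ 2 +
        8 * ((2 ^ (K - 4 * s₄) : ℕ) : ℝ) / 2 ^ K) ≤ 12 * (2 : ℝ) ^ (K + ν) / (2 : ℝ) ^ (4 * s₄) := by
  have e1 : (2 : ℝ) ^ (K + ν) / ((2 ^ (ν + 8 * s₄) : ℕ) * (2 ^ (K - 4 * s₄) : ℕ)) = 1 / (2 : ℝ) ^ (4 * s₄) := by
    push_cast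
    rw [div_eq_div_iff (by positivity) (by positivity), one_mul, ← pow_add, ← pow_add]
    congr 1; omega
  have e2 : 8 * ((2 ^ (K - 4 * s₄) : ℕ) : ℝ) / 2 ^ K = 8 / (2 : ℝ) ^ (4 * s₄) := by
    push_cast
    rw [div_eq_div_iff (by positivity) (by positivity), mul_assoc, ← pow_add]
    congr 2; omega
  rw [e1, e2]
  have h1 : (1 : ℝ) ≤ (2 : ℝ) ^ (4 * s₄) := one_le_pow₀ (by norm_num)
  have hq : (0 : ℝ) < (2 : ℝ) ^ (4 * s₄) := by positivity
  rw [div_pow, one_pow, show (4 : ℝ) * (1 / ((2 : ℝ) ^ (4 * s₄)) ^ 2) + 8 / (2 : ℝ) ^ (4 * s₄) =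
    (4 / (2 : ℝ) ^ (4 * s₄) + 8) / (2 : ℝ) ^ (4 * s₄) by field_simp]
  rw [mul_div_assoc']
  refine div_le_div_of_nonneg_right ?_ hq.le
  have : 4 / (2 : ℝ) ^ (4 * s₄) ≤ 4 := div_le_self (by norm_num) h1
  nlinarith [pow_pos (show (0:ℝ) < 2 by norm_num) (K + ν)]

/-- **The Fejér error of a middle window in closed form**: with `t = 8s₄`, `s = 4s₄ ≤ K`,
`K + ν ≤ i + j + 3` and `1 + log(6·2^i·2^j) ≤ Lg` (`Lg ≥ 1`):
`fejerErrMid ≤ 12 · 2^i 2^j · Lg · 2^{-s₄}`. [cite: Bourgain2013MoebiusWalsh, Lemma 5] -/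
theorem fejerErrMid_le {i j K ν s₄ : ℕ} {Lg : ℝ} (hsK : 4 * s₄ ≤ K) (hLg1 : 1 ≤ Lg)
    (hLg : 1 + Real.log ((6 * 2 ^ i * 2 ^ j : ℕ)) ≤ Lg) :
    fejerErrMid i j K ν (8 * s₄) (4 * s₄) ≤ 12 * 2 ^ i * 2 ^ j * Lg / (2 : ℝ) ^ s₄ := by
  unfold fejerErrMid
  set M : ℝ := (2 : ℝ) ^ i with hM
  set N : ℝ := (2 : ℝ) ^ j with hN
  have hM0 : 0 < M := by positivity
  have hN0 : 0 < N := by positivity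
  have hB := fejerB₃_le (ν := ν) hsK
  have hlog0 : 0 ≤ 1 + Real.log ((6 * 2 ^ i * 2 ^ j : ℕ)) := by
    have : (1 : ℝ) ≤ ((6 * 2 ^ i * 2 ^ j : ℕ) : ℝ) := by
      have : 1 ≤ 6 * 2 ^ i * 2 ^ j := by
        have := Nat.one_le_two_pow (n := i); have := Nat.one_le_two_pow (n := j); nlinarith
      exact_mod_cast this
    have := Real.log_nonneg this; linarith
  -- the inner radicand
  set W : ℝ := (((6 * 2 ^ i * 2 ^ j : ℕ)) : ℝ) * (1 + Real.log ((6 * 2 ^ i * 2 ^ j : ℕ))) ^ 3 *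
      (4 * ((2 : ℝ) ^ (i + j + 3) / 2 ^ (K + ν) * (2 ^ (K + ν) * (4 * ((2 : ℝ) ^ (K + ν) /
        ((2 ^ (ν + 8 * s₄) : ℕ) * (2 ^ (K - 4 * s₄) : ℕ))) ^ 2 + 8 * ((2 ^ (K - 4 * s₄) : ℕ) : ℝ) / 2 ^ K)))) with hW
  have hWle : W ≤ 2304 * M ^ 2 * N ^ 2 * Lg ^ 4 / ((2 : ℝ) ^ s₄) ^ 4 := by
    have h1 : (((6 * 2 ^ i * 2 ^ j : ℕ)) : ℝ) = 6 * M * N := by rw [hM, hN]; push_cast; ring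
    have h2 : (1 + Real.log ((6 * 2 ^ i * 2 ^ j : ℕ))) ^ 3 ≤ Lg ^ 3 := pow_le_pow_left₀ hlog0 hLg 3
    have h3 : (2 : ℝ) ^ (i + j + 3) / 2 ^ (K + ν) * (2 ^ (K + ν) * (4 * ((2 : ℝ) ^ (K + ν) /
        ((2 ^ (ν + 8 * s₄) : ℕ) * (2 ^ (K - 4 * s₄) : ℕ))) ^ 2 + 8 * ((2 ^ (K - 4 * s₄) : ℕ) : ℝ) / 2 ^ K)) ≤
        96 * M * N / (2 : ℝ) ^ (4 * s₄) := by
      calc _ ≤ (2 : ℝ) ^ (i + j + 3) / 2 ^ (K + ν) * (12 * (2 : ℝ) ^ (K + ν) / (2 : ℝ) ^ (4 * s₄)) :=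
            mul_le_mul_of_nonneg_left hB (by positivity)
        _ = 96 * M * N / (2 : ℝ) ^ (4 * s₄) := by
            rw [hM, hN, pow_add, pow_add]; field_simp; ring
    have hL3 : Lg ^ 3 ≤ Lg ^ 4 := pow_le_pow_right₀ hLg1 (by norm_num)
    calc W = (6 * M * N) * (1 + Real.log ((6 * 2 ^ i * 2 ^ j : ℕ))) ^ 3 * (4 * ((2 : ℝ) ^ (i + j + 3) / 2 ^ (K + ν) *
          (2 ^ (K + ν) * (4 * ((2 : ℝ) ^ (K + ν) / ((2 ^ (ν + 8 * s₄) : ℕ) * (2 ^ (K - 4 * s₄) : ℕ))) ^ 2 +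
            8 * ((2 ^ (K - 4 * s₄) : ℕ) : ℝ) / 2 ^ K)))) := by rw [hW, h1]
      _ ≤ (6 * M * N) * Lg ^ 3 * (4 * (96 * M * N / (2 : ℝ) ^ (4 * s₄))) := by
          refine mul_le_mul (mul_le_mul_of_nonneg_left h2 (by positivity)) (mul_le_mul_of_nonneg_left h3 (by norm_num))
            (by positivity) (by positivity)
      _ = 2304 * M ^ 2 * N ^ 2 * Lg ^ 3 / ((2 : ℝ) ^ s₄) ^ 4 := by
          rw [show ((2 : ℝ) ^ s₄) ^ 4 = (2 : ℝ) ^ (4 * s₄) by rw [← pow_mul, mul_comm]]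
          field_simp; ring
      _ ≤ 2304 * M ^ 2 * N ^ 2 * Lg ^ 4 / ((2 : ℝ) ^ s₄) ^ 4 := by
          refine div_le_div_of_nonneg_right (mul_le_mul_of_nonneg_left hL3 (by positivity)) (by positivity)
  -- take square roots twice
  have hW0 : 0 ≤ W := by rw [hW]; positivity
  have hsqW : Real.sqrt W ≤ 48 * M * N * Lg ^ 2 / ((2 : ℝ) ^ s₄) ^ 2 := by
    rw [Real.sqrt_le_left (by positivity)]
    refine hWle.trans (le_of_eq ?_)
    field_simp; ring
  have hU : 3 * 2 ^ i * 2 ^ j * Real.sqrt W ≤ (12 * M * N * Lg / (2 : ℝ) ^ s₄) ^ 2 := by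
    rw [← hM, ← hN]
    calc 3 * M * N * Real.sqrt W ≤ 3 * M * N * (48 * M * N * Lg ^ 2 / ((2 : ℝ) ^ s₄) ^ 2) :=
          mul_le_mul_of_nonneg_left hsqW (by positivity)
      _ = (12 * M * N * Lg / (2 : ℝ) ^ s₄) ^ 2 := by field_simp; ring
  show Real.sqrt (3 * 2 ^ i * 2 ^ j * Real.sqrt W) ≤ 12 * 2 ^ i * 2 ^ j * Lg / (2 : ℝ) ^ s₄
  rw [Real.sqrt_le_left (by positivity), ← hM, ← hN]
  rw [← hM, ← hN] at hU
  exact hU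

/-- **The Fejér error of the top window in closed form** (`K + ν = i + j + 3`): same bound.
[cite: Bourgain2013MoebiusWalsh, Lemma 5] -/
theorem fejerErrTop_le {i j K ν s₄ : ℕ} {Lg : ℝ} (hK : K + ν = i + j + 3) (hsK : 4 * s₄ ≤ K) (hLg1 : 1 ≤ Lg)
    (hLg : 1 + Real.log ((6 * 2 ^ i * 2 ^ j : ℕ)) ≤ Lg) :
    fejerErrTop i j K ν (8 * s₄) (4 * s₄) ≤ 12 * 2 ^ i * 2 ^ j * Lg / (2 : ℝ) ^ s₄ := by
  have h := fejerErrMid_le (i := i) (j := j) (K := K) (ν := ν) hsK hLg1 hLg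
  have e : fejerErrTop i j K ν (8 * s₄) (4 * s₄) = fejerErrMid i j K ν (8 * s₄) (4 * s₄) := by
    unfold fejerErrTop fejerErrMid
    rw [hK, div_self (by positivity), one_mul]
  rw [e]; exact h

/-! ### Exponent bookkeeping: tools -/

/-- `2^x ≤ 2^y` for real exponents `x ≤ y`. [folklore] -/
theorem two_rpow_mono {x y : ℝ} (h : x ≤ y) : (2 : ℝ) ^ x ≤ (2 : ℝ) ^ y :=
  Real.rpow_le_rpow_of_exponent_le one_le_two h

/-- `η₀ = 2·2^{-c₂c₀} ≤ 2^{1 - c₀/6}`. [folklore] -/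
theorem eta_le_rpow (c₀ : ℕ) : 2 * (2 : ℝ) ^ (-(walshSupExponent * c₀)) ≤ (2 : ℝ) ^ (1 - (c₀ : ℝ) / 6) := by
  rw [show (1 : ℝ) - (c₀ : ℝ) / 6 = 1 + (-(c₀ : ℝ) / 6) by ring, Real.rpow_add two_pos, Real.rpow_one]
  refine mul_le_mul_of_nonneg_left (two_rpow_mono ?_) zero_le_two
  have h := one_div_six_le_walshSupExponent
  have hc : (0 : ℝ) ≤ c₀ := Nat.cast_nonneg c₀
  rw [neg_div]; refine neg_le_neg ?_
  calc (c₀ : ℝ) / 6 = 1 / 6 * c₀ := by ring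
    _ ≤ walshSupExponent * c₀ := mul_le_mul_of_nonneg_right h hc

/-- `2^{κ x} ≤ 2^{4x/9}`. [folklore] -/
theorem rpow_kappa_le (x : ℝ) (hx : 0 ≤ x) : (2 : ℝ) ^ (walshL1Exponent * x) ≤ (2 : ℝ) ^ (4 * x / 9) := by
  refine two_rpow_mono ?_
  have := two_mul_walshL1Exponent_le
  nlinarith

/-- `2^{(2κ-1) x} ≤ 2^{-x/9}` for `x ≥ 0`. [folklore] -/
theorem rpow_two_kappa_sub_one_le (x : ℝ) (hx : 0 ≤ x) :
    (2 : ℝ) ^ ((2 * walshL1Exponent - 1) * x) ≤ (2 : ℝ) ^ (-x / 9) := by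
  refine two_rpow_mono ?_
  have := two_mul_walshL1Exponent_le
  nlinarith

/-- A natural power as a real power. [folklore] -/
theorem two_pow_eq_rpow (n : ℕ) : (2 : ℝ) ^ n = (2 : ℝ) ^ (n : ℝ) := (Real.rpow_natCast 2 n).symm

/-- `2^a / 2^b = 2^{a-b}` (real exponents). [folklore] -/
theorem two_rpow_div (a b : ℝ) : (2 : ℝ) ^ a / (2 : ℝ) ^ b = (2 : ℝ) ^ (a - b) := by
  rw [Real.rpow_sub two_pos]

/-- `2^a * 2^b = 2^{a+b}` (real exponents). [folklore] -/
theorem two_rpow_mul (a b : ℝ) : (2 : ℝ) ^ a * (2 : ℝ) ^ b = (2 : ℝ) ^ (a + b) := by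
  rw [Real.rpow_add two_pos]

/-- Products of quantities bounded by powers of two. [folklore] -/
theorem mul_le_two_rpow_add {x y a b : ℝ} (hx : x ≤ (2 : ℝ) ^ a) (hy : y ≤ (2 : ℝ) ^ b) (hy0 : 0 ≤ y) :
    x * y ≤ (2 : ℝ) ^ (a + b) := by
  rw [← two_rpow_mul]; exact mul_le_mul hx hy hy0 (by positivity)

/-- A natural power of two below a real power: `2^n ≤ 2^x` when `n ≤ x`. [folklore] -/
theorem natpow_le_rpow {n : ℕ} {x : ℝ} (h : (n : ℝ) ≤ x) : (2 : ℝ) ^ n ≤ (2 : ℝ) ^ x := by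
  rw [two_pow_eq_rpow]; exact two_rpow_mono h

/-- `2^a / 2^b = 2^{a-b}` for natural exponents, as a real power. [folklore] -/
theorem natpow_div_natpow (a b : ℕ) : (2 : ℝ) ^ a / (2 : ℝ) ^ b = (2 : ℝ) ^ ((a : ℝ) - b) := by
  rw [two_pow_eq_rpow, two_pow_eq_rpow, two_rpow_div]

/-! ### Exponent bookkeeping: the bottom window -/

/-- **The bottom-window resonance condition from exponent inequalities.** With `M₁ = 2^{m₁}`,
`Λ' = 2(2^ν/M₁ + 2^ρ) ≤ 2^{lam}`, `ν ≤ 2^{lν}`, `θ = 2^{-θ₀}`, the closed form of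
`resBoundBottom_split_le` is `≤ 2^j θ²/64` as soon as five linear exponent inequalities hold.
[cite: Bourgain2013MoebiusWalsh, (2.19)–(2.22)] -/
theorem bottom_h4_of_exponents {j ν ρ m₁ x₀ c₀ lν lam θ₀ : ℕ}
    (hν : (ν : ℝ) ≤ (2 : ℝ) ^ lν) (hLam : 2 * ((2 : ℝ) ^ ν / (2 : ℝ) ^ m₁ + (2 : ℝ) ^ ρ) ≤ (2 : ℝ) ^ lam)
    (cB1 : (9 : ℝ) + lν + lam + 8 * (ν : ℝ) / 9 - m₁ ≤ -2 * (θ₀ : ℝ) - 4)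
    (cB2 : (9 : ℝ) + lν + lam + 17 * (ν : ℝ) / 9 - m₁ ≤ (j : ℝ) - 2 * θ₀ - 4)
    (cB3 : (9 : ℝ) + lν + lam + 8 * (ν : ℝ) / 9 ≤ (j : ℝ) - 2 * θ₀ - 4)
    (cC : (13 : ℝ) + lν + lam + (x₀ : ℝ) / 2 + 2 * θ₀ ≤ (c₀ : ℝ) / 6)
    (cD : (13 : ℝ) + lν + lam + 2 * θ₀ ≤ (x₀ : ℝ) / 9) :
    64 * ((2 ^ j : ℕ) * (2 * (2 : ℝ) ^ (-(walshSupExponent * c₀))) ^ 2 * (2 * ((2 : ℝ) ^ ν / (2 : ℝ) ^ m₁ + (2 ^ ρ : ℕ))) +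
        ((ν : ℕ) : ℝ) *
          ((((2 ^ j : ℕ) : ℝ) / (2 : ℝ) ^ m₁ + (2 : ℝ) ^ ν / (2 : ℝ) ^ m₁ + 1) *
              (8 * (2 * ((2 : ℝ) ^ ν / (2 : ℝ) ^ m₁ + (2 ^ ρ : ℕ)))) * (2 : ℝ) ^ (2 * walshL1Exponent * (ν : ℕ)) +
            4 * (2 ^ j : ℕ) * (2 * ((2 : ℝ) ^ ν / (2 : ℝ) ^ m₁ + (2 ^ ρ : ℕ))) * (2 * (2 : ℝ) ^ (-(walshSupExponent * c₀))) *
              (2 : ℝ) ^ (walshL1Exponent * x₀) +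
            8 * (2 ^ j : ℕ) * (2 * ((2 : ℝ) ^ ν / (2 : ℝ) ^ m₁ + (2 ^ ρ : ℕ))) * (2 : ℝ) ^ ((2 * walshL1Exponent - 1) * x₀))) ≤
      2 ^ j * ((2 : ℝ) ^ (-(θ₀ : ℝ))) ^ 2 := by
  -- notation
  set N : ℝ := (2 : ℝ) ^ j with hN
  have hNr : N = (2 : ℝ) ^ (j : ℝ) := by rw [hN, two_pow_eq_rpow]
  set Lam : ℝ := 2 * ((2 : ℝ) ^ ν / (2 : ℝ) ^ m₁ + (2 : ℝ) ^ ρ) with hLamdef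
  have hLam' : Lam ≤ (2 : ℝ) ^ (lam : ℝ) := by rw [← two_pow_eq_rpow]; exact hLam
  have hLam0 : 0 ≤ Lam := by positivity
  set η₀ : ℝ := 2 * (2 : ℝ) ^ (-(walshSupExponent * c₀)) with hη₀
  have hη₀le : η₀ ≤ (2 : ℝ) ^ (1 - (c₀ : ℝ) / 6) := eta_le_rpow c₀
  have hη₀0 : 0 ≤ η₀ := by positivity
  have hνr : (ν : ℝ) ≤ (2 : ℝ) ^ (lν : ℝ) := by rw [← two_pow_eq_rpow]; exact hν
  have hν0 : (0 : ℝ) ≤ ν := Nat.cast_nonneg ν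
  have hθ2 : ((2 : ℝ) ^ (-(θ₀ : ℝ))) ^ 2 = (2 : ℝ) ^ (-2 * (θ₀ : ℝ)) := by
    rw [← Real.rpow_natCast, ← Real.rpow_mul (by norm_num)]; norm_num; ring_nf
  have hM₁ : (2 : ℝ) ^ m₁ = (2 : ℝ) ^ (m₁ : ℝ) := two_pow_eq_rpow m₁
  have h2ν : (2 : ℝ) ^ ν = (2 : ℝ) ^ (ν : ℝ) := two_pow_eq_rpow ν
  have hkap : (2 : ℝ) ^ (2 * walshL1Exponent * (ν : ℕ)) ≤ (2 : ℝ) ^ (8 * (ν : ℝ) / 9) := by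
    have := rpow_kappa_le (2 * (ν : ℝ)) (by positivity)
    rw [show walshL1Exponent * (2 * (ν : ℝ)) = 2 * walshL1Exponent * (ν : ℕ) by ring] at this
    refine this.trans (le_of_eq ?_); ring_nf
  have hkx : (2 : ℝ) ^ (walshL1Exponent * x₀) ≤ (2 : ℝ) ^ ((x₀ : ℝ) / 2) := by
    refine two_rpow_mono ?_
    have := Literature.NumberTheory.LFunctions.MoebiusWalsh.walshL1Exponent_lt_half
    have hx : (0 : ℝ) ≤ x₀ := Nat.cast_nonneg x₀
    nlinarith
  have hkd : (2 : ℝ) ^ ((2 * walshL1Exponent - 1) * x₀) ≤ (2 : ℝ) ^ (-(x₀ : ℝ) / 9) :=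
    rpow_two_kappa_sub_one_le _ (Nat.cast_nonneg x₀)
  -- the target pieces, each `≤ N 2^{-2θ₀} / 16` (the first `≤ N 2^{-2θ₀}/4`)
  set G : ℝ := N * (2 : ℝ) ^ (-2 * (θ₀ : ℝ)) with hG
  have hG16 : ∀ x : ℝ, x ≤ -2 * (θ₀ : ℝ) - 4 → N * (2 : ℝ) ^ x ≤ G / 16 := by
    intro x hx
    rw [hG, show N * (2 : ℝ) ^ (-2 * (θ₀ : ℝ)) / 16 = N * (2 : ℝ) ^ (-2 * (θ₀ : ℝ) - 4) by
      rw [Real.rpow_sub two_pos]; norm_num; ring]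
    exact mul_le_mul_of_nonneg_left (two_rpow_mono hx) (by positivity)
  have hNle : N ≤ (2 : ℝ) ^ (j : ℝ) := hNr.le
  have hN0 : 0 ≤ N := by positivity
  have h64 : (64 : ℝ) ≤ (2 : ℝ) ^ (6 : ℝ) := by norm_num
  have h8 : (8 : ℝ) ≤ (2 : ℝ) ^ (3 : ℝ) := by norm_num
  have h4 : (4 : ℝ) ≤ (2 : ℝ) ^ (2 : ℝ) := by norm_num
  have hGdef : ∀ d : ℝ, (2 : ℝ) ^ ((j : ℝ) + (-2 * (θ₀ : ℝ) - d)) = G / (2 : ℝ) ^ d := by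
    intro d; rw [hG, hNr, two_rpow_mul, eq_div_iff (by positivity), two_rpow_mul]; ring_nf
  -- piece A: `64 N η₀² Λ ≤ G/4`
  have hη2 : η₀ ^ 2 ≤ (2 : ℝ) ^ (2 - (c₀ : ℝ) / 3) := by
    calc η₀ ^ 2 ≤ ((2 : ℝ) ^ (1 - (c₀ : ℝ) / 6)) ^ 2 := pow_le_pow_left₀ hη₀0 hη₀le 2
      _ = (2 : ℝ) ^ (2 - (c₀ : ℝ) / 3) := by
          rw [← Real.rpow_natCast, ← Real.rpow_mul (by norm_num)]; norm_num; ring_nf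
  have hA : 64 * (N * η₀ ^ 2 * Lam) ≤ G / (2 : ℝ) ^ (2 : ℝ) := by
    have h := mul_le_two_rpow_add h64 (mul_le_two_rpow_add (mul_le_two_rpow_add hNle hη2 (by positivity)) hLam'
      hLam0) (by positivity)
    refine h.trans ?_
    rw [← hGdef]; exact two_rpow_mono (by linarith)
  -- factor bounds
  have hNM : N / (2 : ℝ) ^ m₁ ≤ (2 : ℝ) ^ ((j : ℝ) - m₁) := by rw [hNr, hM₁, two_rpow_div]
  have hνM : (2 : ℝ) ^ ν / (2 : ℝ) ^ m₁ ≤ (2 : ℝ) ^ ((ν : ℝ) - m₁) := by rw [h2ν, hM₁, two_rpow_div]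
  have h1le : (1 : ℝ) ≤ (2 : ℝ) ^ (0 : ℝ) := by rw [Real.rpow_zero]
  -- piece B1: `64 ν (N/M₁) (8 Lam) 2^{2κν} ≤ G/16`
  have hB1 : 64 * ((ν : ℝ) * ((N / (2 : ℝ) ^ m₁) * (8 * Lam) * (2 : ℝ) ^ (2 * walshL1Exponent * (ν : ℕ)))) ≤
      G / (2 : ℝ) ^ (4 : ℝ) := by
    have h := mul_le_two_rpow_add h64 (mul_le_two_rpow_add hνr
      (mul_le_two_rpow_add (mul_le_two_rpow_add hNM (mul_le_two_rpow_add h8 hLam' hLam0) (by positivity)) hkap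
        (by positivity)) (by positivity)) (by positivity)
    refine h.trans ?_
    rw [← hGdef]; exact two_rpow_mono (by linarith)
  -- piece B2: `64 ν (2^ν/M₁) (8 Lam) 2^{2κν} ≤ G/16`
  have hB2 : 64 * ((ν : ℝ) * (((2 : ℝ) ^ ν / (2 : ℝ) ^ m₁) * (8 * Lam) * (2 : ℝ) ^ (2 * walshL1Exponent * (ν : ℕ)))) ≤
      G / (2 : ℝ) ^ (4 : ℝ) := by
    have h := mul_le_two_rpow_add h64 (mul_le_two_rpow_add hνr
      (mul_le_two_rpow_add (mul_le_two_rpow_add hνM (mul_le_two_rpow_add h8 hLam' hLam0) (by positivity)) hkap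
        (by positivity)) (by positivity)) (by positivity)
    refine h.trans ?_
    rw [← hGdef]; exact two_rpow_mono (by linarith)
  -- piece B3: `64 ν (8 Lam) 2^{2κν} ≤ G/16`
  have hB3 : 64 * ((ν : ℝ) * (1 * (8 * Lam) * (2 : ℝ) ^ (2 * walshL1Exponent * (ν : ℕ)))) ≤ G / (2 : ℝ) ^ (4 : ℝ) := by
    have h := mul_le_two_rpow_add h64 (mul_le_two_rpow_add hνr
      (mul_le_two_rpow_add (mul_le_two_rpow_add h1le (mul_le_two_rpow_add h8 hLam' hLam0) (by positivity)) hkap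
        (by positivity)) (by positivity)) (by positivity)
    refine h.trans ?_
    rw [← hGdef]; exact two_rpow_mono (by linarith)
  -- piece C: `64 ν (4 N Lam η₀ 2^{κx₀}) ≤ G/16`
  have hC : 64 * ((ν : ℝ) * (4 * N * Lam * η₀ * (2 : ℝ) ^ (walshL1Exponent * x₀))) ≤ G / (2 : ℝ) ^ (4 : ℝ) := by
    have h := mul_le_two_rpow_add h64 (mul_le_two_rpow_add hνr
      (mul_le_two_rpow_add (mul_le_two_rpow_add (mul_le_two_rpow_add (mul_le_two_rpow_add h4 hNle hN0) hLam' hLam0)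
        hη₀le hη₀0) hkx (by positivity)) (by positivity)) (by positivity)
    refine h.trans ?_
    rw [← hGdef]; exact two_rpow_mono (by linarith)
  -- piece D: `64 ν (8 N Lam 2^{(2κ-1)x₀}) ≤ G/16`
  have hD : 64 * ((ν : ℝ) * (8 * N * Lam * (2 : ℝ) ^ ((2 * walshL1Exponent - 1) * x₀))) ≤ G / (2 : ℝ) ^ (4 : ℝ) := by
    have h := mul_le_two_rpow_add h64 (mul_le_two_rpow_add hνr
      (mul_le_two_rpow_add (mul_le_two_rpow_add (mul_le_two_rpow_add h8 hNle hN0) hLam' hLam0) hkd (by positivity))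
      (by positivity)) (by positivity)
    refine h.trans ?_
    rw [← hGdef]; exact two_rpow_mono (by linarith)
  -- sum up
  have hG0 : 0 ≤ G := by rw [hG]; positivity
  have e16 : G / (2 : ℝ) ^ (4 : ℝ) = G / 16 := by norm_num
  have e4 : G / (2 : ℝ) ^ (2 : ℝ) = G / 4 := by norm_num
  rw [e16] at hB1 hB2 hB3 hC hD; rw [e4] at hA
  simp only [Nat.cast_pow, Nat.cast_ofNat]
  rw [hθ2, ← hG]
  have hexp : 64 * (N * η₀ ^ 2 * Lam + (ν : ℝ) * ((N / (2 : ℝ) ^ m₁ + (2 : ℝ) ^ ν / (2 : ℝ) ^ m₁ + 1) * (8 * Lam) *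
      (2 : ℝ) ^ (2 * walshL1Exponent * (ν : ℕ)) + 4 * N * Lam * η₀ * (2 : ℝ) ^ (walshL1Exponent * x₀) +
      8 * N * Lam * (2 : ℝ) ^ ((2 * walshL1Exponent - 1) * x₀))) =
      64 * (N * η₀ ^ 2 * Lam) +
        (64 * ((ν : ℝ) * ((N / (2 : ℝ) ^ m₁) * (8 * Lam) * (2 : ℝ) ^ (2 * walshL1Exponent * (ν : ℕ)))) +
         64 * ((ν : ℝ) * (((2 : ℝ) ^ ν / (2 : ℝ) ^ m₁) * (8 * Lam) * (2 : ℝ) ^ (2 * walshL1Exponent * (ν : ℕ)))) +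
         64 * ((ν : ℝ) * (1 * (8 * Lam) * (2 : ℝ) ^ (2 * walshL1Exponent * (ν : ℕ))))) +
        64 * ((ν : ℝ) * (4 * N * Lam * η₀ * (2 : ℝ) ^ (walshL1Exponent * x₀))) +
        64 * ((ν : ℝ) * (8 * N * Lam * (2 : ℝ) ^ ((2 * walshL1Exponent - 1) * x₀))) := by ring
  rw [hexp]
  linarith

/-! ### Exponent bookkeeping: the restricted sums -/

/-- `resSumBound` of the windows in closed exponent form: with `V = 2^{ν+t}`, `L = 2^ρ`,
`P = 2^{K+ν}/2^K`, `C_int = 2^{t+4}`, and `2τP + 1 ≤ 2^{A}`,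
`RS(τ) ≤ 2^{t+ρ+2} · 2^{t+4} · 2^{A/2}`. [folklore] -/
theorem resSumBound_le_rpow {ν t ρ K A : ℕ} {τ : ℝ} (hτ : 0 ≤ τ)
    (hA : 2 * τ * ((2 : ℝ) ^ (K + ν) / (2 ^ K : ℕ)) + 1 ≤ (2 : ℝ) ^ A) :
    resSumBound (2 ^ (ν + t)) (2 ^ ρ) ((2 : ℝ) ^ (K + ν) / (2 ^ K : ℕ)) (2 ^ (t + 4)) walshL1Exponent τ ≤
      (2 : ℝ) ^ ((t : ℝ) + ρ + 2 + (t + 4) + (A : ℝ) / 2) := by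
  unfold resSumBound
  have hP : (2 : ℝ) ^ (K + ν) / (2 ^ K : ℕ) = (2 : ℝ) ^ ν := by
    push_cast; rw [pow_add]; field_simp
  rw [hP] at hA ⊢
  have h1 : 2 * ((2 ^ (ν + t) : ℕ) : ℝ) * ((2 ^ ρ : ℕ) : ℝ) / (2 : ℝ) ^ ν + 2 ≤ (2 : ℝ) ^ ((t : ℝ) + ρ + 2) := by
    have e : 2 * ((2 ^ (ν + t) : ℕ) : ℝ) * ((2 ^ ρ : ℕ) : ℝ) / (2 : ℝ) ^ ν = (2 : ℝ) ^ (t + ρ + 1) := by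
      push_cast; rw [pow_add, pow_add, pow_add, pow_one]; field_simp
    rw [e, show (2 : ℝ) ^ ((t : ℝ) + ρ + 2) = (2 : ℝ) ^ (t + ρ + 1) * 2 by
      rw [← Real.rpow_natCast, ← Real.rpow_add_one two_ne_zero]; push_cast; ring_nf]
    have : (2 : ℝ) ≤ (2 : ℝ) ^ (t + ρ + 1) := by
      calc (2 : ℝ) = 2 ^ 1 := by norm_num
        _ ≤ 2 ^ (t + ρ + 1) := pow_le_pow_right₀ (by norm_num) (by omega)
    linarith
  have h2 : (2 : ℝ) ^ (t + 4) * (2 * τ * (2 : ℝ) ^ ν + 1) ^ walshL1Exponent ≤ (2 : ℝ) ^ (((t : ℝ) + 4) + (A : ℝ) / 2) := by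
    rw [← two_rpow_mul]
    refine mul_le_mul (le_of_eq (by rw [two_pow_eq_rpow]; push_cast; ring_nf)) ?_ (by positivity) (by positivity)
    calc (2 * τ * (2 : ℝ) ^ ν + 1) ^ walshL1Exponent ≤ ((2 : ℝ) ^ A) ^ walshL1Exponent :=
          Real.rpow_le_rpow (by positivity) hA walshL1Exponent_pos.le
      _ = (2 : ℝ) ^ ((A : ℝ) * walshL1Exponent) := by rw [two_pow_eq_rpow, ← Real.rpow_mul (by norm_num)]
      _ ≤ (2 : ℝ) ^ ((A : ℝ) / 2) := two_rpow_mono (by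
          have := Literature.NumberTheory.LFunctions.MoebiusWalsh.walshL1Exponent_lt_half
          have hA0 : (0 : ℝ) ≤ A := Nat.cast_nonneg A
          nlinarith)
  calc _ ≤ (2 : ℝ) ^ ((t : ℝ) + ρ + 2) * (2 : ℝ) ^ (((t : ℝ) + 4) + (A : ℝ) / 2) :=
        mul_le_mul h1 h2 (by positivity) (by positivity)
    _ = _ := by rw [two_rpow_mul]; ring_nf

/-- `2VL/P + 2 ≤ 2^{t+ρ+2}` for `V = 2^{ν+t}`, `L = 2^ρ`, `P = 2^{K+ν}/2^K`. [folklore] -/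
theorem twoVLP_le (ν t ρ K : ℕ) :
    2 * ((2 ^ (ν + t) : ℕ) : ℝ) * ((2 ^ ρ : ℕ) : ℝ) / ((2 : ℝ) ^ (K + ν) / (2 ^ K : ℕ)) + 2 ≤ (2 : ℝ) ^ ((t : ℝ) + ρ + 2) := by
  have hP : (2 : ℝ) ^ (K + ν) / (2 ^ K : ℕ) = (2 : ℝ) ^ ν := by push_cast; rw [pow_add]; field_simp
  rw [hP]
  have e : 2 * ((2 ^ (ν + t) : ℕ) : ℝ) * ((2 ^ ρ : ℕ) : ℝ) / (2 : ℝ) ^ ν = (2 : ℝ) ^ (t + ρ + 1) := by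
    push_cast; rw [pow_add, pow_add, pow_add, pow_one]; field_simp
  rw [e, show (2 : ℝ) ^ ((t : ℝ) + ρ + 2) = (2 : ℝ) ^ (t + ρ + 1) * 2 by
    rw [← Real.rpow_natCast, ← Real.rpow_add_one two_ne_zero]; push_cast; ring_nf]
  have : (2 : ℝ) ≤ (2 : ℝ) ^ (t + ρ + 1) := by
    calc (2 : ℝ) = 2 ^ 1 := by norm_num
      _ ≤ 2 ^ (t + ρ + 1) := pow_le_pow_right₀ (by norm_num) (by omega)
  linarith

/-- **The sup-route term** `e₀ · N · RS(τ_{e₀}) · 2·2^{e₀} · η₀ ≤ 2^j θ²/4096` from exponent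
inequalities (`2τ_{e₀}P + 1 ≤ 2^{Ae}` via `ν + 3 − m₁ ≤ Ae`, `e₀ + 5 + j − K ≤ Ae`).
[cite: Bourgain2013MoebiusWalsh, (2.27)] -/
theorem supTerm_le {j ν t ρ K m₁ c₀ e₀ le Ae θ₀ : ℕ} (hm₁ : m₁ ≤ ν + 1) (hKe : K ≤ e₀ + 3 + j)
    (hle : (e₀ : ℝ) ≤ (2 : ℝ) ^ le) (hAe1 : ν + 3 - m₁ ≤ Ae) (hAe2 : e₀ + 5 + j - K ≤ Ae)
    (cT3 : (22 : ℝ) + le + 2 * t + ρ + (Ae : ℝ) / 2 + e₀ - (c₀ : ℝ) / 6 ≤ -2 * (θ₀ : ℝ)) :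
    64 * ((e₀ : ℝ) * (((2 ^ j : ℕ) : ℝ) *
        resSumBound (2 ^ (ν + t)) (2 ^ ρ : ℕ) ((2 : ℝ) ^ (K + ν) / (2 ^ K : ℕ)) (2 ^ (t + 4)) walshL1Exponent
          (1 / (2 : ℝ) ^ m₁ + 2 ^ (e₀ + 1) * (((2 ^ j : ℕ) + (2 ^ j : ℕ) : ℕ) : ℝ) / (2 : ℝ) ^ (K + ν)) *
        (2 * 2 ^ e₀ * (2 * (2 : ℝ) ^ (-(walshSupExponent * c₀)))))) ≤ 2 ^ j * ((2 : ℝ) ^ (-(θ₀ : ℝ))) ^ 2 / 64 := by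
  set N : ℝ := (2 : ℝ) ^ j with hN
  have hNr : N = (2 : ℝ) ^ (j : ℝ) := by rw [hN, two_pow_eq_rpow]
  have hNle : N ≤ (2 : ℝ) ^ (j : ℝ) := hNr.le
  set η₀ : ℝ := 2 * (2 : ℝ) ^ (-(walshSupExponent * c₀)) with hη₀
  have hη₀le : η₀ ≤ (2 : ℝ) ^ (1 - (c₀ : ℝ) / 6) := eta_le_rpow c₀
  have hη₀0 : 0 ≤ η₀ := by positivity
  have hθ2 : ((2 : ℝ) ^ (-(θ₀ : ℝ))) ^ 2 = (2 : ℝ) ^ (-2 * (θ₀ : ℝ)) := by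
    rw [← Real.rpow_natCast, ← Real.rpow_mul (by norm_num)]; norm_num; ring_nf
  have h64 : (64 : ℝ) ≤ (2 : ℝ) ^ (6 : ℝ) := by norm_num
  have h2le : (2 : ℝ) ≤ (2 : ℝ) ^ (1 : ℝ) := by norm_num
  have hP : (2 : ℝ) ^ (K + ν) / (2 ^ K : ℕ) = (2 : ℝ) ^ ν := by push_cast; rw [pow_add]; field_simp
  have hδP : 2 * (1 / (2 : ℝ) ^ m₁) * ((2 : ℝ) ^ (K + ν) / (2 ^ K : ℕ)) = (2 : ℝ) ^ (ν + 1 - m₁) := by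
    rw [hP, show ν + 1 - m₁ = (ν + 1) - m₁ from rfl, pow_sub₀ _ two_ne_zero (by omega), pow_succ]; field_simp
  have hτ0 : 0 ≤ 1 / (2 : ℝ) ^ m₁ + 2 ^ (e₀ + 1) * ((((2 ^ j : ℕ) + (2 ^ j : ℕ) : ℕ)) : ℝ) / (2 : ℝ) ^ (K + ν) := by positivity
  have hAe : 2 * (1 / (2 : ℝ) ^ m₁ + 2 ^ (e₀ + 1) * ((((2 ^ j : ℕ) + (2 ^ j : ℕ) : ℕ)) : ℝ) / (2 : ℝ) ^ (K + ν)) *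
      ((2 : ℝ) ^ (K + ν) / (2 ^ K : ℕ)) + 1 ≤ (2 : ℝ) ^ Ae := by
    have e1 : 2 * (1 / (2 : ℝ) ^ m₁ + 2 ^ (e₀ + 1) * ((((2 ^ j : ℕ) + (2 ^ j : ℕ) : ℕ)) : ℝ) / (2 : ℝ) ^ (K + ν)) *
        ((2 : ℝ) ^ (K + ν) / (2 ^ K : ℕ)) =
        2 * (1 / (2 : ℝ) ^ m₁) * ((2 : ℝ) ^ (K + ν) / (2 ^ K : ℕ)) + (2 : ℝ) ^ (e₀ + 3 + j - K) := by
      rw [hP]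
      have hK' : (2 : ℝ) ^ (e₀ + 3 + j - K) * (2 : ℝ) ^ K = (2 : ℝ) ^ (e₀ + 3 + j) := by
        rw [← pow_add]; congr 1; omega
      push_cast
      rw [show (2 : ℝ) ^ (K + ν) = (2 : ℝ) ^ K * (2 : ℝ) ^ ν by rw [pow_add]]
      field_simp
      calc (2 : ℝ) * (2 ^ K * 2 ^ ν + 2 ^ m₁ * 2 ^ (e₀ + 1) * 2 ^ j * (1 + 1))
          = 2 ^ K * (2 * 2 ^ ν) + 2 ^ m₁ * ((2 : ℝ) ^ (e₀ + 3 + j - K) * 2 ^ K) := by rw [hK']; ring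
        _ = _ := by ring
    rw [e1, hδP]
    have h1 : (2 : ℝ) ^ (ν + 1 - m₁) ≤ (2 : ℝ) ^ (Ae - 2) := pow_le_pow_right₀ (by norm_num) (by omega)
    have h2 : (2 : ℝ) ^ (e₀ + 3 + j - K) ≤ (2 : ℝ) ^ (Ae - 2) := pow_le_pow_right₀ (by norm_num) (by omega)
    have h3 : (1 : ℝ) ≤ (2 : ℝ) ^ (Ae - 2) := one_le_pow₀ (by norm_num)
    have h4 : (2 : ℝ) ^ (Ae - 2) * 4 ≤ (2 : ℝ) ^ Ae := by
      rw [show (4 : ℝ) = 2 ^ 2 by norm_num, ← pow_add]; exact pow_le_pow_right₀ (by norm_num) (by omega)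
    linarith
  have hRSτ := resSumBound_le_rpow (ν := ν) (t := t) (ρ := ρ) (K := K) hτ0 hAe
  set RSτ := resSumBound (2 ^ (ν + t)) (2 ^ ρ) ((2 : ℝ) ^ (K + ν) / (2 ^ K : ℕ)) (2 ^ (t + 4)) walshL1Exponent
      (1 / (2 : ℝ) ^ m₁ + 2 ^ (e₀ + 1) * ((((2 ^ j : ℕ) + (2 ^ j : ℕ) : ℕ)) : ℝ) / (2 : ℝ) ^ (K + ν)) with hRSτdef
  have hRSτ0 : 0 ≤ RSτ := by rw [hRSτdef]; unfold resSumBound; positivity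
  have hler : (e₀ : ℝ) ≤ (2 : ℝ) ^ (le : ℝ) := by rw [← two_pow_eq_rpow]; exact hle
  have h2e₀ : 2 * (2 : ℝ) ^ e₀ * η₀ ≤ (2 : ℝ) ^ ((1 : ℝ) + e₀ + (1 - (c₀ : ℝ) / 6)) :=
    mul_le_two_rpow_add (mul_le_two_rpow_add h2le (natpow_le_rpow (le_refl (e₀ : ℝ))) (by positivity)) hη₀le hη₀0
  have h := mul_le_two_rpow_add h64 (mul_le_two_rpow_add hler
    (mul_le_two_rpow_add (mul_le_two_rpow_add hNle hRSτ hRSτ0) h2e₀ (by positivity)) (by positivity)) (by positivity)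
  have hfin : (2 : ℝ) ^ ((6 : ℝ) + ((le : ℝ) + (((j : ℝ) + ((t : ℝ) + ρ + 2 + ((t : ℝ) + 4) + (Ae : ℝ) / 2)) +
      ((1 : ℝ) + e₀ + (1 - (c₀ : ℝ) / 6))))) ≤ 2 ^ j * ((2 : ℝ) ^ (-(θ₀ : ℝ))) ^ 2 / 64 := by
    rw [hθ2, two_pow_eq_rpow j, two_rpow_mul, show (64 : ℝ) = (2 : ℝ) ^ (6 : ℝ) by norm_num, two_rpow_div]
    exact two_rpow_mono (by linarith)
  refine le_trans (le_of_eq ?_) (h.trans hfin)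
  rw [hRSτdef, hN]; push_cast; ring

/-! ### Exponent bookkeeping: a middle window, four-monomial form -/

set_option maxHeartbeats 2000000 in
/-- **The middle-window resonance condition (four-monomial closed form) from exponent
inequalities** (`M₁ = 2^{m₁}`, `θ = 2^{-θ₀}`, `E₁ = ν + t + 1 ≤ 2^{lν}`, `m₁ ≤ ν + 1`, `K ≤ j + 4`;
the sup-route term is taken as an abstract hypothesis `hT3`, trivial when `e₀ = 0`).
[cite: Bourgain2013MoebiusWalsh, (2.23)–(2.27)] -/
theorem middle4_h4_of_exponents {j ν t ρ K m₁ c₀ e₀ lν θ₀ : ℕ} (hm₁ : m₁ ≤ ν + 1) (hKj : K ≤ j + 4)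
    (hν : ((ν + t + 1 : ℕ) : ℝ) ≤ (2 : ℝ) ^ lν)
    (cM1 : (13 : ℝ) + 2 * t + ρ + ((ν : ℝ) + 2 - m₁) / 2 - (c₀ : ℝ) / 6 ≤ -2 * (θ₀ : ℝ) - 4)
    (_cM2a : (18 : ℝ) + 2 * t + 8 * (ν : ℝ) / 9 + (j + 1 + t - K) + (K - m₁ - t) ≤ (j : ℝ) - 2 * θ₀)
    (cM2b : (18 : ℝ) + 2 * t + 8 * (ν : ℝ) / 9 + (j + 1 + t - K) ≤ (j : ℝ) - 2 * θ₀)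
    (cM2c : (19 : ℝ) + 2 * t + 8 * (ν : ℝ) / 9 + (K - m₁ - t) ≤ (j : ℝ) - 2 * θ₀)
    (_cM2d : (19 : ℝ) + 2 * t + 8 * (ν : ℝ) / 9 ≤ (j : ℝ) - 2 * θ₀)
    (cM3a : (22 : ℝ) + lν + 2 * t + 4 * (ν : ℝ) / 9 + 4 * ((ν : ℝ) + t + 1) / 9 - m₁ ≤ -2 * (θ₀ : ℝ))
    (cM3b : (21 : ℝ) + lν + 3 * t + 4 * (ν : ℝ) / 9 + 4 * ((ν : ℝ) + t + 1) / 9 + j - K ≤ (j : ℝ) - 2 * θ₀)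
    (cM3d : (21 : ℝ) + lν + 2 * t + 4 * (ν : ℝ) / 9 + 4 * ((ν : ℝ) + t + 1) / 9 ≤ (j : ℝ) - 2 * θ₀)
    (cP3 : (29 : ℝ) + lν + ((K : ℝ) + ν - m₁) + 3 * t + ρ + (4 + (j : ℝ) - K) / 2 - (e₀ : ℝ) / 9 ≤ (j : ℝ) - 2 * θ₀)
    (hT3 : 64 * ((e₀ : ℝ) * (((2 ^ j : ℕ) : ℝ) *
            resSumBound (2 ^ (ν + t)) (2 ^ ρ : ℕ) ((2 : ℝ) ^ (K + ν) / (2 ^ K : ℕ)) (2 ^ (t + 4)) walshL1Exponent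
              (1 / (2 : ℝ) ^ m₁ + 2 ^ (e₀ + 1) * (((2 ^ j : ℕ) + (2 ^ j : ℕ) : ℕ) : ℝ) / (2 : ℝ) ^ (K + ν)) *
            (2 * 2 ^ e₀ * (2 * (2 : ℝ) ^ (-(walshSupExponent * c₀)))))) ≤ 2 ^ j * ((2 : ℝ) ^ (-(θ₀ : ℝ))) ^ 2 / 64) :
    64 * ((2 ^ j : ℕ) * (2 * (2 : ℝ) ^ (-(walshSupExponent * c₀))) *
          resSumBound (2 ^ (ν + t)) (2 ^ ρ : ℕ) ((2 : ℝ) ^ (K + ν) / (2 ^ K : ℕ)) (2 ^ (t + 4)) walshL1Exponent (1 / (2 : ℝ) ^ m₁) +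
        (2 ^ (t + 3) * (2 : ℝ) ^ (walshL1Exponent * ν)) ^ 2 *
          ((((2 ^ j : ℕ) : ℝ) * (2 * (2 ^ (ν + t) : ℕ)) / (2 : ℝ) ^ (K + ν) + 2) *
            (2 * (1 / (2 : ℝ) ^ m₁) * (2 : ℝ) ^ (K + ν) / 2 ^ (ν + t + 1) + 1)) +
        ((e₀ : ℝ) * (((2 ^ j : ℕ) : ℝ) *
            resSumBound (2 ^ (ν + t)) (2 ^ ρ : ℕ) ((2 : ℝ) ^ (K + ν) / (2 ^ K : ℕ)) (2 ^ (t + 4)) walshL1Exponent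
              (1 / (2 : ℝ) ^ m₁ + 2 ^ (e₀ + 1) * (((2 ^ j : ℕ) + (2 ^ j : ℕ) : ℕ) : ℝ) / (2 : ℝ) ^ (K + ν)) *
            (2 * 2 ^ e₀ * (2 * (2 : ℝ) ^ (-(walshSupExponent * c₀))))) +
          (((ν + t + 1 : ℕ) : ℝ) * ((4 * (1 / (2 : ℝ) ^ m₁) * (2 ^ j : ℕ) + ((2 ^ j : ℕ) : ℝ) * 2 ^ (ν + t + 1) / (2 : ℝ) ^ (K + ν) + 2) *
              (2 ^ (t + 3) * (2 : ℝ) ^ (walshL1Exponent * ν)) * (2 * ((2 : ℝ) ^ (t + 4) * ((2 : ℝ) ^ (ν + t + 1)) ^ walshL1Exponent)) +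
            8 * ((1 / (2 : ℝ) ^ m₁) * (2 : ℝ) ^ (K + ν)) *
            ((2 * (2 ^ (ν + t) : ℕ) * (2 ^ ρ : ℕ) / ((2 : ℝ) ^ (K + ν) / (2 ^ K : ℕ)) + 2) * (2 : ℝ) ^ (t + 4)) *
            (2 : ℝ) ^ (t + 4) * (16 * (2 ^ j : ℕ) * ((2 : ℝ) ^ (K + ν) / (2 ^ K : ℕ)) / (2 : ℝ) ^ (K + ν)) ^ walshL1Exponent *
            ((2 : ℝ) ^ e₀) ^ (2 * walshL1Exponent - 1))))) ≤ 2 ^ j * ((2 : ℝ) ^ (-(θ₀ : ℝ))) ^ 2 := by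
  -- notation and factor bounds
  set N : ℝ := (2 : ℝ) ^ j with hN
  have hNr : N = (2 : ℝ) ^ (j : ℝ) := by rw [hN, two_pow_eq_rpow]
  have hNle : N ≤ (2 : ℝ) ^ (j : ℝ) := hNr.le
  have hN0 : 0 ≤ N := by positivity
  set η₀ : ℝ := 2 * (2 : ℝ) ^ (-(walshSupExponent * c₀)) with hη₀
  have hη₀le : η₀ ≤ (2 : ℝ) ^ (1 - (c₀ : ℝ) / 6) := eta_le_rpow c₀
  have hη₀0 : 0 ≤ η₀ := by positivity
  set η₁ : ℝ := 2 ^ (t + 3) * (2 : ℝ) ^ (walshL1Exponent * ν) with hη₁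
  have hη₁le : η₁ ≤ (2 : ℝ) ^ ((t : ℝ) + 3 + 4 * (ν : ℝ) / 9) := by
    rw [hη₁]; exact mul_le_two_rpow_add (natpow_le_rpow (by push_cast; exact le_rfl))
      (rpow_kappa_le _ (Nat.cast_nonneg ν)) (by positivity)
  have hη₁0 : 0 ≤ η₁ := by positivity
  have hη₁sq : η₁ ^ 2 ≤ (2 : ℝ) ^ (2 * (t : ℝ) + 6 + 8 * (ν : ℝ) / 9) := by
    calc η₁ ^ 2 ≤ ((2 : ℝ) ^ ((t : ℝ) + 3 + 4 * (ν : ℝ) / 9)) ^ 2 := pow_le_pow_left₀ hη₁0 hη₁le 2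
      _ = _ := by rw [← Real.rpow_natCast, ← Real.rpow_mul (by norm_num)]; push_cast; ring_nf
  have hθ2 : ((2 : ℝ) ^ (-(θ₀ : ℝ))) ^ 2 = (2 : ℝ) ^ (-2 * (θ₀ : ℝ)) := by
    rw [← Real.rpow_natCast, ← Real.rpow_mul (by norm_num)]; norm_num; ring_nf
  set G : ℝ := N * (2 : ℝ) ^ (-2 * (θ₀ : ℝ)) with hG
  have hGdef : ∀ d : ℝ, (2 : ℝ) ^ ((j : ℝ) + (-2 * (θ₀ : ℝ) - d)) = G / (2 : ℝ) ^ d := by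
    intro d; rw [hG, hNr, two_rpow_mul, eq_div_iff (by positivity), two_rpow_mul]; ring_nf
  have h64 : (64 : ℝ) ≤ (2 : ℝ) ^ (6 : ℝ) := by norm_num
  have h8 : (8 : ℝ) ≤ (2 : ℝ) ^ (3 : ℝ) := by norm_num
  have h2le : (2 : ℝ) ≤ (2 : ℝ) ^ (1 : ℝ) := by norm_num
  have hM₁ : (2 : ℝ) ^ m₁ = (2 : ℝ) ^ (m₁ : ℝ) := two_pow_eq_rpow m₁
  have hP : (2 : ℝ) ^ (K + ν) / (2 ^ K : ℕ) = (2 : ℝ) ^ ν := by push_cast; rw [pow_add]; field_simp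
  -- `RS(δ)`
  have hA2 : 2 * (1 / (2 : ℝ) ^ m₁) * ((2 : ℝ) ^ (K + ν) / (2 ^ K : ℕ)) + 1 ≤ (2 : ℝ) ^ (ν + 2 - m₁) := by
    rw [hP]
    have e : 2 * (1 / (2 : ℝ) ^ m₁) * (2 : ℝ) ^ ν = (2 : ℝ) ^ (ν + 1 - m₁) := by
      rw [show ν + 1 - m₁ = (ν + 1) - m₁ from rfl, pow_sub₀ _ two_ne_zero (by omega), pow_succ]; field_simp
    rw [e]
    have h1 : (1 : ℝ) ≤ (2 : ℝ) ^ (ν + 1 - m₁) := one_le_pow₀ (by norm_num)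
    calc (2 : ℝ) ^ (ν + 1 - m₁) + 1 ≤ (2 : ℝ) ^ (ν + 1 - m₁) * 2 := by linarith
      _ = (2 : ℝ) ^ (ν + 2 - m₁) := by rw [← pow_succ]; congr 1; omega
  have hRS := resSumBound_le_rpow (ν := ν) (t := t) (ρ := ρ) (K := K) (τ := 1 / (2 : ℝ) ^ m₁) (by positivity) hA2
  have hRS' : resSumBound (2 ^ (ν + t)) (2 ^ ρ) ((2 : ℝ) ^ (K + ν) / (2 ^ K : ℕ)) (2 ^ (t + 4)) walshL1Exponent
      (1 / (2 : ℝ) ^ m₁) ≤ (2 : ℝ) ^ ((t : ℝ) + ρ + 2 + (t + 4) + ((ν : ℝ) + 2 - m₁) / 2) := by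
    refine hRS.trans (two_rpow_mono ?_)
    have : (((ν + 2 - m₁ : ℕ)) : ℝ) = (ν : ℝ) + 2 - m₁ := by
      rw [Nat.cast_sub (by omega)]; push_cast; ring
    rw [this]
  have hRS0 : 0 ≤ resSumBound (2 ^ (ν + t)) (2 ^ ρ) ((2 : ℝ) ^ (K + ν) / (2 ^ K : ℕ)) (2 ^ (t + 4)) walshL1Exponent
      (1 / (2 : ℝ) ^ m₁) := by unfold resSumBound; positivity
  -- term 1
  have hT1 : 64 * (N * η₀ * resSumBound (2 ^ (ν + t)) (2 ^ ρ) ((2 : ℝ) ^ (K + ν) / (2 ^ K : ℕ)) (2 ^ (t + 4))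
      walshL1Exponent (1 / (2 : ℝ) ^ m₁)) ≤ G / (2 : ℝ) ^ (4 : ℝ) := by
    have h := mul_le_two_rpow_add h64 (mul_le_two_rpow_add (mul_le_two_rpow_add hNle hη₀le hη₀0) hRS' hRS0) (by positivity)
    refine h.trans ?_
    rw [← hGdef]; exact two_rpow_mono (by linarith)
  -- term 2
  have ha : ((2 ^ j : ℕ) : ℝ) * (2 * (2 ^ (ν + t) : ℕ)) / (2 : ℝ) ^ (K + ν) ≤ (2 : ℝ) ^ ((j : ℝ) + 1 + t - K) := by
    refine le_of_eq ?_
    push_cast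
    rw [show (2 : ℝ) ^ j * (2 * (2 : ℝ) ^ (ν + t)) / (2 : ℝ) ^ (K + ν) = (2 : ℝ) ^ (j + 1 + (ν + t)) / (2 : ℝ) ^ (K + ν) by ring,
      natpow_div_natpow]
    push_cast; ring_nf
  have hb : 2 * (1 / (2 : ℝ) ^ m₁) * (2 : ℝ) ^ (K + ν) / 2 ^ (ν + t + 1) ≤ (2 : ℝ) ^ ((K : ℝ) - m₁ - t) := by
    refine le_of_eq ?_
    rw [show 2 * (1 / (2 : ℝ) ^ m₁) * (2 : ℝ) ^ (K + ν) / 2 ^ (ν + t + 1) =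
      ((2 : ℝ) ^ (K + ν + 1) / (2 : ℝ) ^ (ν + t + 1)) / (2 : ℝ) ^ m₁ by field_simp; ring,
      natpow_div_natpow, two_pow_eq_rpow, two_rpow_div]
    push_cast; ring_nf
  have ha0 : 0 ≤ ((2 ^ j : ℕ) : ℝ) * (2 * (2 ^ (ν + t) : ℕ)) / (2 : ℝ) ^ (K + ν) := by positivity
  have hb0 : 0 ≤ 2 * (1 / (2 : ℝ) ^ m₁) * (2 : ℝ) ^ (K + ν) / 2 ^ (ν + t + 1) := by positivity
  set a : ℝ := ((2 ^ j : ℕ) : ℝ) * (2 * (2 ^ (ν + t) : ℕ)) / (2 : ℝ) ^ (K + ν) with hadef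
  set b : ℝ := 2 * (1 / (2 : ℝ) ^ m₁) * (2 : ℝ) ^ (K + ν) / 2 ^ (ν + t + 1) with hbdef
  have hT2a : η₁ ^ 2 * (a * b) ≤ G / (2 : ℝ) ^ (12 : ℝ) := by
    have h := mul_le_two_rpow_add hη₁sq (mul_le_two_rpow_add ha hb hb0) (by positivity)
    refine h.trans ?_; rw [← hGdef]; exact two_rpow_mono (by linarith)
  have hT2b : η₁ ^ 2 * a ≤ G / (2 : ℝ) ^ (12 : ℝ) := by
    have h := mul_le_two_rpow_add hη₁sq ha ha0
    refine h.trans ?_; rw [← hGdef]; exact two_rpow_mono (by linarith)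
  have hT2c : η₁ ^ 2 * (2 * b) ≤ G / (2 : ℝ) ^ (12 : ℝ) := by
    have h := mul_le_two_rpow_add hη₁sq (mul_le_two_rpow_add h2le hb hb0) (by positivity)
    refine h.trans ?_; rw [← hGdef]; exact two_rpow_mono (by linarith)
  have hT2d : η₁ ^ 2 * 2 ≤ G / (2 : ℝ) ^ (12 : ℝ) := by
    have h := mul_le_two_rpow_add hη₁sq h2le (by norm_num)
    refine h.trans ?_; rw [← hGdef]; exact two_rpow_mono (by linarith)
  -- term 4, pieces `P1, P2, P4`: `(ν+t+1) · x · η₁ · BL₁`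
  have hνr : ((ν + t + 1 : ℕ) : ℝ) ≤ (2 : ℝ) ^ (lν : ℝ) := by rw [← two_pow_eq_rpow]; exact hν
  have hν0 : (0 : ℝ) ≤ ((ν + t + 1 : ℕ) : ℝ) := Nat.cast_nonneg _
  have hc1 : 4 * (1 / (2 : ℝ) ^ m₁) * (2 ^ j : ℕ) ≤ (2 : ℝ) ^ ((2 : ℝ) + j - m₁) := by
    refine le_of_eq ?_
    push_cast
    rw [show (4 : ℝ) * (1 / (2 : ℝ) ^ m₁) * (2 : ℝ) ^ j = (2 : ℝ) ^ (j + 2) / (2 : ℝ) ^ m₁ by field_simp; ring,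
      natpow_div_natpow]
    push_cast; ring_nf
  have hc2 : ((2 ^ j : ℕ) : ℝ) * 2 ^ (ν + t + 1) / (2 : ℝ) ^ (K + ν) ≤ (2 : ℝ) ^ ((j : ℝ) + 1 + t - K) := by
    refine le_of_eq ?_
    push_cast
    rw [← pow_add, natpow_div_natpow]; push_cast; ring_nf
  have hBL : 2 * ((2 : ℝ) ^ (t + 4) * ((2 : ℝ) ^ (ν + t + 1)) ^ walshL1Exponent) ≤
      (2 : ℝ) ^ ((1 : ℝ) + (((t : ℝ) + 4) + 4 * ((ν : ℝ) + t + 1) / 9)) := by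
    have hk : ((2 : ℝ) ^ (ν + t + 1)) ^ walshL1Exponent ≤ (2 : ℝ) ^ (4 * ((ν : ℝ) + t + 1) / 9) := by
      rw [two_pow_eq_rpow, ← Real.rpow_mul (by norm_num)]
      have := rpow_kappa_le (((ν + t + 1 : ℕ) : ℝ)) (Nat.cast_nonneg _)
      rw [mul_comm] at this
      push_cast at this ⊢
      exact this
    have hk0 : 0 ≤ ((2 : ℝ) ^ (ν + t + 1)) ^ walshL1Exponent := by positivity
    exact mul_le_two_rpow_add h2le (mul_le_two_rpow_add (natpow_le_rpow (by push_cast; exact le_rfl)) hk hk0) (by positivity)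
  have hBL0 : 0 ≤ 2 * ((2 : ℝ) ^ (t + 4) * ((2 : ℝ) ^ (ν + t + 1)) ^ walshL1Exponent) := by positivity
  set BL : ℝ := 2 * ((2 : ℝ) ^ (t + 4) * ((2 : ℝ) ^ (ν + t + 1)) ^ walshL1Exponent) with hBLdef
  have hPx : ∀ {x : ℝ} {e : ℝ}, x ≤ (2 : ℝ) ^ e → 0 ≤ x →
      (lν : ℝ) + (e + ((t : ℝ) + 3 + 4 * (ν : ℝ) / 9) + ((1 : ℝ) + (((t : ℝ) + 4) + 4 * ((ν : ℝ) + t + 1) / 9))) ≤ (j : ℝ) + (-2 * (θ₀ : ℝ) - 12) →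
      ((ν + t + 1 : ℕ) : ℝ) * (x * η₁ * BL) ≤ G / (2 : ℝ) ^ (12 : ℝ) := by
    intro x e hx hx0 hexp
    have h := mul_le_two_rpow_add hνr (mul_le_two_rpow_add (mul_le_two_rpow_add hx hη₁le hη₁0) hBL hBL0) (by positivity)
    refine h.trans ?_; rw [← hGdef]; exact two_rpow_mono (by linarith)
  have hP1 := hPx hc1 (by positivity) (by linarith)
  have hP2 := hPx hc2 (by positivity) (by linarith)
  have hP4 := hPx (x := 2) (e := 1) h2le (by norm_num) (by linarith)
  -- term 4, piece `P3`: `(ν+t+1) · 8δQ · VLC · Cint · (16NP/Q)^κ · (2^{e₀})^{2κ-1}`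
  have hδQ : (1 / (2 : ℝ) ^ m₁) * (2 : ℝ) ^ (K + ν) ≤ (2 : ℝ) ^ ((K : ℝ) + ν - m₁) := by
    refine le_of_eq ?_
    rw [show (1 / (2 : ℝ) ^ m₁) * (2 : ℝ) ^ (K + ν) = (2 : ℝ) ^ (K + ν) / (2 : ℝ) ^ m₁ by field_simp, natpow_div_natpow]
    push_cast; ring_nf
  have hVLC : (2 * (2 ^ (ν + t) : ℕ) * (2 ^ ρ : ℕ) / ((2 : ℝ) ^ (K + ν) / (2 ^ K : ℕ)) + 2) * (2 : ℝ) ^ (t + 4) ≤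
      (2 : ℝ) ^ (((t : ℝ) + ρ + 2) + ((t : ℝ) + 4)) := by
    refine mul_le_two_rpow_add ?_ (natpow_le_rpow (by push_cast; exact le_rfl)) (by positivity)
    have := twoVLP_le ν t ρ K
    push_cast at this ⊢
    exact this
  have hCint : (2 : ℝ) ^ (t + 4) ≤ (2 : ℝ) ^ ((t : ℝ) + 4) := natpow_le_rpow (by push_cast; exact le_rfl)
  have hNPQ : (16 * (2 ^ j : ℕ) * ((2 : ℝ) ^ (K + ν) / (2 ^ K : ℕ)) / (2 : ℝ) ^ (K + ν)) ^ walshL1Exponent ≤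
      (2 : ℝ) ^ ((4 + (j : ℝ) - K) / 2) := by
    have e : 16 * ((2 ^ j : ℕ) : ℝ) * ((2 : ℝ) ^ (K + ν) / (2 ^ K : ℕ)) / (2 : ℝ) ^ (K + ν) = (2 : ℝ) ^ ((4 : ℝ) + j - K) := by
      rw [hP]; push_cast
      rw [show (16 : ℝ) * 2 ^ j * 2 ^ ν / 2 ^ (K + ν) = (2 : ℝ) ^ (4 + j + ν) / (2 : ℝ) ^ (K + ν) by norm_num; ring,
        natpow_div_natpow]; push_cast; ring_nf
    rw [e, ← Real.rpow_mul (by norm_num)]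
    refine two_rpow_mono ?_
    have := Literature.NumberTheory.LFunctions.MoebiusWalsh.walshL1Exponent_lt_half
    have h0 : (0 : ℝ) ≤ (4 : ℝ) + j - K := by
      have : (K : ℝ) ≤ j + 4 := by exact_mod_cast hKj
      linarith
    nlinarith
  have hNPQ0 : 0 ≤ (16 * (2 ^ j : ℕ) * ((2 : ℝ) ^ (K + ν) / (2 ^ K : ℕ)) / (2 : ℝ) ^ (K + ν)) ^ walshL1Exponent := by
    positivity
  have hdec : ((2 : ℝ) ^ e₀) ^ (2 * walshL1Exponent - 1) ≤ (2 : ℝ) ^ (-(e₀ : ℝ) / 9) := by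
    rw [two_pow_eq_rpow, ← Real.rpow_mul (by norm_num), mul_comm]
    exact rpow_two_kappa_sub_one_le _ (Nat.cast_nonneg e₀)
  have hdec0 : 0 ≤ ((2 : ℝ) ^ e₀) ^ (2 * walshL1Exponent - 1) := by positivity
  set P3 : ℝ := 8 * ((1 / (2 : ℝ) ^ m₁) * (2 : ℝ) ^ (K + ν)) *
      ((2 * (2 ^ (ν + t) : ℕ) * (2 ^ ρ : ℕ) / ((2 : ℝ) ^ (K + ν) / (2 ^ K : ℕ)) + 2) * (2 : ℝ) ^ (t + 4)) *
      (2 : ℝ) ^ (t + 4) * (16 * (2 ^ j : ℕ) * ((2 : ℝ) ^ (K + ν) / (2 ^ K : ℕ)) / (2 : ℝ) ^ (K + ν)) ^ walshL1Exponent *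
      ((2 : ℝ) ^ e₀) ^ (2 * walshL1Exponent - 1) with hP3def
  have hP3 : ((ν + t + 1 : ℕ) : ℝ) * P3 ≤ G / (2 : ℝ) ^ (12 : ℝ) := by
    have h := mul_le_two_rpow_add hνr
      (mul_le_two_rpow_add (mul_le_two_rpow_add (mul_le_two_rpow_add (mul_le_two_rpow_add
        (mul_le_two_rpow_add h8 hδQ (by positivity)) hVLC (by positivity)) hCint (by positivity)) hNPQ hNPQ0) hdec hdec0)
      (by positivity)
    refine h.trans ?_; rw [← hGdef]; exact two_rpow_mono (by linarith)
  -- sum up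
  have e16 : G / (2 : ℝ) ^ (4 : ℝ) = G / 16 := by norm_num
  have e4096 : G / (2 : ℝ) ^ (12 : ℝ) = G / 4096 := by norm_num
  rw [e16] at hT1; rw [e4096] at hT2a hT2b hT2c hT2d hP1 hP2 hP4 hP3
  have hG0 : 0 ≤ G := by rw [hG]; positivity
  set RSB := resSumBound (2 ^ (ν + t)) (2 ^ ρ) ((2 : ℝ) ^ (K + ν) / (2 ^ K : ℕ)) (2 ^ (t + 4)) walshL1Exponent
      (1 / (2 : ℝ) ^ m₁) with hRSB
  set T3 : ℝ := (e₀ : ℝ) * (((2 ^ j : ℕ) : ℝ) *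
      resSumBound (2 ^ (ν + t)) (2 ^ ρ : ℕ) ((2 : ℝ) ^ (K + ν) / (2 ^ K : ℕ)) (2 ^ (t + 4)) walshL1Exponent
        (1 / (2 : ℝ) ^ m₁ + 2 ^ (e₀ + 1) * (((2 ^ j : ℕ) + (2 ^ j : ℕ) : ℕ) : ℝ) / (2 : ℝ) ^ (K + ν)) *
      (2 * 2 ^ e₀ * (2 * (2 : ℝ) ^ (-(walshSupExponent * c₀))))) with hT3def
  have hT3' : 64 * T3 ≤ G / 64 := by
    have := hT3
    rw [hθ2] at this
    rw [hG, hN]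
    simpa [hT3def] using this
  have hfinal : 64 * (N * η₀ * RSB + η₁ ^ 2 * ((a + 2) * (b + 1)) +
      (T3 + ((ν + t + 1 : ℕ) : ℝ) * ((4 * (1 / (2 : ℝ) ^ m₁) * N + N * 2 ^ (ν + t + 1) / (2 : ℝ) ^ (K + ν) + 2) * η₁ * BL + P3))) ≤ G := by
    have hsplit : 64 * (N * η₀ * RSB + η₁ ^ 2 * ((a + 2) * (b + 1)) +
        (T3 + ((ν + t + 1 : ℕ) : ℝ) * ((4 * (1 / (2 : ℝ) ^ m₁) * N + N * 2 ^ (ν + t + 1) / (2 : ℝ) ^ (K + ν) + 2) * η₁ * BL + P3))) =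
        64 * (N * η₀ * RSB) + 64 * (η₁ ^ 2 * (a * b)) + 64 * (η₁ ^ 2 * a) + 64 * (η₁ ^ 2 * (2 * b)) + 64 * (η₁ ^ 2 * 2) +
        64 * T3 +
        64 * (((ν + t + 1 : ℕ) : ℝ) * ((4 * (1 / (2 : ℝ) ^ m₁) * (2 ^ j : ℕ)) * η₁ * BL)) +
        64 * (((ν + t + 1 : ℕ) : ℝ) * ((((2 ^ j : ℕ) : ℝ) * 2 ^ (ν + t + 1) / (2 : ℝ) ^ (K + ν)) * η₁ * BL)) +
        64 * (((ν + t + 1 : ℕ) : ℝ) * (2 * η₁ * BL)) +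
        64 * (((ν + t + 1 : ℕ) : ℝ) * P3) := by
      rw [hN]; push_cast; ring
    rw [hsplit]
    linarith
  refine le_trans (le_of_eq ?_) (hfinal.trans (le_of_eq ?_))
  · rw [hRSB, hT3def, hP3def, hBLdef, hN]; push_cast; ring
  · rw [hG, hN, hθ2]

/-! ### Exponent bookkeeping: the top window -/


set_option maxHeartbeats 2000000 in
/-- **The top-window resonance condition from exponent inequalities** (`M₁ = 2^{m₁}`,
`θ = 2^{-θ₀}`, `K + ν = i + j + 3`, `e₀ ≤ 2^{le}`, `E₁ ≤ 2^{lE}`, `m₁ ≤ ν + 1`,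
`2τ_{e₀}P + 1 ≤ 2^{Ae}`). [cite: Bourgain2013MoebiusWalsh, (2.23)–(2.27)] -/
theorem top_h4_of_exponents {i j ν t ρ K m₁ c₀ e₀ E₁ le lE Ae θ₀ : ℕ} (hm₁ : m₁ ≤ ν + 1) (hKν : K + ν = i + j + 3)
    (hKj : K ≤ j + 4) (hle : (e₀ : ℝ) ≤ (2 : ℝ) ^ le) (hlE : (E₁ : ℝ) ≤ (2 : ℝ) ^ lE) (hKe : K ≤ e₀ + 3 + j)
    (hAe1 : ν + 3 - m₁ ≤ Ae) (hAe2 : e₀ + 5 + j - K ≤ Ae)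
    (cT1 : (13 : ℝ) + 2 * t + ρ + ((ν : ℝ) + 2 - m₁) / 2 - (c₀ : ℝ) / 6 ≤ -2 * (θ₀ : ℝ) - 4)
    (cT2a : (19 : ℝ) + 2 * t + 8 * (ν : ℝ) / 9 + (j + 1 + t - K) + (1 + K + ν - m₁ - E₁) ≤ (j : ℝ) - 2 * θ₀)
    (cT2b : (19 : ℝ) + 2 * t + 8 * (ν : ℝ) / 9 + (j + 1 + t - K) ≤ (j : ℝ) - 2 * θ₀)
    (cT2c : (20 : ℝ) + 2 * t + 8 * (ν : ℝ) / 9 + (1 + K + ν - m₁ - E₁) ≤ (j : ℝ) - 2 * θ₀)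
    (cT2d : (20 : ℝ) + 2 * t + 8 * (ν : ℝ) / 9 ≤ (j : ℝ) - 2 * θ₀)
    (cT3 : (22 : ℝ) + le + 2 * t + ρ + (Ae : ℝ) / 2 + e₀ - (c₀ : ℝ) / 6 ≤ -2 * (θ₀ : ℝ))
    (cT4 : (33 : ℝ) + lE + (K + ν - m₁) + 3 * t + ρ + (4 + (j : ℝ) - K) / 2 - (e₀ : ℝ) / 9 ≤ (j : ℝ) - 2 * θ₀) :
    64 * ((2 ^ j : ℕ) * (2 * (2 : ℝ) ^ (-(walshSupExponent * c₀))) *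
          resSumBound (2 ^ (ν + t)) (2 ^ ρ : ℕ) ((2 : ℝ) ^ (K + ν) / (2 ^ K : ℕ)) (2 ^ (t + 4)) walshL1Exponent (1 / (2 : ℝ) ^ m₁) +
        (2 ^ (t + 3) * (2 : ℝ) ^ (walshL1Exponent * ν)) ^ 2 *
          ((((2 ^ j : ℕ) : ℝ) * (2 * (2 ^ (ν + t) : ℕ)) / (2 : ℝ) ^ (K + ν) + 2) *
            (2 * (1 / (2 : ℝ) ^ m₁) * (2 : ℝ) ^ (K + ν) / 2 ^ E₁ + 1)) +
        ((e₀ : ℝ) * (((2 ^ j : ℕ) : ℝ) *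
            resSumBound (2 ^ (ν + t)) (2 ^ ρ : ℕ) ((2 : ℝ) ^ (K + ν) / (2 ^ K : ℕ)) (2 ^ (t + 4)) walshL1Exponent
              (1 / (2 : ℝ) ^ m₁ + 2 ^ (e₀ + 1) * (((2 ^ j : ℕ) + (2 ^ j : ℕ) : ℕ) : ℝ) / (2 : ℝ) ^ (K + ν)) *
            (2 * 2 ^ e₀ * (2 * (2 : ℝ) ^ (-(walshSupExponent * c₀))))) +
          ((E₁ : ℝ) * (32 * ((1 / (2 : ℝ) ^ m₁) * (2 : ℝ) ^ (K + ν)) *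
            ((2 * (2 ^ (ν + t) : ℕ) * (2 ^ ρ : ℕ) / ((2 : ℝ) ^ (K + ν) / (2 ^ K : ℕ)) + 2) * (2 : ℝ) ^ (t + 4)) *
            (2 : ℝ) ^ (t + 4) * (16 * (2 ^ j : ℕ) * ((2 : ℝ) ^ (K + ν) / (2 ^ K : ℕ)) / (2 : ℝ) ^ (K + ν)) ^ walshL1Exponent *
            ((2 : ℝ) ^ e₀) ^ (2 * walshL1Exponent - 1))))) ≤ 2 ^ j * ((2 : ℝ) ^ (-(θ₀ : ℝ))) ^ 2 := by
  -- notation and factor bounds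
  set N : ℝ := (2 : ℝ) ^ j with hN
  have hNr : N = (2 : ℝ) ^ (j : ℝ) := by rw [hN, two_pow_eq_rpow]
  have hNle : N ≤ (2 : ℝ) ^ (j : ℝ) := hNr.le
  have hN0 : 0 ≤ N := by positivity
  set η₀ : ℝ := 2 * (2 : ℝ) ^ (-(walshSupExponent * c₀)) with hη₀
  have hη₀le : η₀ ≤ (2 : ℝ) ^ (1 - (c₀ : ℝ) / 6) := eta_le_rpow c₀
  have hη₀0 : 0 ≤ η₀ := by positivity
  set η₁ : ℝ := 2 ^ (t + 3) * (2 : ℝ) ^ (walshL1Exponent * ν) with hη₁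
  have hη₁le : η₁ ≤ (2 : ℝ) ^ ((t : ℝ) + 3 + 4 * (ν : ℝ) / 9) := by
    rw [hη₁]; exact mul_le_two_rpow_add (natpow_le_rpow (by push_cast; exact le_rfl))
      (rpow_kappa_le _ (Nat.cast_nonneg ν)) (by positivity)
  have hη₁0 : 0 ≤ η₁ := by positivity
  have hη₁sq : η₁ ^ 2 ≤ (2 : ℝ) ^ (2 * (t : ℝ) + 6 + 8 * (ν : ℝ) / 9) := by
    calc η₁ ^ 2 ≤ ((2 : ℝ) ^ ((t : ℝ) + 3 + 4 * (ν : ℝ) / 9)) ^ 2 := pow_le_pow_left₀ hη₁0 hη₁le 2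
      _ = _ := by rw [← Real.rpow_natCast, ← Real.rpow_mul (by norm_num)]; push_cast; ring_nf
  have hθ2 : ((2 : ℝ) ^ (-(θ₀ : ℝ))) ^ 2 = (2 : ℝ) ^ (-2 * (θ₀ : ℝ)) := by
    rw [← Real.rpow_natCast, ← Real.rpow_mul (by norm_num)]; norm_num; ring_nf
  set G : ℝ := N * (2 : ℝ) ^ (-2 * (θ₀ : ℝ)) with hG
  have hGdef : ∀ d : ℝ, (2 : ℝ) ^ ((j : ℝ) + (-2 * (θ₀ : ℝ) - d)) = G / (2 : ℝ) ^ d := by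
    intro d; rw [hG, hNr, two_rpow_mul, eq_div_iff (by positivity), two_rpow_mul]; ring_nf
  have h64 : (64 : ℝ) ≤ (2 : ℝ) ^ (6 : ℝ) := by norm_num
  have h32 : (32 : ℝ) ≤ (2 : ℝ) ^ (5 : ℝ) := by norm_num
  have h2le : (2 : ℝ) ≤ (2 : ℝ) ^ (1 : ℝ) := by norm_num
  have hM₁ : (2 : ℝ) ^ m₁ = (2 : ℝ) ^ (m₁ : ℝ) := two_pow_eq_rpow m₁
  have hP : (2 : ℝ) ^ (K + ν) / (2 ^ K : ℕ) = (2 : ℝ) ^ ν := by push_cast; rw [pow_add]; field_simp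
  -- `RS(δ)`
  have hδP : 2 * (1 / (2 : ℝ) ^ m₁) * ((2 : ℝ) ^ (K + ν) / (2 ^ K : ℕ)) = (2 : ℝ) ^ (ν + 1 - m₁) := by
    rw [hP, show ν + 1 - m₁ = (ν + 1) - m₁ from rfl, pow_sub₀ _ two_ne_zero (by omega), pow_succ]; field_simp
  have hA2 : 2 * (1 / (2 : ℝ) ^ m₁) * ((2 : ℝ) ^ (K + ν) / (2 ^ K : ℕ)) + 1 ≤ (2 : ℝ) ^ (ν + 2 - m₁) := by
    rw [hδP]
    have h1 : (1 : ℝ) ≤ (2 : ℝ) ^ (ν + 1 - m₁) := one_le_pow₀ (by norm_num)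
    calc (2 : ℝ) ^ (ν + 1 - m₁) + 1 ≤ (2 : ℝ) ^ (ν + 1 - m₁) * 2 := by linarith
      _ = (2 : ℝ) ^ (ν + 2 - m₁) := by rw [← pow_succ]; congr 1; omega
  have hRS := resSumBound_le_rpow (ν := ν) (t := t) (ρ := ρ) (K := K) (τ := 1 / (2 : ℝ) ^ m₁) (by positivity) hA2
  have hRS' : resSumBound (2 ^ (ν + t)) (2 ^ ρ) ((2 : ℝ) ^ (K + ν) / (2 ^ K : ℕ)) (2 ^ (t + 4)) walshL1Exponent
      (1 / (2 : ℝ) ^ m₁) ≤ (2 : ℝ) ^ ((t : ℝ) + ρ + 2 + (t + 4) + ((ν : ℝ) + 2 - m₁) / 2) := by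
    refine hRS.trans (two_rpow_mono ?_)
    have : (((ν + 2 - m₁ : ℕ)) : ℝ) = (ν : ℝ) + 2 - m₁ := by
      rw [Nat.cast_sub (by omega)]; push_cast; ring
    rw [this]
  have hRS0 : 0 ≤ resSumBound (2 ^ (ν + t)) (2 ^ ρ) ((2 : ℝ) ^ (K + ν) / (2 ^ K : ℕ)) (2 ^ (t + 4)) walshL1Exponent
      (1 / (2 : ℝ) ^ m₁) := by unfold resSumBound; positivity
  -- term 1
  have hT1 : 64 * (N * η₀ * resSumBound (2 ^ (ν + t)) (2 ^ ρ) ((2 : ℝ) ^ (K + ν) / (2 ^ K : ℕ)) (2 ^ (t + 4))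
      walshL1Exponent (1 / (2 : ℝ) ^ m₁)) ≤ G / (2 : ℝ) ^ (4 : ℝ) := by
    have h := mul_le_two_rpow_add h64 (mul_le_two_rpow_add (mul_le_two_rpow_add hNle hη₀le hη₀0) hRS' hRS0) (by positivity)
    refine h.trans ?_
    rw [← hGdef]; exact two_rpow_mono (by linarith)
  -- term 2
  have ha : ((2 ^ j : ℕ) : ℝ) * (2 * (2 ^ (ν + t) : ℕ)) / (2 : ℝ) ^ (K + ν) ≤ (2 : ℝ) ^ ((j : ℝ) + 1 + t - K) := by
    refine le_of_eq ?_
    push_cast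
    rw [show (2 : ℝ) ^ j * (2 * (2 : ℝ) ^ (ν + t)) / (2 : ℝ) ^ (K + ν) = (2 : ℝ) ^ (j + 1 + (ν + t)) / (2 : ℝ) ^ (K + ν) by ring,
      natpow_div_natpow]
    push_cast; ring_nf
  have hb : 2 * (1 / (2 : ℝ) ^ m₁) * (2 : ℝ) ^ (K + ν) / 2 ^ E₁ ≤ (2 : ℝ) ^ ((1 : ℝ) + K + ν - m₁ - E₁) := by
    refine le_of_eq ?_
    rw [show 2 * (1 / (2 : ℝ) ^ m₁) * (2 : ℝ) ^ (K + ν) / 2 ^ E₁ =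
      ((2 : ℝ) ^ (K + ν + 1) / (2 : ℝ) ^ E₁) / (2 : ℝ) ^ m₁ by field_simp; ring,
      natpow_div_natpow, two_pow_eq_rpow, two_rpow_div]
    push_cast; ring_nf
  have ha0 : 0 ≤ ((2 ^ j : ℕ) : ℝ) * (2 * (2 ^ (ν + t) : ℕ)) / (2 : ℝ) ^ (K + ν) := by positivity
  have hb0 : 0 ≤ 2 * (1 / (2 : ℝ) ^ m₁) * (2 : ℝ) ^ (K + ν) / 2 ^ E₁ := by positivity
  set a : ℝ := ((2 ^ j : ℕ) : ℝ) * (2 * (2 ^ (ν + t) : ℕ)) / (2 : ℝ) ^ (K + ν) with hadef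
  set b : ℝ := 2 * (1 / (2 : ℝ) ^ m₁) * (2 : ℝ) ^ (K + ν) / 2 ^ E₁ with hbdef
  have hT2a : η₁ ^ 2 * (a * b) ≤ G / (2 : ℝ) ^ (12 : ℝ) := by
    have h := mul_le_two_rpow_add hη₁sq (mul_le_two_rpow_add ha hb hb0) (by positivity)
    refine h.trans ?_; rw [← hGdef]; exact two_rpow_mono (by linarith)
  have hT2b : η₁ ^ 2 * a ≤ G / (2 : ℝ) ^ (12 : ℝ) := by
    have h := mul_le_two_rpow_add hη₁sq ha ha0
    refine h.trans ?_; rw [← hGdef]; exact two_rpow_mono (by linarith)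
  have hT2c : η₁ ^ 2 * (2 * b) ≤ G / (2 : ℝ) ^ (12 : ℝ) := by
    have h := mul_le_two_rpow_add hη₁sq (mul_le_two_rpow_add h2le hb hb0) (by positivity)
    refine h.trans ?_; rw [← hGdef]; exact two_rpow_mono (by linarith)
  have hT2d : η₁ ^ 2 * 2 ≤ G / (2 : ℝ) ^ (12 : ℝ) := by
    have h := mul_le_two_rpow_add hη₁sq h2le (by norm_num)
    refine h.trans ?_; rw [← hGdef]; exact two_rpow_mono (by linarith)
  -- term 3 : `e₀ · (N · RS(τ) · (2·2^{e₀}·η₀))`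
  have hτ0 : 0 ≤ 1 / (2 : ℝ) ^ m₁ + 2 ^ (e₀ + 1) * ((((2 ^ j : ℕ) + (2 ^ j : ℕ) : ℕ)) : ℝ) / (2 : ℝ) ^ (K + ν) := by positivity
  have hAe : 2 * (1 / (2 : ℝ) ^ m₁ + 2 ^ (e₀ + 1) * ((((2 ^ j : ℕ) + (2 ^ j : ℕ) : ℕ)) : ℝ) / (2 : ℝ) ^ (K + ν)) *
      ((2 : ℝ) ^ (K + ν) / (2 ^ K : ℕ)) + 1 ≤ (2 : ℝ) ^ Ae := by
    have e1 : 2 * (1 / (2 : ℝ) ^ m₁ + 2 ^ (e₀ + 1) * ((((2 ^ j : ℕ) + (2 ^ j : ℕ) : ℕ)) : ℝ) / (2 : ℝ) ^ (K + ν)) *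
        ((2 : ℝ) ^ (K + ν) / (2 ^ K : ℕ)) =
        2 * (1 / (2 : ℝ) ^ m₁) * ((2 : ℝ) ^ (K + ν) / (2 ^ K : ℕ)) + (2 : ℝ) ^ (e₀ + 3 + j - K) := by
      rw [hP]
      have hK' : (2 : ℝ) ^ (e₀ + 3 + j - K) * (2 : ℝ) ^ K = (2 : ℝ) ^ (e₀ + 3 + j) := by
        rw [← pow_add]; congr 1; omega
      push_cast
      rw [show (2 : ℝ) ^ (K + ν) = (2 : ℝ) ^ K * (2 : ℝ) ^ ν by rw [pow_add]]
      field_simp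
      calc (2 : ℝ) * (2 ^ K * 2 ^ ν + 2 ^ m₁ * 2 ^ (e₀ + 1) * 2 ^ j * (1 + 1))
          = 2 ^ K * (2 * 2 ^ ν) + 2 ^ m₁ * ((2 : ℝ) ^ (e₀ + 3 + j - K) * 2 ^ K) := by rw [hK']; ring
        _ = _ := by ring
    rw [e1, hδP]
    have h1 : (2 : ℝ) ^ (ν + 1 - m₁) ≤ (2 : ℝ) ^ (Ae - 2) := pow_le_pow_right₀ (by norm_num) (by omega)
    have h2 : (2 : ℝ) ^ (e₀ + 3 + j - K) ≤ (2 : ℝ) ^ (Ae - 2) := pow_le_pow_right₀ (by norm_num) (by omega)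
    have h3 : (1 : ℝ) ≤ (2 : ℝ) ^ (Ae - 2) := one_le_pow₀ (by norm_num)
    have h4 : (2 : ℝ) ^ (Ae - 2) * 4 ≤ (2 : ℝ) ^ Ae := by
      rw [show (4 : ℝ) = 2 ^ 2 by norm_num, ← pow_add]; exact pow_le_pow_right₀ (by norm_num) (by omega)
    linarith
  have hRSτ := resSumBound_le_rpow (ν := ν) (t := t) (ρ := ρ) (K := K) hτ0 hAe
  set RSτ := resSumBound (2 ^ (ν + t)) (2 ^ ρ) ((2 : ℝ) ^ (K + ν) / (2 ^ K : ℕ)) (2 ^ (t + 4)) walshL1Exponent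
      (1 / (2 : ℝ) ^ m₁ + 2 ^ (e₀ + 1) * ((((2 ^ j : ℕ) + (2 ^ j : ℕ) : ℕ)) : ℝ) / (2 : ℝ) ^ (K + ν)) with hRSτdef
  have hRSτ0 : 0 ≤ RSτ := by rw [hRSτdef]; unfold resSumBound; positivity
  have hler : (e₀ : ℝ) ≤ (2 : ℝ) ^ (le : ℝ) := by rw [← two_pow_eq_rpow]; exact hle
  have h2e₀ : 2 * (2 : ℝ) ^ e₀ * η₀ ≤ (2 : ℝ) ^ ((1 : ℝ) + e₀ + (1 - (c₀ : ℝ) / 6)) := by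
    have := mul_le_two_rpow_add (mul_le_two_rpow_add h2le (natpow_le_rpow (le_refl (e₀ : ℝ))) (by positivity)) hη₀le hη₀0
    exact this
  have hT3 : (e₀ : ℝ) * (N * RSτ * (2 * (2 : ℝ) ^ e₀ * η₀)) ≤ G / (2 : ℝ) ^ (12 : ℝ) := by
    have h := mul_le_two_rpow_add hler (mul_le_two_rpow_add (mul_le_two_rpow_add hNle hRSτ hRSτ0) h2e₀ (by positivity))
      (by positivity)
    refine h.trans ?_; rw [← hGdef]; exact two_rpow_mono (by linarith)
  -- term 4
  have hlEr : (E₁ : ℝ) ≤ (2 : ℝ) ^ (lE : ℝ) := by rw [← two_pow_eq_rpow]; exact hlE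
  have hδQ : (1 / (2 : ℝ) ^ m₁) * (2 : ℝ) ^ (K + ν) ≤ (2 : ℝ) ^ ((K : ℝ) + ν - m₁) := by
    refine le_of_eq ?_
    rw [show (1 / (2 : ℝ) ^ m₁) * (2 : ℝ) ^ (K + ν) = (2 : ℝ) ^ (K + ν) / (2 : ℝ) ^ m₁ by field_simp, natpow_div_natpow]
    push_cast; ring_nf
  have hVLC : (2 * (2 ^ (ν + t) : ℕ) * (2 ^ ρ : ℕ) / ((2 : ℝ) ^ (K + ν) / (2 ^ K : ℕ)) + 2) * (2 : ℝ) ^ (t + 4) ≤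
      (2 : ℝ) ^ (((t : ℝ) + ρ + 2) + ((t : ℝ) + 4)) := by
    refine mul_le_two_rpow_add ?_ (natpow_le_rpow (by push_cast; exact le_rfl)) (by positivity)
    have := twoVLP_le ν t ρ K
    push_cast at this ⊢
    exact this
  have hCint : (2 : ℝ) ^ (t + 4) ≤ (2 : ℝ) ^ ((t : ℝ) + 4) := natpow_le_rpow (by push_cast; exact le_rfl)
  have hNPQ : (16 * (2 ^ j : ℕ) * ((2 : ℝ) ^ (K + ν) / (2 ^ K : ℕ)) / (2 : ℝ) ^ (K + ν)) ^ walshL1Exponent ≤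
      (2 : ℝ) ^ ((4 + (j : ℝ) - K) / 2) := by
    have e : 16 * ((2 ^ j : ℕ) : ℝ) * ((2 : ℝ) ^ (K + ν) / (2 ^ K : ℕ)) / (2 : ℝ) ^ (K + ν) = (2 : ℝ) ^ ((4 : ℝ) + j - K) := by
      rw [hP]; push_cast
      rw [show (16 : ℝ) * 2 ^ j * 2 ^ ν / 2 ^ (K + ν) = (2 : ℝ) ^ (4 + j + ν) / (2 : ℝ) ^ (K + ν) by norm_num; ring,
        natpow_div_natpow]; push_cast; ring_nf
    rw [e, ← Real.rpow_mul (by norm_num)]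
    refine two_rpow_mono ?_
    have := Literature.NumberTheory.LFunctions.MoebiusWalsh.walshL1Exponent_lt_half
    have h0 : (0 : ℝ) ≤ (4 : ℝ) + j - K := by
      have : (K : ℝ) ≤ j + 4 := by exact_mod_cast hKj
      linarith
    nlinarith
  have hNPQ0 : 0 ≤ (16 * (2 ^ j : ℕ) * ((2 : ℝ) ^ (K + ν) / (2 ^ K : ℕ)) / (2 : ℝ) ^ (K + ν)) ^ walshL1Exponent := by
    positivity
  have hdec : ((2 : ℝ) ^ e₀) ^ (2 * walshL1Exponent - 1) ≤ (2 : ℝ) ^ (-(e₀ : ℝ) / 9) := by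
    rw [two_pow_eq_rpow, ← Real.rpow_mul (by norm_num), mul_comm]
    exact rpow_two_kappa_sub_one_le _ (Nat.cast_nonneg e₀)
  have hdec0 : 0 ≤ ((2 : ℝ) ^ e₀) ^ (2 * walshL1Exponent - 1) := by positivity
  have hT4 : (E₁ : ℝ) * (32 * ((1 / (2 : ℝ) ^ m₁) * (2 : ℝ) ^ (K + ν)) *
      ((2 * (2 ^ (ν + t) : ℕ) * (2 ^ ρ : ℕ) / ((2 : ℝ) ^ (K + ν) / (2 ^ K : ℕ)) + 2) * (2 : ℝ) ^ (t + 4)) *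
      (2 : ℝ) ^ (t + 4) * (16 * (2 ^ j : ℕ) * ((2 : ℝ) ^ (K + ν) / (2 ^ K : ℕ)) / (2 : ℝ) ^ (K + ν)) ^ walshL1Exponent *
      ((2 : ℝ) ^ e₀) ^ (2 * walshL1Exponent - 1)) ≤ G / (2 : ℝ) ^ (12 : ℝ) := by
    have h := mul_le_two_rpow_add hlEr
      (mul_le_two_rpow_add (mul_le_two_rpow_add (mul_le_two_rpow_add (mul_le_two_rpow_add
        (mul_le_two_rpow_add h32 hδQ (by positivity)) hVLC (by positivity)) hCint (by positivity)) hNPQ hNPQ0) hdec hdec0)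
      (by positivity)
    refine h.trans ?_; rw [← hGdef]; exact two_rpow_mono (by linarith)
  -- sum up
  have e16 : G / (2 : ℝ) ^ (4 : ℝ) = G / 16 := by norm_num
  have e4096 : G / (2 : ℝ) ^ (12 : ℝ) = G / 4096 := by norm_num
  rw [e16] at hT1; rw [e4096] at hT2a hT2b hT2c hT2d hT3 hT4
  have hG0 : 0 ≤ G := by rw [hG]; positivity
  set RSB := resSumBound (2 ^ (ν + t)) (2 ^ ρ) ((2 : ℝ) ^ (K + ν) / (2 ^ K : ℕ)) (2 ^ (t + 4)) walshL1Exponent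
      (1 / (2 : ℝ) ^ m₁) with hRSB
  set T4 : ℝ := (E₁ : ℝ) * (32 * ((1 / (2 : ℝ) ^ m₁) * (2 : ℝ) ^ (K + ν)) *
      ((2 * (2 ^ (ν + t) : ℕ) * (2 ^ ρ : ℕ) / ((2 : ℝ) ^ (K + ν) / (2 ^ K : ℕ)) + 2) * (2 : ℝ) ^ (t + 4)) *
      (2 : ℝ) ^ (t + 4) * (16 * (2 ^ j : ℕ) * ((2 : ℝ) ^ (K + ν) / (2 ^ K : ℕ)) / (2 : ℝ) ^ (K + ν)) ^ walshL1Exponent *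
      ((2 : ℝ) ^ e₀) ^ (2 * walshL1Exponent - 1)) with hT4def
  have hfinal : 64 * (N * η₀ * RSB + η₁ ^ 2 * ((a + 2) * (b + 1)) +
      ((e₀ : ℝ) * (N * RSτ * (2 * (2 : ℝ) ^ e₀ * η₀)) + T4)) ≤ G := by
    have hsplit : 64 * (N * η₀ * RSB + η₁ ^ 2 * ((a + 2) * (b + 1)) +
        ((e₀ : ℝ) * (N * RSτ * (2 * (2 : ℝ) ^ e₀ * η₀)) + T4)) =
        64 * (N * η₀ * RSB) + 64 * (η₁ ^ 2 * (a * b)) + 64 * (η₁ ^ 2 * a) + 64 * (η₁ ^ 2 * (2 * b)) + 64 * (η₁ ^ 2 * 2) +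
          64 * ((e₀ : ℝ) * (N * RSτ * (2 * (2 : ℝ) ^ e₀ * η₀))) + 64 * T4 := by ring
    rw [hsplit]
    linarith
  refine le_trans (le_of_eq ?_) (hfinal.trans (le_of_eq ?_))
  · rw [hRSB, hRSτdef, hT4def, hN]; push_cast; ring
  · rw [hG, hN, hθ2]

/-! ### The type-II box bound with the parameter scheme -/

set_option maxHeartbeats 4000000 in
/-- **The box bound with explicit parameters.** For a box `D_i × D_j` (`i ≤ j`), a digit set
`T ⊆ [0, i+j+3)`, a subset `T' ⊆ T` living above `K₁` (or below `ν₀`), `|β| ≤ 1`,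
`∑_{D_i} α² ≤ Dα`, and the parameter scheme `θ = 2^{-θ₀}`, `M₁ = W = 2^{m₁}`, `m₁ = i−E−2−a₀`,
`s = 4s₄`, `t = 8s₄`, `ν₀ = i+2+ρ+E`, `ν_t = i+ρ+4`, the linear exponent conditions below give
`|boxSum T i j α β| ≤ √Dα · √(2^i) · 2^j · 2^{-θ₀}`. [cite: Bourgain2013MoebiusWalsh, (2.29)–(2.33)] -/
theorem box_param {T T' : Finset ℕ} (hT'T : T' ⊆ T) {α β : ℕ → ℝ} {Dα : ℝ}
    {i j ρ E a₀ s₄ e₀ x₀ c₀ K₁ K₂ Kc θ₀ lg Ae AeM : ℕ} (hα : ∑ a ∈ dyBlock i, α a ^ 2 ≤ Dα) (hβ : ∀ b, |β b| ≤ 1)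
    (hT : ∀ u ∈ T, u < i + j + 3)
    -- structure
    (hi : 1 ≤ i) (hρ : 2 * θ₀ + 4 ≤ ρ) (hρ2 : 2 ≤ ρ) (hE : 2 * θ₀ + 11 ≤ E) (hij : i ≤ j)
    (ha : E + 2 + a₀ + 1 ≤ i) (hρi : ρ ≤ i + 2) (hjE : ρ + E + 5 ≤ j)
    (hK₁ : i + 2 - ρ ≤ K₁) (hK₂ : K₂ ≤ j - ρ - E - 5) (hKt : j - ρ - 1 ≤ K₂ + (i + 2 + ρ + E))
    (hK12 : K₁ ≤ K₂ ∨ j - ρ - 1 ≤ i + 2 + ρ + E)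
    (hlow : ∀ u ∈ T', u < i + 2 + ρ + E ∨ K₁ ≤ u)
    (ht : 8 * s₄ ≤ i + 2 - ρ) (ht' : 8 * s₄ ≤ j - ρ - 1) (he₀ : e₀ ≤ i + 3) (he₀' : E + a₀ + 4 ≤ e₀)
    (hcard : c₀ * ((K₂ - K₁) / (i + 2 + ρ + E) + 4) ≤ T'.card)
    -- sizes in powers of two
    (hn1 : ((i + 2 + ρ + E + 8 * s₄ + 1 : ℕ) : ℝ) ≤ (2 : ℝ) ^ lg) (hn2 : ((i + 3 : ℕ) : ℝ) ≤ (2 : ℝ) ^ lg)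
    (hLg : 1 + Real.log ((6 * 2 ^ i * 2 ^ j : ℕ)) ≤ (2 : ℝ) ^ lg)
    (hs₄ : 2 * θ₀ + lg + 11 ≤ s₄) (ha₀ : 2 * (8 * s₄) + (i + 2 + ρ + E) + 2 * θ₀ + 12 ≤ 2 ^ a₀)
    (hAe1 : (i + ρ + 4) + 3 - (i - E - 2 - a₀) ≤ Ae) (hAe2 : e₀ + ρ + 6 ≤ Ae)
    (hAeM1 : (i + 2 + ρ + E) + 3 - (i - E - 2 - a₀) ≤ AeM) (hAeM2 : e₀ + 5 + Kc ≤ AeM)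
    -- bottom window exponents (`ν₀ = i+2+ρ+E`, `lam = ρ+2E+a₀+6`, `m₁ = i-E-2-a₀`)
    (cB1 : (9 : ℝ) + lg + (ρ + 2 * E + a₀ + 6 : ℕ) + 8 * ((i + 2 + ρ + E : ℕ) : ℝ) / 9 - (i - E - 2 - a₀ : ℕ) ≤ -2 * (θ₀ : ℝ) - 4)
    (cB2 : (9 : ℝ) + lg + (ρ + 2 * E + a₀ + 6 : ℕ) + 17 * ((i + 2 + ρ + E : ℕ) : ℝ) / 9 - (i - E - 2 - a₀ : ℕ) ≤ (j : ℝ) - 2 * θ₀ - 4)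
    (cB3 : (9 : ℝ) + lg + (ρ + 2 * E + a₀ + 6 : ℕ) + 8 * ((i + 2 + ρ + E : ℕ) : ℝ) / 9 ≤ (j : ℝ) - 2 * θ₀ - 4)
    (cC : (13 : ℝ) + lg + (ρ + 2 * E + a₀ + 6 : ℕ) + (x₀ : ℝ) / 2 + 2 * θ₀ ≤ (c₀ : ℝ) / 6)
    (cD : (13 : ℝ) + lg + (ρ + 2 * E + a₀ + 6 : ℕ) + 2 * θ₀ ≤ (x₀ : ℝ) / 9)
    -- middle windows (`K₁ ≤ K ≤ j-ρ-E-5`)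
    (cM1 : (13 : ℝ) + 2 * (8 * s₄ : ℕ) + ρ + (((i + 2 + ρ + E : ℕ) : ℝ) + 2 - (i - E - 2 - a₀ : ℕ)) / 2 - (c₀ : ℝ) / 6 ≤ -2 * (θ₀ : ℝ) - 4)
    (cM2d : (19 : ℝ) + 2 * (8 * s₄ : ℕ) + 8 * ((i + 2 + ρ + E : ℕ) : ℝ) / 9 ≤ (j : ℝ) - 2 * θ₀)
    (cM3a : (22 : ℝ) + lg + 2 * (8 * s₄ : ℕ) + 4 * ((i + 2 + ρ + E : ℕ) : ℝ) / 9 +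
      4 * (((i + 2 + ρ + E : ℕ) : ℝ) + (8 * s₄ : ℕ) + 1) / 9 - (i - E - 2 - a₀ : ℕ) ≤ -2 * (θ₀ : ℝ))
    (cM3b : (21 : ℝ) + lg + 3 * (8 * s₄ : ℕ) + 4 * ((i + 2 + ρ + E : ℕ) : ℝ) / 9 +
      4 * (((i + 2 + ρ + E : ℕ) : ℝ) + (8 * s₄ : ℕ) + 1) / 9 + j - K₁ ≤ (j : ℝ) - 2 * θ₀)
    (cM2c : (19 : ℝ) + 2 * (8 * s₄ : ℕ) + 8 * ((i + 2 + ρ + E : ℕ) : ℝ) / 9 + ((K₂ : ℝ) - (i - E - 2 - a₀ : ℕ) - (8 * s₄ : ℕ)) ≤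
      (j : ℝ) - 2 * θ₀)
    (hKc : (62 : ℝ) + 2 * lg + 2 * (((i + 2 + ρ + E : ℕ) : ℝ) - (i - E - 2 - a₀ : ℕ)) + 6 * (8 * s₄ : ℕ) + 2 * ρ + 4 * θ₀ ≤ Kc)
    (he₀big : (31 : ℝ) + lg + (((i + 2 + ρ + E : ℕ) : ℝ) - (i - E - 2 - a₀ : ℕ)) + 3 * (8 * s₄ : ℕ) + ρ + 2 * θ₀ ≤ (e₀ : ℝ) / 9)
    (cT3M : (22 : ℝ) + lg + 2 * (8 * s₄ : ℕ) + ρ + (AeM : ℝ) / 2 + e₀ - (c₀ : ℝ) / 6 ≤ -2 * (θ₀ : ℝ))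
    (cM3d : (21 : ℝ) + lg + 2 * (8 * s₄ : ℕ) + 4 * ((i + 2 + ρ + E : ℕ) : ℝ) / 9 +
      4 * (((i + 2 + ρ + E : ℕ) : ℝ) + (8 * s₄ : ℕ) + 1) / 9 ≤ (j : ℝ) - 2 * θ₀)
    -- top window (`ν_t = i+ρ+4`, `K = j-ρ-1`, `E₁ = i+3`)
    (cT1 : (13 : ℝ) + 2 * (8 * s₄ : ℕ) + ρ + (((i + ρ + 4 : ℕ) : ℝ) + 2 - (i - E - 2 - a₀ : ℕ)) / 2 - (c₀ : ℝ) / 6 ≤ -2 * (θ₀ : ℝ) - 4)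
    (cT2a : (19 : ℝ) + 2 * (8 * s₄ : ℕ) + 8 * ((i + ρ + 4 : ℕ) : ℝ) / 9 + (j + 1 + (8 * s₄ : ℕ) - (j - ρ - 1 : ℕ)) +
      (1 + (j - ρ - 1 : ℕ) + (i + ρ + 4 : ℕ) - (i - E - 2 - a₀ : ℕ) - (i + 3 : ℕ)) ≤ (j : ℝ) - 2 * θ₀)
    (cT2b : (19 : ℝ) + 2 * (8 * s₄ : ℕ) + 8 * ((i + ρ + 4 : ℕ) : ℝ) / 9 + (j + 1 + (8 * s₄ : ℕ) - (j - ρ - 1 : ℕ)) ≤ (j : ℝ) - 2 * θ₀)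
    (cT2c : (20 : ℝ) + 2 * (8 * s₄ : ℕ) + 8 * ((i + ρ + 4 : ℕ) : ℝ) / 9 +
      (1 + (j - ρ - 1 : ℕ) + (i + ρ + 4 : ℕ) - (i - E - 2 - a₀ : ℕ) - (i + 3 : ℕ)) ≤ (j : ℝ) - 2 * θ₀)
    (cT2d : (20 : ℝ) + 2 * (8 * s₄ : ℕ) + 8 * ((i + ρ + 4 : ℕ) : ℝ) / 9 ≤ (j : ℝ) - 2 * θ₀)
    (cT3 : (22 : ℝ) + lg + 2 * (8 * s₄ : ℕ) + ρ + (Ae : ℝ) / 2 + e₀ - (c₀ : ℝ) / 6 ≤ -2 * (θ₀ : ℝ))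
    (cT4 : (33 : ℝ) + lg + ((j - ρ - 1 : ℕ) + (i + ρ + 4 : ℕ) - (i - E - 2 - a₀ : ℕ)) + 3 * (8 * s₄ : ℕ) + ρ +
      (4 + (j : ℝ) - (j - ρ - 1 : ℕ)) / 2 - (e₀ : ℝ) / 9 ≤ (j : ℝ) - 2 * θ₀) :
    |boxSum T i j α β| ≤ Real.sqrt Dα * Real.sqrt ((2 : ℝ) ^ i) * 2 ^ j * (2 : ℝ) ^ (-(θ₀ : ℝ)) := by
  set θ : ℝ := (2 : ℝ) ^ (-(θ₀ : ℝ)) with hθ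
  have hθ0 : 0 ≤ θ := by positivity
  have hθ2 : θ ^ 2 = (2 : ℝ) ^ (-2 * (θ₀ : ℝ)) := by
    rw [hθ, ← Real.rpow_natCast, ← Real.rpow_mul (by norm_num)]; norm_num; ring_nf
  -- h1, h2
  have h1 : 12 ≤ θ ^ 2 * 2 ^ ρ := by
    rw [hθ2, two_pow_eq_rpow, two_rpow_mul]
    have : (4 : ℝ) ≤ -2 * (θ₀ : ℝ) + ρ := by
      have : ((2 * θ₀ + 4 : ℕ) : ℝ) ≤ ρ := by exact_mod_cast hρ
      push_cast at this; linarith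
    calc (12 : ℝ) ≤ (2 : ℝ) ^ (4 : ℝ) := by norm_num
      _ ≤ _ := two_rpow_mono this
  have h2 : 1152 ≤ θ ^ 2 * 2 ^ E := by
    rw [hθ2, two_pow_eq_rpow, two_rpow_mul]
    have : (11 : ℝ) ≤ -2 * (θ₀ : ℝ) + E := by
      have : ((2 * θ₀ + 11 : ℕ) : ℝ) ≤ E := by exact_mod_cast hE
      push_cast at this; linarith
    calc (1152 : ℝ) ≤ (2 : ℝ) ^ (11 : ℝ) := by norm_num
      _ ≤ _ := two_rpow_mono this
  -- the tails `h5`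
  have h5 : ∀ (ν c : ℕ), (c : ℝ) + 4 * (ν : ℝ) / 9 ≤ (8 * s₄ : ℕ) + 3 + 4 * ((i + 2 + ρ + E : ℕ) : ℝ) / 9 →
      64 * ((1 / 2 : ℝ) ^ (2 ^ a₀) * (2 ^ c * (2 : ℝ) ^ (walshL1Exponent * (ν : ℕ))) ^ 2) ≤ θ ^ 2 := by
    intro ν c hc
    have hη : 2 ^ c * (2 : ℝ) ^ (walshL1Exponent * (ν : ℕ)) ≤ (2 : ℝ) ^ ((c : ℝ) + 4 * (ν : ℝ) / 9) :=
      mul_le_two_rpow_add (natpow_le_rpow le_rfl) (rpow_kappa_le _ (Nat.cast_nonneg ν)) (by positivity)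
    have hη2 : (2 ^ c * (2 : ℝ) ^ (walshL1Exponent * (ν : ℕ))) ^ 2 ≤ (2 : ℝ) ^ (2 * ((c : ℝ) + 4 * (ν : ℝ) / 9)) := by
      calc _ ≤ ((2 : ℝ) ^ ((c : ℝ) + 4 * (ν : ℝ) / 9)) ^ 2 := pow_le_pow_left₀ (by positivity) hη 2
        _ = _ := by rw [← Real.rpow_natCast, ← Real.rpow_mul (by norm_num)]; push_cast; ring_nf
    have hhalf : (1 / 2 : ℝ) ^ (2 ^ a₀) ≤ (2 : ℝ) ^ (-((2 ^ a₀ : ℕ) : ℝ)) :=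
      le_of_eq (by rw [one_div, inv_pow, Real.rpow_neg (by norm_num), ← two_pow_eq_rpow])
    have h64 : (64 : ℝ) ≤ (2 : ℝ) ^ (6 : ℝ) := by norm_num
    have h := mul_le_two_rpow_add h64 (mul_le_two_rpow_add hhalf hη2 (by positivity)) (by positivity)
    refine h.trans ?_
    rw [hθ2]; refine two_rpow_mono ?_
    have ha₀' : ((2 * (8 * s₄) + (i + 2 + ρ + E) + 2 * θ₀ + 12 : ℕ) : ℝ) ≤ ((2 ^ a₀ : ℕ) : ℝ) := by exact_mod_cast ha₀
    push_cast at ha₀' hc ⊢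
    linarith
  have hE2 : (2 : ℝ) ≤ E := by exact_mod_cast (show 2 ≤ E by omega)
  have h5b := h5 (i + 2 + ρ + E) 1 (by push_cast; linarith)
  have h5m := h5 (i + 2 + ρ + E) (8 * s₄ + 3) (by push_cast; linarith)
  have h5t := h5 (i + ρ + 4) (8 * s₄ + 3) (by push_cast; linarith)
  simp only [pow_one] at h5b
  -- Fejér errors
  have hLg1 : (1 : ℝ) ≤ (2 : ℝ) ^ lg := one_le_pow₀ (by norm_num)
  have hs₄r : 2 * (θ₀ : ℝ) + lg + 11 ≤ s₄ := by exact_mod_cast hs₄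
  have hfe : ∀ X : ℝ, X ≤ 12 * 2 ^ i * 2 ^ j * (2 : ℝ) ^ lg / (2 : ℝ) ^ s₄ → 64 * X ≤ 2 ^ i * 2 ^ j * θ ^ 2 := by
    intro X hX
    refine (mul_le_mul_of_nonneg_left hX (by norm_num)).trans ?_
    rw [hθ2, show (64 : ℝ) * (12 * 2 ^ i * 2 ^ j * (2 : ℝ) ^ lg / (2 : ℝ) ^ s₄) = 2 ^ i * 2 ^ j * (768 * ((2 : ℝ) ^ lg / (2 : ℝ) ^ s₄)) by ring]
    refine mul_le_mul_of_nonneg_left ?_ (by positivity)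
    rw [natpow_div_natpow]
    calc (768 : ℝ) * (2 : ℝ) ^ ((lg : ℝ) - s₄) ≤ (2 : ℝ) ^ (10 : ℝ) * (2 : ℝ) ^ ((lg : ℝ) - s₄) :=
          mul_le_mul_of_nonneg_right (by norm_num) (by positivity)
      _ = (2 : ℝ) ^ (10 + ((lg : ℝ) - s₄)) := two_rpow_mul _ _
      _ ≤ (2 : ℝ) ^ (-2 * (θ₀ : ℝ)) := two_rpow_mono (by linarith)
  have h3m : ∀ K ∈ Icc K₁ K₂, 64 * fejerErrMid i j K (i + 2 + ρ + E) (8 * s₄) (4 * s₄) ≤ 2 ^ i * 2 ^ j * θ ^ 2 := by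
    intro K hK
    have hK' := Finset.mem_Icc.mp hK
    exact hfe _ (fejerErrMid_le (ν := i + 2 + ρ + E) (by omega) hLg1 hLg)
  have h3t : 64 * fejerErrTop i j (j - ρ - 1) (i + ρ + 4) (8 * s₄) (4 * s₄) ≤ 2 ^ i * 2 ^ j * θ ^ 2 :=
    hfe _ (fejerErrTop_le (by omega) (by omega) hLg1 hLg)
  -- casts of `M₁`
  have hM₁c : (((2 ^ (i - E - 2 - a₀) : ℕ)) : ℝ) = (2 : ℝ) ^ (i - E - 2 - a₀) := by push_cast; rfl
  have hm₁r : ((i - E - 2 - a₀ : ℕ) : ℝ) = (i : ℝ) - E - 2 - a₀ := by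
    rw [show i - E - 2 - a₀ = i - (E + 2 + a₀) by omega, Nat.cast_sub (by omega)]; push_cast; ring
  have hν₀r : ((i + 2 + ρ + E : ℕ) : ℝ) ≤ (2 : ℝ) ^ lg := by
    refine le_trans ?_ hn1; exact_mod_cast (show i + 2 + ρ + E ≤ i + 2 + ρ + E + 8 * s₄ + 1 by omega)
  -- bottom window
  have hLam : 2 * ((2 : ℝ) ^ (i + 2 + ρ + E) / (2 : ℝ) ^ (i - E - 2 - a₀) + (2 : ℝ) ^ ρ) ≤ (2 : ℝ) ^ (ρ + 2 * E + a₀ + 6) := by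
    have e : (2 : ℝ) ^ (i + 2 + ρ + E) / (2 : ℝ) ^ (i - E - 2 - a₀) = (2 : ℝ) ^ (ρ + 2 * E + a₀ + 4) := by
      rw [div_eq_iff (by positivity), ← pow_add]; congr 1; omega
    rw [e]
    have h1' : (2 : ℝ) ^ ρ ≤ (2 : ℝ) ^ (ρ + 2 * E + a₀ + 4) := pow_le_pow_right₀ (by norm_num) (by omega)
    have h2' : (2 : ℝ) ^ (ρ + 2 * E + a₀ + 6) = (2 : ℝ) ^ (ρ + 2 * E + a₀ + 4) * 4 := by
      rw [show ρ + 2 * E + a₀ + 6 = (ρ + 2 * E + a₀ + 4) + 2 by omega, pow_add]; norm_num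
    rw [h2']; linarith
  have h4b' := bottom_h4_of_exponents (j := j) (ν := i + 2 + ρ + E) (ρ := ρ) (m₁ := i - E - 2 - a₀) (x₀ := x₀) (c₀ := c₀)
    (lν := lg) (lam := ρ + 2 * E + a₀ + 6) (θ₀ := θ₀) hν₀r hLam cB1 cB2 cB3 cC cD
  have hθ2' : ((2 : ℝ) ^ (-(θ₀ : ℝ))) ^ 2 = (2 : ℝ) ^ (-2 * (θ₀ : ℝ)) := by
    rw [← Real.rpow_natCast, ← Real.rpow_mul (by norm_num)]; norm_num; ring_nf
  have hW0 : (0 : ℝ) < (((2 ^ (i - E - 2 - a₀) : ℕ)) : ℝ) := by positivity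
  have h4b : ∀ c : ℕ, c₀ ≤ c → 64 * resBoundBottom (i + 2 + ρ + E) c (2 ^ j) (2 ^ ρ)
      (((2 ^ (i - E - 2 - a₀) : ℕ)) : ℝ) ≤ 2 ^ j * θ ^ 2 := by
    intro c hc
    have hres := resBoundBottom_split_le (i + 2 + ρ + E) c (2 ^ j) (2 ^ ρ) x₀ c₀ hc hW0
    refine le_trans (mul_le_mul_of_nonneg_left hres (by norm_num)) ?_
    have h := h4b'
    rw [hθ2'] at h; rw [hθ2]
    rw [hM₁c]; push_cast at h ⊢
    exact h
  -- middle windows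
  have h4m : ∀ K ∈ Icc K₁ K₂, ∀ c : ℕ, c₀ ≤ c → 64 * resBoundTop (i + 2 + ρ + E) (8 * s₄) c (2 ^ j) (2 ^ ρ)
      ((i + 2 + ρ + E) + 8 * s₄ + 1) K (((2 ^ (i - E - 2 - a₀) : ℕ)) : ℝ) ≤ 2 ^ j * θ ^ 2 := by
    intro K hK c hc
    have hK' := Finset.mem_Icc.mp hK
    have hKr : (K₁ : ℝ) ≤ K := by exact_mod_cast hK'.1
    have hKr' : (K : ℝ) ≤ ((K₂ : ℕ) : ℝ) := by exact_mod_cast hK'.2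
    have hK₂r : ((K₂ : ℕ) : ℝ) ≤ (j : ℝ) - ρ - E - 5 := by
      have h' : ((K₂ : ℕ) : ℝ) ≤ ((j - ρ - E - 5 : ℕ) : ℝ) := by exact_mod_cast hK₂
      rw [show j - ρ - E - 5 = j - (ρ + E + 5) by omega, Nat.cast_sub (by omega)] at h'
      push_cast at h'; linarith
    have hKj : K ≤ j + 4 := by omega
    have hρ0 : (0 : ℝ) ≤ ρ := Nat.cast_nonneg ρ
    have hE0 : (0 : ℝ) ≤ E := Nat.cast_nonneg E
    have hlg0 : (0 : ℝ) ≤ lg := Nat.cast_nonneg lg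
    have hθ₀0 : (0 : ℝ) ≤ θ₀ := Nat.cast_nonneg θ₀
    have hs₄0 : (0 : ℝ) ≤ s₄ := Nat.cast_nonneg s₄
    have hKcN : ρ + 2 * E + a₀ + 5 ≤ Kc := by
      have h' : ((ρ + 2 * E + a₀ + 5 : ℕ) : ℝ) ≤ Kc := by
        have h'' := hKc
        rw [hm₁r] at h''; push_cast at h'' ⊢; linarith
      exact_mod_cast h'
    -- the derived linear conditions
    have dM2a : (18 : ℝ) + 2 * (8 * s₄ : ℕ) + 8 * ((i + 2 + ρ + E : ℕ) : ℝ) / 9 + (j + 1 + (8 * s₄ : ℕ) - K) +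
        (K - (i - E - 2 - a₀ : ℕ) - (8 * s₄ : ℕ)) ≤ (j : ℝ) - 2 * θ₀ := by
      have h' := cM3a; push_cast at h' ⊢; linarith
    have dM2b : (18 : ℝ) + 2 * (8 * s₄ : ℕ) + 8 * ((i + 2 + ρ + E : ℕ) : ℝ) / 9 + (j + 1 + (8 * s₄ : ℕ) - K) ≤ (j : ℝ) - 2 * θ₀ := by
      have h' := cM3b; push_cast at h' ⊢; linarith
    have dM2c : (19 : ℝ) + 2 * (8 * s₄ : ℕ) + 8 * ((i + 2 + ρ + E : ℕ) : ℝ) / 9 + (K - (i - E - 2 - a₀ : ℕ) - (8 * s₄ : ℕ)) ≤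
        (j : ℝ) - 2 * θ₀ := by
      have h' := cM2c; push_cast at h' ⊢; linarith
    have dM3b : (21 : ℝ) + lg + 3 * (8 * s₄ : ℕ) + 4 * ((i + 2 + ρ + E : ℕ) : ℝ) / 9 +
        4 * (((i + 2 + ρ + E : ℕ) : ℝ) + (8 * s₄ : ℕ) + 1) / 9 + j - K ≤ (j : ℝ) - 2 * θ₀ := by
      have h' := cM3b; linarith
    -- `hA` for `e`: `2δP + 1 ≤ (8NP/Q) 2^e` as soon as `ν + 2 − m₁ ≤ 3 + j − K + e`
    have hPK : (2 : ℝ) ^ (K + (i + 2 + ρ + E)) / (2 ^ K : ℕ) = (2 : ℝ) ^ (i + 2 + ρ + E) := by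
      push_cast; rw [pow_add]; field_simp
    have hAe : ∀ e : ℕ, (i + 2 + ρ + E) + 2 - (i - E - 2 - a₀) + K ≤ 3 + j + e →
        2 * (1 / ((2 ^ (i - E - 2 - a₀) : ℕ) : ℝ)) * ((2 : ℝ) ^ (K + (i + 2 + ρ + E)) / (2 ^ K : ℕ)) + 1 ≤
        (8 * (2 ^ j : ℕ) * ((2 : ℝ) ^ (K + (i + 2 + ρ + E)) / (2 ^ K : ℕ)) / (2 : ℝ) ^ (K + (i + 2 + ρ + E))) * 2 ^ e := by
      intro e he
      rw [hPK]; push_cast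
      have e1 : 2 * (1 / (2 : ℝ) ^ (i - E - 2 - a₀)) * (2 : ℝ) ^ (i + 2 + ρ + E) = (2 : ℝ) ^ (ρ + 2 * E + a₀ + 5) := by
        rw [show (2 : ℝ) ^ (i + 2 + ρ + E) = (2 : ℝ) ^ (i - E - 2 - a₀) * (2 : ℝ) ^ (ρ + 2 * E + a₀ + 4) by
          rw [← pow_add]; congr 1; omega]
        field_simp; ring
      have e2 : 8 * (2 : ℝ) ^ j * (2 : ℝ) ^ (i + 2 + ρ + E) / (2 : ℝ) ^ (K + (i + 2 + ρ + E)) * 2 ^ e = (2 : ℝ) ^ (3 + j + e - K) := by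
        rw [pow_add (2 : ℝ) K, show (2 : ℝ) ^ (3 + j + e - K) = (2 : ℝ) ^ (3 + j + e) / (2 : ℝ) ^ K by
          rw [eq_div_iff (by positivity), ← pow_add]; congr 1; omega]
        rw [show (2 : ℝ) ^ (3 + j + e) = 8 * 2 ^ j * 2 ^ e by rw [pow_add, pow_add]; norm_num]
        field_simp
      rw [e1, e2]
      have h1' : (2 : ℝ) ^ (ρ + 2 * E + a₀ + 5) ≤ (2 : ℝ) ^ (3 + j + e - K - 1) := pow_le_pow_right₀ (by norm_num) (by omega)
      have h2' : (1 : ℝ) ≤ (2 : ℝ) ^ (3 + j + e - K - 1) := one_le_pow₀ (by norm_num)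
      have h3' : (2 : ℝ) ^ (3 + j + e - K) = (2 : ℝ) ^ (3 + j + e - K - 1) * 2 := by rw [← pow_succ]; congr 1; omega
      rw [h3']; linarith
    by_cases hlowK : K + Kc ≤ j
    · -- low regime: `e₀ = 0`, no sup route
      have hres := resBoundTop_split4_le (i + 2 + ρ + E) (8 * s₄) c (2 ^ j) (2 ^ ρ) ((i + 2 + ρ + E) + 8 * s₄ + 1) K 0 c₀
        hc hW0 (by omega) (hAe 0 (by omega))
      refine le_trans (mul_le_mul_of_nonneg_left hres (by norm_num)) ?_
      have hKcr : (K : ℝ) + Kc ≤ j := by exact_mod_cast hlowK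
      have dP3 : (29 : ℝ) + lg + ((K : ℝ) + (i + 2 + ρ + E : ℕ) - (i - E - 2 - a₀ : ℕ)) + 3 * (8 * s₄ : ℕ) + ρ +
          (4 + (j : ℝ) - K) / 2 - ((0 : ℕ) : ℝ) / 9 ≤ (j : ℝ) - 2 * θ₀ := by
        have h' := hKc; push_cast at h' ⊢; linarith
      have h := middle4_h4_of_exponents (j := j) (ν := i + 2 + ρ + E) (t := 8 * s₄) (ρ := ρ) (K := K) (m₁ := i - E - 2 - a₀)
        (c₀ := c₀) (e₀ := 0) (lν := lg) (θ₀ := θ₀) (by omega) hKj hn1 cM1 dM2a dM2b dM2c cM2d cM3a dM3b cM3d dP3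
        (by simp only [Nat.cast_zero, zero_mul, mul_zero]; positivity)
      rw [hθ2'] at h; rw [hθ2]
      rw [hM₁c]; push_cast at h ⊢
      exact h
    · -- high regime: sup route up to `e₀`
      have hKc' : j < K + Kc := not_le.mp hlowK
      have hres := resBoundTop_split4_le (i + 2 + ρ + E) (8 * s₄) c (2 ^ j) (2 ^ ρ) ((i + 2 + ρ + E) + 8 * s₄ + 1) K e₀ c₀
        hc hW0 (by omega) (hAe e₀ (by omega))
      refine le_trans (mul_le_mul_of_nonneg_left hres (by norm_num)) ?_
      have hKcr : (j : ℝ) < K + Kc := by exact_mod_cast hKc'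
      have hT3 := supTerm_le (j := j) (ν := i + 2 + ρ + E) (t := 8 * s₄) (ρ := ρ) (K := K) (m₁ := i - E - 2 - a₀)
        (c₀ := c₀) (e₀ := e₀) (le := lg) (Ae := AeM) (θ₀ := θ₀) (by omega) (by omega)
        (le_trans (by exact_mod_cast he₀) hn2) hAeM1 (by omega) cT3M
      have dP3 : (29 : ℝ) + lg + ((K : ℝ) + (i + 2 + ρ + E : ℕ) - (i - E - 2 - a₀ : ℕ)) + 3 * (8 * s₄ : ℕ) + ρ +
          (4 + (j : ℝ) - K) / 2 - (e₀ : ℝ) / 9 ≤ (j : ℝ) - 2 * θ₀ := by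
        have h' := he₀big; push_cast at h' ⊢; linarith
      have h := middle4_h4_of_exponents (j := j) (ν := i + 2 + ρ + E) (t := 8 * s₄) (ρ := ρ) (K := K) (m₁ := i - E - 2 - a₀)
        (c₀ := c₀) (e₀ := e₀) (lν := lg) (θ₀ := θ₀) (by omega) hKj hn1 cM1 dM2a dM2b dM2c cM2d cM3a dM3b cM3d dP3 hT3
      rw [hθ2'] at h; rw [hθ2]
      rw [hM₁c]; push_cast at h ⊢
      exact h
  -- top window
  have hi3 : ((i + 3 : ℕ) : ℝ) ≤ (2 : ℝ) ^ lg := hn2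
  have he₀r : (e₀ : ℝ) ≤ (2 : ℝ) ^ lg := le_trans (by exact_mod_cast he₀) hi3
  have h4t' := top_h4_of_exponents (i := i) (j := j) (ν := i + ρ + 4) (t := 8 * s₄) (ρ := ρ) (K := j - ρ - 1)
    (m₁ := i - E - 2 - a₀) (c₀ := c₀) (e₀ := e₀) (E₁ := i + 3) (le := lg) (lE := lg) (Ae := Ae) (θ₀ := θ₀)
    (by omega) (by omega) (by omega) he₀r hi3 (by omega) hAe1 (by omega) cT1 cT2a cT2b cT2c cT2d cT3 cT4
  have hKν : (j - ρ - 1) + (i + ρ + 4) = i + j + 3 := by omega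
  have hE₁ : (2 : ℝ) ^ (i + 3) * (2 ^ j : ℕ) ≤ 2 * (2 : ℝ) ^ ((j - ρ - 1) + (i + ρ + 4)) := by
    rw [hKν]; push_cast
    rw [show (2 : ℝ) ^ (i + 3) * 2 ^ j = 2 ^ (i + j + 3) by ring]
    have : (0 : ℝ) ≤ 2 ^ (i + j + 3) := by positivity
    linarith
  have hP : (2 : ℝ) ^ ((j - ρ - 1) + (i + ρ + 4)) / (2 ^ (j - ρ - 1) : ℕ) = (2 : ℝ) ^ (i + ρ + 4) := by
    push_cast; rw [pow_add]; field_simp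
  have hA : 2 * (1 / ((2 ^ (i - E - 2 - a₀) : ℕ) : ℝ)) * ((2 : ℝ) ^ ((j - ρ - 1) + (i + ρ + 4)) / (2 ^ (j - ρ - 1) : ℕ)) + 1 ≤
      (8 * (2 ^ j : ℕ) * ((2 : ℝ) ^ ((j - ρ - 1) + (i + ρ + 4)) / (2 ^ (j - ρ - 1) : ℕ)) / (2 : ℝ) ^ ((j - ρ - 1) + (i + ρ + 4))) * 2 ^ e₀ := by
    rw [hP, hKν]; push_cast
    have e1 : 2 * (1 / (2 : ℝ) ^ (i - E - 2 - a₀)) * (2 : ℝ) ^ (i + ρ + 4) = (2 : ℝ) ^ (ρ + E + a₀ + 7) := by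
      rw [show (2 : ℝ) ^ (i + ρ + 4) = (2 : ℝ) ^ (i - E - 2 - a₀) * (2 : ℝ) ^ (ρ + E + a₀ + 6) by rw [← pow_add]; congr 1; omega]
      field_simp; ring
    have e2 : 8 * (2 : ℝ) ^ j * (2 : ℝ) ^ (i + ρ + 4) / (2 : ℝ) ^ (i + j + 3) * 2 ^ e₀ = (2 : ℝ) ^ (ρ + 4 + e₀) := by
      rw [show (2 : ℝ) ^ (i + j + 3) = (2 : ℝ) ^ j * (2 : ℝ) ^ (i + 3) by rw [← pow_add]; congr 1; omega]
      rw [show (2 : ℝ) ^ (i + ρ + 4) = (2 : ℝ) ^ (i + 3) * (2 : ℝ) ^ (ρ + 1) by rw [← pow_add]; congr 1; omega]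
      rw [show (2 : ℝ) ^ (ρ + 4 + e₀) = 8 * (2 : ℝ) ^ (ρ + 1) * (2 : ℝ) ^ e₀ by rw [pow_add, pow_add]; norm_num; ring]
      field_simp
    rw [e1, e2]
    have h1' : (2 : ℝ) ^ (ρ + E + a₀ + 7) ≤ (2 : ℝ) ^ (ρ + 3 + e₀) := pow_le_pow_right₀ (by norm_num) (by omega)
    have h2' : (1 : ℝ) ≤ (2 : ℝ) ^ (ρ + 3 + e₀) := one_le_pow₀ (by norm_num)
    have h3' : (2 : ℝ) ^ (ρ + 4 + e₀) = (2 : ℝ) ^ (ρ + 3 + e₀) * 2 := by rw [← pow_succ]; congr 1; omega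
    rw [h3']; linarith
  have hB : (2 : ℝ) ^ (i + 3) ≤ 2 * (1 / ((2 ^ (i - E - 2 - a₀) : ℕ) : ℝ)) * (2 : ℝ) ^ ((j - ρ - 1) + (i + ρ + 4)) := by
    rw [hKν]; push_cast
    rw [show (2 : ℝ) ^ (i + j + 3) = (2 : ℝ) ^ (i - E - 2 - a₀) * (2 : ℝ) ^ (j + E + a₀ + 5) by rw [← pow_add]; congr 1; omega]
    have e : 2 * (1 / (2 : ℝ) ^ (i - E - 2 - a₀)) * ((2 : ℝ) ^ (i - E - 2 - a₀) * (2 : ℝ) ^ (j + E + a₀ + 5)) =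
        (2 : ℝ) ^ (j + E + a₀ + 6) := by rw [pow_succ _ (j + E + a₀ + 5)]; field_simp
    rw [e]; exact pow_le_pow_right₀ (by norm_num) (by omega)
  have h4t : ∀ c : ℕ, c₀ ≤ c → 64 * resBoundTop (i + ρ + 4) (8 * s₄) c (2 ^ j) (2 ^ ρ) (i + 3) (j - ρ - 1)
      (((2 ^ (i - E - 2 - a₀) : ℕ)) : ℝ) ≤ 2 ^ j * θ ^ 2 := by
    intro c hc
    have hres := resBoundTop_split_le (i + ρ + 4) (8 * s₄) c (2 ^ j) (2 ^ ρ) (i + 3) (j - ρ - 1) e₀ c₀ hc hW0 he₀ hE₁ hA hB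
    refine le_trans (mul_le_mul_of_nonneg_left hres (by norm_num)) ?_
    have h := h4t'
    rw [hθ2'] at h; rw [hθ2]
    rw [hM₁c]; push_cast at h ⊢
    exact h
  exact box_small_of_windows hT'T hα hβ hθ0 hT hi hρ2 hρi hjE hij ha hK₁ hK₂ hKt hK12 hlow (s := 4 * s₄)
    ht ht' hcard h1 h2 h4b h5b h3m h4m h5m h3t h4t h5t

end Literature.NumberTheory.LFunctions.MoebiusWalshResonance
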